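import Literature.MathematicalPhysics.QuantumFieldTheory.Balaban1983to89.B6HolderTermMultiLevelBox
import Literature.MathematicalPhysics.QuantumFieldTheory.Balaban1983to89.B6Prop22AdjMultiLevelBox
import Literature.MathematicalPhysics.QuantumFieldTheory.Balaban1983to89.B6Ineq243HolderDualTwoLevelBox
import Literature.MathematicalPhysics.QuantumFieldTheory.Balaban1983to89.B6Prop22DualHolderTwoLevelBox

/-!
# `Balaban1983to89.B6DualHolderTermMultiLevelBox` — [B6] PROPOSITION 2.2, FIFTH ENTRY OF (2.67) (`‖ζG′∇^{η*}λ‖_α`),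
GENUINE `k`-LEVEL OPERATOR ON A BOX, PART 1: THE PER-TERM INPUTS — THE HÖLDER-WEIGHTED ROW PAIRS OF ONE TERM
`v_□G′(□)h_□∂ᵀ` OF `G′₀ᵀ∂ᵀ` AND THE HÖLDER-WEIGHTED COLUMN PAIRS OF ONE TERM `(K_□(h_□)G′(□)v_□)ᵀ` OF `Rᵀ`
(file 12 of the multi-level parametrix; no existing module is touched; no fact is minted)

FRAMING (verbatim cell line):
statement-level skeleton of published theorems with citation tags; proofs where landed; nothing here is a claim about the Yang–Mills mass gap

Source under audit (cell pub-balaban / lit-balaban): T. Bałaban, *Propagators and renormalization transformations for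
lattice gauge theories. II*, Commun. Math. Phys. **96** (1984) 223–250 [`Balaban1984PropagatorsII`, "B6"], p. 234
[PDF 12] (2.64)–(2.67), Proposition 2.2; p. 229–230 [PDF 7–8] (2.36)–(2.38), (2.40), (2.42)–(2.44); p. 232 [PDF 10]
(2.49)/(2.51) (renders `run/shared/lean/pub/pub-balaban/b2b-balaban-ref1/pages/1984-cmp96-propagators-rt-II/…-p007/
p008/p010/p012-x2.png`); [3] = T. Bałaban, *Regularity and decay of lattice Green's functions*, Commun. Math. Phys.
**89** (1983) 571–597 [`Balaban1983RegularityDecay`, "B4"], Theorem (1.9) p. 573, §2 pp. 575–577 ((2.6),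
«|∂^ηh_j| ≤ O(M⁻¹)», «|Δ^ηh_j| ≤ O(M⁻²)»).  Unit `lit-balaban-p21` (Phase-2 proof seat p21 gen 11), HOME
`run/shared/lean/pub/lit-balaban/`, B6 fold owner r03, referee ref-4.

## WHAT IS PRINTED (p. 234, verbatim up to notation)

«Let us formulate these results in Proposition 2.2. If we have (2.1), (2.2) and M is sufficiently large, then the
operator G′ = Δ′_a^{−1}(a = 1) satisfies the inequalities |(G′λ)(x)|, |(∇^η_xG′λ)(x)|, |(G′∇^{η*}λ)(x)|, ‖ζ∇^η_xG′λ‖_α,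
‖ζG′∇^{η*}λ‖_α, |(Δ^ηG′λ)(x)| ≤ O(1)[(L^jη)², L^jη, L^jη, (L^jη)^{1−α}(‖ζ‖_α + |ζ|), (L^jη)^{1−α}(‖ζ‖_α + |ζ|), 1]·
e^{−½δ₀d(y,y′)}|λ|, x ∈ B^j(y) or supp ζ ⊂ B^j(y), y ∈ Λ_j, supp λ ⊂ B^{j′}(y′), y′ ∈ Λ_{j′}. (2.67)»; p. 230:
«Properties of the operators G′_j(□), G′_j(□)Q′_j* and C_Λ^{(j)}(□) are described in Lemmas 2.2, 2.4, Proposition 2.3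
[3]. From these and (2.42) we get» (2.43) — the cube estimates come from [3], whose Theorem (1.9) (p. 573) is the
Hölder estimate «without any restrictions on the points x, x′» (docfix: the sentence of p. 230 quoted verbatim, referee
NOTE S-B6-g41-2; no declaration changed); (2.44) p. 230 is the smallness `O(M^{−1})` of the terms
`K_□(h_□) = [Δ′(□), h_□]` of `R` (2.40).

## THE ROUTE FOR THE FIFTH ENTRY (k-level; as the two-level `B6Prop22DualHolderTwoLevelBox`, file 13 assembles)

`V = G′∂ᵀ` (the third-entry operator, `B6Prop22AdjMultiLevelBox`) satisfies the TRANSPOSED fixed point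
`V = G′₀ᵀ∂ᵀ + RᵀV` (symmetry of `Δ′` and of `G′`), so that for the pair functional `D_α` of a block,
`D_αV = D_αG′₀ᵀ∂ᵀ + (D_αRᵀΛ)(Λ^{−1}V)`, `Λ = diag(L^{lev})` — NO iteration: the long differences in the pair fall on the
rows of `G′₀ᵀ∂ᵀ` (this file, §§2–3) and on the rows of `RᵀΛ` = the COLUMNS of `R` on the level-weighted input (this
file, §4), while `Λ^{−1}V` is the landed third entry.

## WHAT THIS FILE CERTIFIES (kernel-checked; setting of files 1–11 of the multi-level parametrix)

For the genuine `k`-level operator of a nested family `D : Domains d ℓ M_h k P R` on the box, the multi-size cover with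
its terms `aX = h_□G′(□)v_□`, `bX = K_□(h_□)G′(□)v_□` (files 2, 9), the blocks `blkOf`/distance `d` of `geom D`, in
lattice units, for `0 ≤ α < 1`:
* §2 the column kernel `colKer` of a term of `G′₀ᵀ∂ᵀ = Σ_□ v_□G′(□)h_□∂ᵀ` (`(v_□G′(□)h_□∂ᵀ)(x,x′) = v_□(x)k_□(x,x′)`,
  `k_□ = ∂h_□·G′(□) + h_□(·+e)·(column difference of G′(□))`), its vanishing off the cube image ([3] (2.6) margin), its
  bound on the image by the rows and `∂^*`-rows of `G′(□)` (`abs_colKer_img_le`), and the decaying single-row bound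
  `core_le` against a vector supported far from the row;
* §3 `aXt_row_le` (one row of one term against a block-supported `λ`), `core_pair_le` — NEAR PAIRS of rows
  (`|x̂−x| + 1 ≤ 2L^{i_□}`), deterministic: the product rule in the pair `∂h_□(x′)·(long row difference of G′(□))`
  (telescoped differenced rows, `B6Prop22HolderTwoLevelBox.wsum_longDiff_le`, weight `|x̂−x|^{−α}|x̂−x| ≤ (L^j)^{1−α}`) `+
  h_□(x′+e)·(mixed difference: long in the row, unit in the column)` (the COLUMN Hölder clause of the cube lineage,
  `B6Ineq243HolderDualTwoLevelBox.ineq243_twoLevel_holderDual_wsum2`, weight `|x̂−x|^{−α}L^{2i} = (L^i)^{1−α}(L^i/|x̂−x|)^αL^i`);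
  and `aXt_dd_le` — EVERY PAIR `x ≠ x̂` OF ONE BLOCK: `∃ δ₅, Q > 0`,
  `|x̂−x|_∞^{−α}·|((v_□G′(□)h_□∂ᵀ)λ)(x̂) − ((v_□G′(□)h_□∂ᵀ)λ)(x)| ≤ (L^{j})^{1−α}·Q·e^{−δ₅d(y,y′)/(d+1)}·sup|λ|`
  (near: `(v_□(x̂) − v_□(x))·core(x̂) + v_□(x)·(core(x̂) − core(x))`, `|v_□(x̂) − v_□(x)| ≤ (d+1)D₁|x̂−x|/L^{j_□}` on one
  block; far: two single rows and `|x̂−x|^{−α}L^{j} ≤ L(L^j)^{1−α}`);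
* §4 `bXt_pair_near_le` — NEAR PAIRS of columns of one term of `R` (`|x̂−x| ≤ L^{i_□}`), deterministic: the column pair is
  `Σ_z (K_□(h_□)u)(z)g(z)` with the two-row vector `u = (L^i/|x̂−x|)^α(v_□(x̂)G′(□)(b̂,·) − v_□(x)G′(□)(b,·))`
  (`B6Prop22DualHolderTwoLevelBox.wsum2_kComm_le`, `cube_pair_wsum2_le`, `cube_pair_diff_wsum2_le` — the two-centre
  weighted (2.44)); `bXt_col_le` — ONE COLUMN of one term of `R` on the level-weighted input `Λf` (the per-term content
  of `B6Prop22AdjMultiLevelBox.sOp_majorant`, exported): `∃ δ₇, K₇ > 0`,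
  `|((K_□(h_□)G′(□)v_□)ᵀΛf)(x)| ≤ L^{j+1}·(K₇/M_h)·e^{−δ₇d(y,y′)/(d+1)}·sup|f|`; and `bXt_dd_le` — EVERY PAIR OF ONE BLOCK:
  `∃ δ₆, Q > 0`, `|x̂−x|_∞^{−α}·|((K_□(h_□)G′(□)v_□)ᵀΛf)(x̂) − (…)(x)| ≤ (L^{j})^{1−α}·(Q/M_h)·e^{−δ₆d(y,y′)/(d+1)}·sup|f|`
  (near: `κ, κ₁ = O(M^{−1})`, `κ₂ = O(M^{−2})` from [3] §2, `(L^i)^{−α}L^{j+1} ≤ L²(L^j)^{1−α}`; far: two single columns).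
The sums over the cover, the transposed fixed point, the lifted pair functional and the chain are file 13
`B6Prop22DualHolderMultiLevelBox`.

## HONEST SCOPE

As files 1–11: levels `1 … k` on a Neumann box, `m² = 0`, the asymmetric partition (`u_□ = h_□`, `v_□ = h_□1_{B^j(Λ_j)}`),
`M_h ≥ 3`, `R ≥ 2L`; lattice units (`G′` here is `η^{−2}G′` of print, `∂ᵀ` is `η∇^{η*}` up to the unit, the Hölder
weight is `|x̂−x|_∞^{−α}` in fine sites — whence `(L^{j})^{1−α}` for «(L^jη)^{1−α}»); the Hölder pairs are the pairs
`x ≠ x̂` of ONE block `B^j(y)` (print: «supp ζ ⊂ B^j(y)»), the cut-off `ζ` and the factor `(‖ζ‖_α + |ζ|)` being dispensed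
with as in [3] (1.9); `0 ≤ α < 1`, rate and constants depending on `α` (the cube Hölder clauses of the lineage are
«∀α ∃δ»); constants existential (functions of `d`, `ℓ`, `α`, the windows).  Nothing is inferred from the manuscript:
every step is kernel-checked.
-/

namespace Literature.MathematicalPhysics.QuantumFieldTheory.Balaban1983to89.B6DualHolderTermMultiLevelBox

open Finset Matrix
open Literature.MathematicalPhysics.QuantumFieldTheory.Balaban1983to89.B4ContourShift (supNorm supNorm_nonneg
  abs_le_supNorm exists_supNorm_eq)
open Literature.MathematicalPhysics.QuantumFieldTheory.Balaban1983to89.B4Reflection242 (boxDom mem_boxDom blk nbrs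
  mem_nbrs)
open Literature.MathematicalPhysics.QuantumFieldTheory.Balaban1983to89.B4Lemma22ReduceZero (Box)
open Literature.MathematicalPhysics.QuantumFieldTheory.Balaban1983to89.B4Lemma22ZeroBoxDerivDual (fwd fwd_eq_of_nbr
  fwd_val_of_mem fwd_of_not_mem)
open Literature.MathematicalPhysics.QuantumFieldTheory.Balaban1983to89.B4PartitionUnity22 (hprof D1 D2 D1_nonneg D2_nonneg
  contDiff_hprof hasCompactSupport_hprof)
open Literature.MathematicalPhysics.QuantumFieldTheory.Balaban1983to89.B4Thm110ZeroBox (boxCast boxCast_apply_val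
  boxCast_symm_apply_val mem_boxDom_of_eq roww mulVec_le_of_roww supNorm_sub_le_sub_add_sub)
open Literature.MathematicalPhysics.QuantumFieldTheory.Balaban1983to89.B4Thm110ZeroBoxDeriv (wsum wsum_mul_left
  supNorm_single_le supNorm_sub_le_nbr)
open Literature.MathematicalPhysics.QuantumFieldTheory.Balaban1983to89.B4Thm19ZeroBoxHolder (wsum2 wsum2_nonneg
  wsum2_le_wsum_left wsum2_mono_rate)
open Literature.MathematicalPhysics.QuantumFieldTheory.Balaban1983to89.B6Ineq243TwoLevelBox
open Literature.MathematicalPhysics.QuantumFieldTheory.Balaban1983to89.B6Ineq243AdjTwoLevelBox (dstar dstar_apply roww_dstar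
  ineq243_twoLevel_dstar_roww)
open Literature.MathematicalPhysics.QuantumFieldTheory.Balaban1983to89.B6Partition236TwoLevelBox
open Literature.MathematicalPhysics.QuantumFieldTheory.Balaban1983to89.B6Eq238TwoLevelBox
open Literature.MathematicalPhysics.QuantumFieldTheory.Balaban1983to89.B6Ineq249TwoLevelBox (near card_near_le
  mem_near_of_abs_lt emb_sub_emb)
open Literature.MathematicalPhysics.QuantumFieldTheory.Balaban1983to89.B6Prop22AdjTwoLevelBox (wsum_kComm_le
  kComm_transpose mul_kComm_apply hLoc_lipschitz hLoc_laplacian_le)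
open Literature.MathematicalPhysics.QuantumFieldTheory.Balaban1983to89.B6Prop22DualHolderTwoLevelBox (wsum2_kComm_le
  cube_pair_wsum2_le cube_pair_diff_wsum2_le)
open Literature.MathematicalPhysics.QuantumFieldTheory.Balaban1983to89.B4Green242Bridge (boxNbrs)
open Literature.MathematicalPhysics.QuantumFieldTheory.Balaban1983to89.B6MultiLevelBoxOperator
open Literature.MathematicalPhysics.QuantumFieldTheory.Balaban1983to89.B6Eq238MultiLevelBox
open Literature.MathematicalPhysics.QuantumFieldTheory.Balaban1983to89.B6Ineq249MultiLevelBox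
open Literature.MathematicalPhysics.QuantumFieldTheory.Balaban1983to89.B6Geom246MultiLevelBox
open Literature.MathematicalPhysics.QuantumFieldTheory.Balaban1983to89.B6Prop22MultiLevelBox
open Literature.MathematicalPhysics.QuantumFieldTheory.Balaban1983to89.B6Prop22DerivMultiLevelBox (dMat
  dMat_mulVec_of_mem dMat_mulVec_of_not_mem img_of_uX_ne_zero mem_keySet_of_uX_ne_zero)
open Literature.MathematicalPhysics.QuantumFieldTheory.Balaban1983to89.B6Prop22AdjMultiLevelBox (levW
  bX_transpose_mulVec_img bX_transpose_mulVec_off gX_apply_img gX_apply_off gX_symm aXt_dMatt_apply aXt_dMatt_apply_off)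
open Literature.MathematicalPhysics.QuantumFieldTheory.Balaban1983to89.B6HolderTermMultiLevelBox (img_of_near
  supNorm_le_of_blkOf_eq)
open Literature.MathematicalPhysics.QuantumFieldTheory.Balaban1983to89.B6Prop22HolderTwoLevelBox (exists_emb_eq_of_near
  wsum_longDiff_le)
open Literature.MathematicalPhysics.QuantumFieldTheory.Balaban1983to89.B6Ineq243HolderDualTwoLevelBox
  (ineq243_twoLevel_holderDual_wsum2)
open Literature.MathematicalPhysics.QuantumFieldTheory.Balaban1983to89.B6RandomWalk (HasMajorant BlockSupp
  hasMajorant_mono)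

noncomputable section

variable {d : ℕ}

/-! ## §1 Tools -/

section Tools

/-- a weighted `ℓ¹` row bound gives decay against bounded vectors supported at (one- or two-centre) distance `≥ D`.
[folklore] -/
private theorem sum_mul_le_of_wrow {X : Type*} [Fintype X] {δ n c F Dd : ℝ} (hn : 0 < n) (hF0 : 0 ≤ F)
    (r u : X → ℝ) (dist : X → ℝ) (hrow : ∑ z, |r z| * Real.exp (δ * dist z / n) ≤ c)
    (hF : ∀ z, |u z| ≤ F) (hD : ∀ z, u z ≠ 0 → Dd ≤ dist z) (hδ : 0 ≤ δ) :
    |∑ z, r z * u z| ≤ c * Real.exp (-(δ * Dd / n)) * F := by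
  have hterm : ∀ z, |r z * u z| ≤ |r z| * Real.exp (δ * dist z / n) * (Real.exp (-(δ * Dd / n)) * F) := by
    intro z
    by_cases hz : u z = 0
    · rw [hz, mul_zero, abs_zero]; positivity
    rw [abs_mul]
    have h1 : 1 ≤ Real.exp (δ * dist z / n) * Real.exp (-(δ * Dd / n)) := by
      rw [← Real.exp_add]
      refine Real.one_le_exp ?_
      have := div_le_div_of_nonneg_right (mul_le_mul_of_nonneg_left (hD z hz) hδ) hn.le
      linarith
    calc |r z| * |u z| ≤ |r z| * (1 * F) := by
          rw [one_mul]; exact mul_le_mul_of_nonneg_left (hF z) (abs_nonneg _)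
      _ ≤ |r z| * (Real.exp (δ * dist z / n) * Real.exp (-(δ * Dd / n)) * F) :=
          mul_le_mul_of_nonneg_left (mul_le_mul_of_nonneg_right h1 hF0) (abs_nonneg _)
      _ = |r z| * Real.exp (δ * dist z / n) * (Real.exp (-(δ * Dd / n)) * F) := by ring
  calc |∑ z, r z * u z| ≤ ∑ z, |r z * u z| := Finset.abs_sum_le_sum_abs _ _
    _ ≤ ∑ z, |r z| * Real.exp (δ * dist z / n) * (Real.exp (-(δ * Dd / n)) * F) :=
        Finset.sum_le_sum fun z _ => hterm z
    _ = (∑ z, |r z| * Real.exp (δ * dist z / n)) * (Real.exp (-(δ * Dd / n)) * F) := by rw [Finset.sum_mul]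
    _ ≤ c * (Real.exp (-(δ * Dd / n)) * F) := mul_le_mul_of_nonneg_right hrow (by positivity)
    _ = c * Real.exp (-(δ * Dd / n)) * F := by ring

/-- the exponent bookkeeping: `e^{−δD/L^i} = e^{δ}·e^{−(δ/(d+1))·dist}` for `D = L^i(dist/(d+1) − 1)`. [folklore] -/
private theorem exp_Dd_eq {δ n dist : ℝ} (hn : 0 < n) (d : ℕ) :
    Real.exp (-(δ * (n * (dist / (d + 1) - 1)) / n)) = Real.exp δ * Real.exp (-(δ / (d + 1) * dist)) := by
  rw [← Real.exp_add]
  congr 1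
  field_simp
  ring

/-- the weakening of a rate against a non-negative distance. [folklore] -/
private theorem exp_rate_mono {δ δ' dist : ℝ} (hδ : δ' ≤ δ) (hdist : 0 ≤ dist) (d : ℕ) :
    Real.exp (-(δ / (d + 1) * dist)) ≤ Real.exp (-(δ' / (d + 1) * dist)) := by
  rw [Real.exp_le_exp, neg_le_neg_iff]
  exact mul_le_mul_of_nonneg_right (div_le_div_of_nonneg_right hδ (by positivity)) hdist

/-- the two exponent steps: `e^{−δD/n} ≤ e^{2δ}·e^{−(δ′/(d+1))dist}`. [folklore] -/
private theorem exp_Dd_le {δ δ' n dist : ℝ} (hδ : 0 ≤ δ) (hδ' : δ' ≤ δ) (hn : 1 ≤ n) (hdist : 0 ≤ dist) (d : ℕ) :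
    Real.exp (-(δ * (n * (dist / (d + 1) - 1)) / n))
      ≤ Real.exp δ * Real.exp δ * Real.exp (-(δ' / (d + 1) * dist)) := by
  have hn0 : 0 < n := by linarith
  rw [exp_Dd_eq hn0 d, mul_assoc]
  have h1 : (1 : ℝ) ≤ Real.exp δ := Real.one_le_exp hδ
  calc Real.exp δ * Real.exp (-(δ / (d + 1) * dist))
      ≤ Real.exp δ * Real.exp (-(δ' / (d + 1) * dist)) :=
        mul_le_mul_of_nonneg_left (exp_rate_mono hδ' hdist d) (Real.exp_pos _).le
    _ = 1 * (Real.exp δ * Real.exp (-(δ' / (d + 1) * dist))) := (one_mul _).symm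
    _ ≤ Real.exp δ * (Real.exp δ * Real.exp (-(δ' / (d + 1) * dist))) :=
        mul_le_mul_of_nonneg_right h1 (by positivity)

/-- the weighted functional is monotone in the rate. [folklore] -/
private theorem wsum_mono_rate {N : Fin (d + 1) → ℕ} {δ δ' : ℝ} (h : δ ≤ δ') (n : ℕ) (x : ↥(boxDom N))
    (g : ↥(boxDom N) → ℝ) : wsum δ n x g ≤ wsum δ' n x g := by
  unfold wsum
  refine Finset.sum_le_sum fun z _ => mul_le_mul_of_nonneg_left ?_ (abs_nonneg _)
  rw [Real.exp_le_exp]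
  exact div_le_div_of_nonneg_right (mul_le_mul_of_nonneg_right h (supNorm_nonneg _)) (Nat.cast_nonneg _)

/-- Hölder weights: `s^{−α}·s = s^{1−α} ≤ T^{1−α}` for `0 < s ≤ T`, `α ≤ 1`. [folklore] -/
private theorem rpow_neg_mul_self_le {s T α : ℝ} (hs : 0 < s) (hsT : s ≤ T) (hα : α ≤ 1) :
    s ^ (-α) * s ≤ T ^ (1 - α) := by
  have e : s ^ (-α) * s = s ^ (1 - α) := by
    rw [show (1 : ℝ) - α = -α + 1 by ring, Real.rpow_add hs, Real.rpow_one]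
  rw [e]
  exact Real.rpow_le_rpow hs.le hsT (by linarith)

/-- Hölder weights: `n^{1−α} ≤ T^{1−α}` for `0 ≤ n ≤ T`, `α ≤ 1`. [folklore] -/
private theorem rpow_one_sub_le {n T α : ℝ} (hn : 0 ≤ n) (hnT : n ≤ T) (hα : α ≤ 1) :
    n ^ (1 - α) ≤ T ^ (1 - α) :=
  Real.rpow_le_rpow hn hnT (by linarith)

/-- Hölder weights: `s^{−α} = n^{−α}·(n/s)^α` (`n, s > 0`). [folklore] -/
private theorem rpow_neg_eq {n s α : ℝ} (hn : 0 < n) (hs : 0 < s) :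
    s ^ (-α) = n ^ (-α) * (n / s) ^ α := by
  rw [Real.div_rpow hn.le hs.le, Real.rpow_neg hs.le, Real.rpow_neg hn.le]
  have hnα : n ^ α ≠ 0 := (Real.rpow_pos_of_pos hn α).ne'
  field_simp

/-- Hölder weights, far pairs: `s^{−α}·T ≤ L·T^{1−α}` when `T ≤ L·n`, `n ≤ s`, `0 ≤ α ≤ 1`, `L ≥ 1`, `n, T > 0`.
[folklore] -/
private theorem rpow_far_le {n s T L α : ℝ} (hn : 0 < n) (hns : n ≤ s) (hT : 0 < T) (hTL : T ≤ L * n)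
    (hL : 1 ≤ L) (hα0 : 0 ≤ α) (hα1 : α ≤ 1) : s ^ (-α) * T ≤ L * T ^ (1 - α) := by
  have hL0 : 0 < L := by linarith
  have h1 : s ^ (-α) ≤ n ^ (-α) := Real.rpow_le_rpow_of_nonpos hn hns (by linarith)
  have hTLn : T / L ≤ n := by rw [div_le_iff₀ hL0]; linarith
  have h2 : n ^ (-α) ≤ (T / L) ^ (-α) := Real.rpow_le_rpow_of_nonpos (div_pos hT hL0) hTLn (by linarith)
  have h3 : (T / L) ^ (-α) = L ^ α * T ^ (-α) := by
    rw [Real.div_rpow hT.le hL0.le, Real.rpow_neg hT.le, Real.rpow_neg hL0.le]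
    field_simp
  have h4 : L ^ α ≤ L := B4Thm19ZeroBoxHolder.rpow_le_self_of_one_le hL hα1
  have h5 : T ^ (-α) * T = T ^ (1 - α) := by
    rw [show (1 : ℝ) - α = -α + 1 by ring, Real.rpow_add hT, Real.rpow_one]
  have hTα : 0 ≤ T ^ (-α) := Real.rpow_nonneg hT.le _
  calc s ^ (-α) * T ≤ L ^ α * T ^ (-α) * T := by
        refine mul_le_mul_of_nonneg_right (h1.trans (h2.trans h3.le)) hT.le
    _ ≤ L * T ^ (-α) * T := by gcongr
    _ = L * T ^ (1 - α) := by rw [mul_assoc, h5]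

end Tools

/-- `|−x|_∞ = |x|_∞`. [folklore] -/
private theorem supNorm_neg' (x : Fin (d + 1) → ℤ) : supNorm (-x) = supNorm x := by
  unfold B4ContourShift.supNorm
  congr 1
  funext i
  simp

/-- the sup distance is symmetric. [folklore] -/
private theorem supNorm_sub_comm (x y : Fin (d + 1) → ℤ) : supNorm (x - y) = supNorm (y - x) := by
  rw [← supNorm_neg', neg_sub]

/-! ## §2 The column kernel of one term of `G′₀ᵀ∂ᵀ`, its rows and its single-row bound -/

section ColKer

variable {ℓ Mh k R : ℕ} {P : Fin (d + 1) → ℕ} {D : Domains d ℓ Mh k P R} {a c : ℕ → ℝ}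

variable (D a c) in
/-- **THE COLUMN KERNEL OF ONE TERM OF `G′₀ᵀ∂ᵀ`** (the bracket of `B6Prop22AdjMultiLevelBox.aXt_dMatt_apply`, zero
where `x′ + e_μ` leaves the box): `k_□(x, x′) = (h_□(x′+e) − h_□(x′))·G′(□)(x,x′) + h_□(x′+e)·(G′(□)(x,x′+e) − G′(□)(x,x′))`,
so that `(v_□G′(□)h_□∂ᵀ)(x, x′) = v_□(x)·k_□(x, x′)`. [cite: Balaban1984PropagatorsII, (2.37) p.229, (2.67) p.234 (entries 3, 5), dictionary] -/
def colKer (hP : ∀ μ, 1 ≤ P μ) (cq : ℕ × (Fin (d + 1) → ℤ)) (hc : CubeData D cq) (μ : Fin (d + 1))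
    (x x' : ↥(boxDom (N0 ℓ Mh k P))) : ℝ :=
  if h : x'.1 + Pi.single μ 1 ∈ boxDom (N0 ℓ Mh k P) then
    (uX (ℓ := ℓ) (Mh := Mh) (k := k) (P := P) cq ⟨x'.1 + Pi.single μ 1, h⟩
        - uX (ℓ := ℓ) (Mh := Mh) (k := k) (P := P) cq x') * gX D a c hP cq hc x x'
      + uX (ℓ := ℓ) (Mh := Mh) (k := k) (P := P) cq ⟨x'.1 + Pi.single μ 1, h⟩
        * (gX D a c hP cq hc x ⟨x'.1 + Pi.single μ 1, h⟩ - gX D a c hP cq hc x x')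
  else 0

/-- the entries of a term of `G′₀ᵀ∂ᵀ`: `v_□(x)·k_□(x, x′)`. [cite: Balaban1984PropagatorsII, (2.37) p.229, (2.67) p.234, dictionary] -/
theorem aXt_dMatt_eq_vX_mul (hP : ∀ μ, 1 ≤ P μ) (cq : ℕ × (Fin (d + 1) → ℤ)) (hc : CubeData D cq) (μ : Fin (d + 1))
    (x x' : ↥(boxDom (N0 ℓ Mh k P))) :
    ((aX D a c hP cq hc)ᵀ * (dMat (N0 ℓ Mh k P) μ)ᵀ) x x' = vX D cq x * colKer D a c hP cq hc μ x x' := by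
  unfold colKer
  by_cases h : x'.1 + Pi.single μ 1 ∈ boxDom (N0 ℓ Mh k P)
  · rw [dif_pos h, aXt_dMatt_apply hP cq hc μ x x' h]
  · rw [dif_neg h, aXt_dMatt_apply_off hP cq hc μ x x' h, mul_zero]

/-- the rows of a term of `G′₀ᵀ∂ᵀ` applied to `λ`: `v_□(x)·Σ_{x′} k_□(x, x′)λ(x′)`. [cite: Balaban1984PropagatorsII, (2.37) p.229, (2.67) p.234, dictionary] -/
theorem aXt_dMatt_mulVec (hP : ∀ μ, 1 ≤ P μ) (cq : ℕ × (Fin (d + 1) → ℤ)) (hc : CubeData D cq) (μ : Fin (d + 1))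
    (lam : ↥(boxDom (N0 ℓ Mh k P)) → ℝ) (x : ↥(boxDom (N0 ℓ Mh k P))) :
    (((aX D a c hP cq hc)ᵀ * (dMat (N0 ℓ Mh k P) μ)ᵀ) *ᵥ lam) x
      = vX D cq x * ∑ x', colKer D a c hP cq hc μ x x' * lam x' := by
  simp only [Matrix.mulVec, dotProduct]
  rw [Finset.mul_sum]
  refine Finset.sum_congr rfl fun x' _ => ?_
  rw [aXt_dMatt_eq_vX_mul]
  ring

/-- `|v_□(z)| ≤ |h_□(z)|` and `v_□(x̂) − v_□(x) = (h_□(x̂) − h_□(x))·1_{B^j(Λ_j)}(x)` on one block (the indicator depends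
on the level only). [cite: Balaban1984PropagatorsII, (2.36)–(2.37) p.229, dictionary] -/
theorem abs_vX_sub_le (cq : ℕ × (Fin (d + 1) → ℤ)) {x xh : ↥(boxDom (N0 ℓ Mh k P))} (hlev : D.lev xh.1 = D.lev x.1) :
    |vX D cq xh - vX D cq x|
      ≤ |uX (ℓ := ℓ) (Mh := Mh) (k := k) (P := P) cq xh - uX (ℓ := ℓ) (Mh := Mh) (k := k) (P := P) cq x| := by
  show |vFun D cq.1 cq.2 xh.1 - vFun D cq.1 cq.2 x.1| ≤ |uFun ℓ Mh cq.1 cq.2 xh.1 - uFun ℓ Mh cq.1 cq.2 x.1|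
  unfold vFun
  rw [hlev, ← sub_mul, abs_mul]
  by_cases h : D.lev x.1 = cq.1
  · rw [if_pos h, abs_one, mul_one]
  · rw [if_neg h, abs_zero, mul_zero]; exact abs_nonneg _

/-- `|v_□| ≤ 1`. [cite: Balaban1984PropagatorsII, (2.36) p.229] -/
theorem abs_vX_le_one (cq : ℕ × (Fin (d + 1) → ℤ)) (x : ↥(boxDom (N0 ℓ Mh k P))) : |vX D cq x| ≤ 1 :=
  abs_vFun_le_one _ _ _

/-- `v_□(x) = 0` where `h_□(x) = 0`. [cite: Balaban1984PropagatorsII, (2.36)–(2.37) p.229] -/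
theorem vX_eq_zero_of_uX (cq : ℕ × (Fin (d + 1) → ℤ)) {x : ↥(boxDom (N0 ℓ Mh k P))}
    (hu : uX (ℓ := ℓ) (Mh := Mh) (k := k) (P := P) cq x = 0) : vX D cq x = 0 := by
  have : uFun ℓ Mh cq.1 cq.2 x.1 = 0 := hu
  show vFun D cq.1 cq.2 x.1 = 0
  unfold vFun; rw [this, zero_mul]

/-- a sum over the box of a function vanishing off the cube image is the sum over the cube. [folklore] -/
private theorem sum_eq_sum_cube (hP : ∀ μ, 1 ≤ P μ) (cq : ℕ × (Fin (d + 1) → ℤ)) (hc : CubeData D cq)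
    (Φ : ↥(boxDom (N0 ℓ Mh k P)) → ℝ)
    (h0 : ∀ x', (∀ b, castP (fin_data hc).2.1 hc.hj.2 (embC D hP cq hc b) ≠ x') → Φ x' = 0) :
    ∑ x', Φ x' = ∑ b, Φ (castP (fin_data hc).2.1 hc.hj.2 (embC D hP cq hc b)) := by
  classical
  have hinj : Function.Injective (fun b => castP (fin_data hc).2.1 hc.hj.2 (embC D hP cq hc b)) :=
    fun b b' h => emb_injective _ hc.hq ((castP (fin_data hc).2.1 hc.hj.2).injective h)
  rw [← Finset.sum_image (f := Φ) (fun b _ b' _ h => hinj h)]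
  symm
  refine Finset.sum_subset (Finset.subset_univ _) fun x' _ hx' => h0 x' fun b hb => hx' ?_
  exact Finset.mem_image.2 ⟨b, Finset.mem_univ _, hb⟩

/-- the column kernel vanishes off the cube image (a site `x′` off the image with `h_□(x′+e) ≠ 0` is impossible by the
[3] (2.6) margin). [cite: Balaban1983RegularityDecay, (2.6) p.576; Balaban1984PropagatorsII, (2.37) p.229] -/
theorem colKer_off (hℓ : 1 ≤ ℓ) (hP : ∀ μ, 1 ≤ P μ) (hMh : 1 ≤ Mh) (cq : ℕ × (Fin (d + 1) → ℤ)) (hc : CubeData D cq)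
    (μ : Fin (d + 1)) (x x' : ↥(boxDom (N0 ℓ Mh k P)))
    (hx' : ∀ b, castP (fin_data hc).2.1 hc.hj.2 (embC D hP cq hc b) ≠ x') : colKer D a c hP cq hc μ x x' = 0 := by
  have hx'' : ∀ b, embC D hP cq hc b ≠ (castP (ℓ := ℓ) (Mh := Mh) (P := P) (fin_data hc).2.1 hc.hj.2).symm x' := by
    intro b hb; exact hx' b (by rw [hb, Equiv.apply_symm_apply])
  unfold colKer
  by_cases hxe : x'.1 + Pi.single μ 1 ∈ boxDom (N0 ℓ Mh k P)
  · rw [dif_pos hxe, gX_apply_off hP cq hc hx'']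
    have hu0 : uX (ℓ := ℓ) (Mh := Mh) (k := k) (P := P) cq ⟨x'.1 + Pi.single μ 1, hxe⟩ = 0 := by
      by_contra hu
      obtain ⟨b, hb⟩ := img_of_uX_ne_zero hℓ hP hMh cq hc hu (w := x')
        (Or.inl (mem_nbrs.2 ⟨μ, Or.inr (by simp)⟩))
      exact hx'' b hb
    rw [hu0]; ring
  · rw [dif_neg hxe]

/-- **THE COLUMN KERNEL ON THE CUBE IMAGE IS BOUNDED BY THE CUBE DATA**: for `x = □-image of y`, `x′ = □-image of b`:
`|k_□(x, x′)| ≤ (d+1)D₁·L^{i_□}·|G′(□)(y,b)| + L^{i_□}·|(G′(□)∂*)(y,b)|` (`|∂h_□| ≤ (d+1)D₁/L^{j_□}`, `L^{2i_□}/L^{j_□} ≤ L^{i_□}`,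
`|h_□| ≤ 1`). [cite: Balaban1984PropagatorsII, (2.43) p.230, (2.67) p.234 (entries 3, 5), dictionary] -/
theorem abs_colKer_img_le (hℓ : 1 ≤ ℓ) (hP : ∀ μ, 1 ≤ P μ) (hMh : 1 ≤ Mh) (cq : ℕ × (Fin (d + 1) → ℤ))
    (hc : CubeData D cq) (μ : Fin (d + 1)) {x : ↥(boxDom (N0 ℓ Mh k P))}
    {y : ↥(Box d ℓ (fin D cq.1 cq.2)
      (fun ν => (ℓ + 1) * cubeM' (MhP ℓ Mh cq.1 (fin D cq.1 cq.2)) (Pj ℓ k P cq.1) cq.2 ν))}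
    (hy : embC D hP cq hc y = (castP (ℓ := ℓ) (Mh := Mh) (P := P) (fin_data hc).2.1 hc.hj.2).symm x)
    (b : ↥(Box d ℓ (fin D cq.1 cq.2)
      (fun ν => (ℓ + 1) * cubeM' (MhP ℓ Mh cq.1 (fin D cq.1 cq.2)) (Pj ℓ k P cq.1) cq.2 ν))) :
    |colKer D a c hP cq hc μ x (castP (fin_data hc).2.1 hc.hj.2 (embC D hP cq hc b))|
      ≤ (d + 1) * D1 hprof * (((ℓ + 1) ^ fin D cq.1 cq.2 : ℕ) : ℝ)
          * |cG D a c cq.1 (fin D cq.1 cq.2) cq.2 hP hc.hq y b|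
        + (((ℓ + 1) ^ fin D cq.1 cq.2 : ℕ) : ℝ)
          * |dstar ((ℓ + 1) ^ fin D cq.1 cq.2) μ (cG D a c cq.1 (fin D cq.1 cq.2) cq.2 hP hc.hq) y b| := by
  obtain ⟨hi1, hij, hji, -, -⟩ := fin_data hc
  have hjk := hc.hj.2
  have hD1 := D1_nonneg contDiff_hprof hasCompactSupport_hprof
  have hn1 : 1 ≤ (ℓ + 1) ^ fin D cq.1 cq.2 := Nat.one_le_pow _ _ (by omega)
  have hn : (0 : ℝ) < (((ℓ + 1) ^ fin D cq.1 cq.2 : ℕ) : ℝ) := by positivity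
  have hncast : (((ℓ + 1) ^ fin D cq.1 cq.2 : ℕ) : ℝ) = ((ℓ : ℝ) + 1) ^ fin D cq.1 cq.2 := by push_cast; ring
  obtain ⟨nn, hnn⟩ : ∃ t : ℝ, t = (((ℓ + 1) ^ fin D cq.1 cq.2 : ℕ) : ℝ) := ⟨_, rfl⟩
  have hnn0 : 0 < nn := by rw [hnn]; exact hn
  rw [← hnn]
  have hzval : ∀ w : ↥(boxDom (N0 ℓ Mh k P)), ((castP (ℓ := ℓ) (Mh := Mh) (P := P) hij hjk).symm w).1 = w.1 :=
    fun w => by unfold castP; exact boxCast_symm_apply_val _ _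
  have hNj1 : 1 ≤ (ℓ + 1) ^ cq.1 := Nat.one_le_pow _ _ (by omega)
  have hM1 : 1 ≤ (ℓ + 1) * Mh := Nat.one_le_iff_ne_zero.2 (Nat.mul_ne_zero_iff.2 ⟨by omega, by omega⟩)
  set x' : ↥(boxDom (N0 ℓ Mh k P)) := castP (fin_data hc).2.1 hc.hj.2 (embC D hP cq hc b) with hx'
  have hb : embC D hP cq hc b = (castP (ℓ := ℓ) (Mh := Mh) (P := P) hij hjk).symm x' := by
    rw [hx', Equiv.symm_apply_apply]
  have hx'val : x'.1 = (embC D hP cq hc b).1 := by rw [hx']; unfold castP; exact boxCast_apply_val _ _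
  have hr0 : 0 ≤ (d + 1) * D1 hprof * nn * |cG D a c cq.1 (fin D cq.1 cq.2) cq.2 hP hc.hq y b|
      + nn * |dstar ((ℓ + 1) ^ fin D cq.1 cq.2) μ (cG D a c cq.1 (fin D cq.1 cq.2) cq.2 hP hc.hq) y b| := by
    positivity
  unfold colKer
  by_cases hxe : x'.1 + Pi.single μ 1 ∈ boxDom (N0 ℓ Mh k P)
  swap
  · rw [dif_neg hxe, abs_zero]; exact hr0
  rw [dif_pos hxe, gX_apply_img hP cq hc hy hb]
  -- first part: `|∂h|·n²|G| ≤ (d+1)D₁·n·|G|`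
  have hdu : |uX (ℓ := ℓ) (Mh := Mh) (k := k) (P := P) cq ⟨x'.1 + Pi.single μ 1, hxe⟩
      - uX (ℓ := ℓ) (Mh := Mh) (k := k) (P := P) cq x'| ≤ (d + 1) * D1 hprof / (((ℓ + 1) ^ cq.1 : ℕ) : ℝ) := by
    have h := abs_hq_sub_le (d := d) hNj1 hM1 cq.2 x'.1 (x'.1 + Pi.single μ 1)
    have hs : supNorm (x'.1 + Pi.single μ 1 - x'.1) ≤ 1 := by
      rw [add_sub_cancel_left]; exact supNorm_single_le μ
    have hMr : (1 : ℝ) ≤ (((ℓ + 1) * Mh : ℕ) : ℝ) := by exact_mod_cast hM1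
    have hnj : (0 : ℝ) < (((ℓ + 1) ^ cq.1 : ℕ) : ℝ) := by positivity
    have hA0 : 0 ≤ (d + 1) * D1 hprof / (((ℓ + 1) * Mh : ℕ) : ℝ) := by positivity
    have h5 : (d + 1) * D1 hprof / (((ℓ + 1) * Mh : ℕ) : ℝ) * supNorm (x'.1 + Pi.single μ 1 - x'.1)
        ≤ (d + 1) * D1 hprof :=
      calc (d + 1) * D1 hprof / (((ℓ + 1) * Mh : ℕ) : ℝ) * supNorm (x'.1 + Pi.single μ 1 - x'.1)
          ≤ (d + 1) * D1 hprof / (((ℓ + 1) * Mh : ℕ) : ℝ) * 1 := mul_le_mul_of_nonneg_left hs hA0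
        _ = (d + 1) * D1 hprof / (((ℓ + 1) * Mh : ℕ) : ℝ) := mul_one _
        _ ≤ (d + 1) * D1 hprof := div_le_self (by positivity) hMr
    exact h.trans (div_le_div_of_nonneg_right h5 hnj.le)
  have hsq : nn * nn / (((ℓ + 1) ^ cq.1 : ℕ) : ℝ) ≤ nn := by
    have hnj : (0 : ℝ) < (((ℓ + 1) ^ cq.1 : ℕ) : ℝ) := by positivity
    rw [div_le_iff₀ hnj]
    refine mul_le_mul_of_nonneg_left ?_ hnn0.le
    rw [hnn]; exact_mod_cast Nat.pow_le_pow_right (by omega) hij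
  have hn2eq : ((((ℓ : ℝ) + 1)) ^ fin D cq.1 cq.2) ^ 2 = nn * nn := by rw [hnn, hncast]; ring
  have hp1 : |(uX (ℓ := ℓ) (Mh := Mh) (k := k) (P := P) cq ⟨x'.1 + Pi.single μ 1, hxe⟩
        - uX (ℓ := ℓ) (Mh := Mh) (k := k) (P := P) cq x')
      * (((((ℓ : ℝ) + 1)) ^ fin D cq.1 cq.2) ^ 2 * cG D a c cq.1 (fin D cq.1 cq.2) cq.2 hP hc.hq y b)|
      ≤ (d + 1) * D1 hprof * nn * |cG D a c cq.1 (fin D cq.1 cq.2) cq.2 hP hc.hq y b| := by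
    rw [abs_mul, abs_mul, hn2eq, abs_of_nonneg (mul_nonneg hnn0.le hnn0.le)]
    calc |uX cq ⟨x'.1 + Pi.single μ 1, hxe⟩ - uX cq x'| * (nn * nn * |cG D a c cq.1 (fin D cq.1 cq.2) cq.2 hP hc.hq y b|)
        ≤ (d + 1) * D1 hprof / (((ℓ + 1) ^ cq.1 : ℕ) : ℝ)
            * (nn * nn * |cG D a c cq.1 (fin D cq.1 cq.2) cq.2 hP hc.hq y b|) :=
          mul_le_mul_of_nonneg_right hdu (by positivity)
      _ = (d + 1) * D1 hprof * (nn * nn / (((ℓ + 1) ^ cq.1 : ℕ) : ℝ))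
            * |cG D a c cq.1 (fin D cq.1 cq.2) cq.2 hP hc.hq y b| := by
          field_simp
      _ ≤ (d + 1) * D1 hprof * nn * |cG D a c cq.1 (fin D cq.1 cq.2) cq.2 hP hc.hq y b| :=
          mul_le_mul_of_nonneg_right (mul_le_mul_of_nonneg_left hsq (by positivity)) (abs_nonneg _)
  -- second part: `|h(x′+e)|·|G(x,x′+e) − G(x,x′)| ≤ n|dstar G(y,b)|`
  have hp2 : |uX (ℓ := ℓ) (Mh := Mh) (k := k) (P := P) cq ⟨x'.1 + Pi.single μ 1, hxe⟩
      * (gX D a c hP cq hc x ⟨x'.1 + Pi.single μ 1, hxe⟩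
        - ((((ℓ : ℝ) + 1)) ^ fin D cq.1 cq.2) ^ 2 * cG D a c cq.1 (fin D cq.1 cq.2) cq.2 hP hc.hq y b)|
      ≤ nn * |dstar ((ℓ + 1) ^ fin D cq.1 cq.2) μ (cG D a c cq.1 (fin D cq.1 cq.2) cq.2 hP hc.hq) y b| := by
    by_cases hu : uX (ℓ := ℓ) (Mh := Mh) (k := k) (P := P) cq ⟨x'.1 + Pi.single μ 1, hxe⟩ = 0
    · rw [hu, zero_mul, abs_zero]; exact mul_nonneg hnn0.le (abs_nonneg _)
    obtain ⟨be, hbe⟩ := img_of_uX_ne_zero hℓ hP hMh cq hc hu (Or.inr rfl)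
    have hbeval : (embC D hP cq hc be).1 = x'.1 + Pi.single μ 1 := by rw [hbe, hzval]
    have hbe1 : be.1 = b.1 + Pi.single μ 1 := by
      have h1 : (embC D hP cq hc be).1 - (embC D hP cq hc b).1 = be.1 - b.1 := by
        unfold embC; exact emb_sub_emb _ hc.hq be b
      rw [hbeval, ← hx'val, add_sub_cancel_left, eq_comm, sub_eq_iff_eq_add'] at h1
      exact h1
    have hfwd : fwd _ μ b = be := fwd_eq_of_nbr μ b be hbe1
    rw [gX_apply_img hP cq hc hy hbe, ← mul_sub, dstar_apply, hfwd, abs_mul, abs_mul, abs_mul, hn2eq,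
      abs_of_nonneg (mul_nonneg hnn0.le hnn0.le), hnn, abs_of_nonneg hn.le]
    have huXe : |uX (ℓ := ℓ) (Mh := Mh) (k := k) (P := P) cq ⟨x'.1 + Pi.single μ 1, hxe⟩| ≤ 1 :=
      abs_hq_le_one _ _ _ _
    calc |uX cq ⟨x'.1 + Pi.single μ 1, hxe⟩|
          * ((((ℓ + 1) ^ fin D cq.1 cq.2 : ℕ) : ℝ) * (((ℓ + 1) ^ fin D cq.1 cq.2 : ℕ) : ℝ)
            * |cG D a c cq.1 (fin D cq.1 cq.2) cq.2 hP hc.hq y be - cG D a c cq.1 (fin D cq.1 cq.2) cq.2 hP hc.hq y b|)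
        ≤ 1 * ((((ℓ + 1) ^ fin D cq.1 cq.2 : ℕ) : ℝ) * (((ℓ + 1) ^ fin D cq.1 cq.2 : ℕ) : ℝ)
            * |cG D a c cq.1 (fin D cq.1 cq.2) cq.2 hP hc.hq y be - cG D a c cq.1 (fin D cq.1 cq.2) cq.2 hP hc.hq y b|) :=
          mul_le_mul_of_nonneg_right huXe (by positivity)
      _ = (((ℓ + 1) ^ fin D cq.1 cq.2 : ℕ) : ℝ) * ((((ℓ + 1) ^ fin D cq.1 cq.2 : ℕ) : ℝ)
            * |cG D a c cq.1 (fin D cq.1 cq.2) cq.2 hP hc.hq y be - cG D a c cq.1 (fin D cq.1 cq.2) cq.2 hP hc.hq y b|) := by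
          ring
  exact (abs_add_le _ _).trans (add_le_add hp1 hp2)

/-- **THE SINGLE-ROW BOUND OF THE COLUMN KERNEL** (deterministic form): given the rows of `G′(□)` (`≤ c′`, rate `δ₁`)
and the bond sums of `G′(□)∂*` (`≤ c_s`, rate `δ₂`), a common rate `δ ≤ δ₁, δ₂`, a vector `λ` on the box with
`|λ| ≤ F` on the cube image and support at sup-distance `≥ D` from the preimage `y` of `x`:
`|Σ_{x′} k_□(x,x′)λ(x′)| ≤ L^{i_□}·((d+1)D₁c′ + c_s)·e^{−δD/L^{i_□}}·F`. [cite: Balaban1984PropagatorsII, (2.43) p.230, (2.66)–(2.67) p.234 (entries 3, 5), dictionary] -/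
theorem core_le (hℓ : 1 ≤ ℓ) (hP : ∀ μ, 1 ≤ P μ) (hMh : 1 ≤ Mh) (cq : ℕ × (Fin (d + 1) → ℤ)) (hc : CubeData D cq)
    (μ : Fin (d + 1)) {δ₁ δ₂ δ c' cs : ℝ} (hδ : 0 ≤ δ) (h1 : δ ≤ δ₁) (h2 : δ ≤ δ₂)
    (h243 : ∀ b, roww δ₁ ((ℓ + 1) ^ fin D cq.1 cq.2) (cG D a c cq.1 (fin D cq.1 cq.2) cq.2 hP hc.hq) b ≤ c')
    (h243s : ∀ b, roww δ₂ ((ℓ + 1) ^ fin D cq.1 cq.2)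
      (dstar ((ℓ + 1) ^ fin D cq.1 cq.2) μ (cG D a c cq.1 (fin D cq.1 cq.2) cq.2 hP hc.hq)) b ≤ cs)
    (lam : ↥(boxDom (N0 ℓ Mh k P)) → ℝ) {F Dd : ℝ} (hF0 : 0 ≤ F)
    (hF : ∀ b, |lam (castP (fin_data hc).2.1 hc.hj.2 (embC D hP cq hc b))| ≤ F)
    {x : ↥(boxDom (N0 ℓ Mh k P))}
    {y : ↥(Box d ℓ (fin D cq.1 cq.2)
      (fun ν => (ℓ + 1) * cubeM' (MhP ℓ Mh cq.1 (fin D cq.1 cq.2)) (Pj ℓ k P cq.1) cq.2 ν))}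
    (hy : embC D hP cq hc y = (castP (ℓ := ℓ) (Mh := Mh) (P := P) (fin_data hc).2.1 hc.hj.2).symm x)
    (hD : ∀ b, lam (castP (fin_data hc).2.1 hc.hj.2 (embC D hP cq hc b)) ≠ 0 → Dd ≤ supNorm (y.1 - b.1)) :
    |∑ x', colKer D a c hP cq hc μ x x' * lam x'|
      ≤ (((ℓ + 1) ^ fin D cq.1 cq.2 : ℕ) : ℝ) * ((d + 1) * D1 hprof * c' + cs)
        * Real.exp (-(δ * Dd / (((ℓ + 1) ^ fin D cq.1 cq.2 : ℕ) : ℝ))) * F := by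
  obtain ⟨hi1, hij, hji, -, -⟩ := fin_data hc
  have hD1 := D1_nonneg contDiff_hprof hasCompactSupport_hprof
  have hn1 : 1 ≤ (ℓ + 1) ^ fin D cq.1 cq.2 := Nat.one_le_pow _ _ (by omega)
  have hn : (0 : ℝ) < (((ℓ + 1) ^ fin D cq.1 cq.2 : ℕ) : ℝ) := by positivity
  obtain ⟨nn, hnn⟩ : ∃ t : ℝ, t = (((ℓ + 1) ^ fin D cq.1 cq.2 : ℕ) : ℝ) := ⟨_, rfl⟩
  have hnn0 : 0 < nn := by rw [hnn]; exact hn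
  have hc'0 : 0 ≤ c' := le_trans (by unfold roww; positivity) (h243 y)
  have hcs0 : 0 ≤ cs := le_trans (by unfold roww; positivity) (h243s y)
  -- the pointwise bound `r(b)` and its weighted sum
  set r : ↥(Box d ℓ (fin D cq.1 cq.2)
      (fun ν => (ℓ + 1) * cubeM' (MhP ℓ Mh cq.1 (fin D cq.1 cq.2)) (Pj ℓ k P cq.1) cq.2 ν)) → ℝ :=
    fun b => (d + 1) * D1 hprof * nn * |cG D a c cq.1 (fin D cq.1 cq.2) cq.2 hP hc.hq y b|
      + nn * |dstar ((ℓ + 1) ^ fin D cq.1 cq.2) μ (cG D a c cq.1 (fin D cq.1 cq.2) cq.2 hP hc.hq) y b| with hr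
  have hr0 : ∀ b, 0 ≤ r b := fun b => by positivity
  have hrow : roww δ ((ℓ + 1) ^ fin D cq.1 cq.2) (cG D a c cq.1 (fin D cq.1 cq.2) cq.2 hP hc.hq) y ≤ c' :=
    (roww_mono h1 _ _ _).trans (h243 y)
  have hrowd : roww δ ((ℓ + 1) ^ fin D cq.1 cq.2)
      (dstar ((ℓ + 1) ^ fin D cq.1 cq.2) μ (cG D a c cq.1 (fin D cq.1 cq.2) cq.2 hP hc.hq)) y ≤ cs :=
    (roww_mono h2 _ _ _).trans (h243s y)
  have hwrow : ∑ b, |r b| * Real.exp (δ * supNorm (y.1 - b.1) / nn) ≤ nn * ((d + 1) * D1 hprof * c' + cs) := by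
    have hsplit : ∀ b, |r b| * Real.exp (δ * supNorm (y.1 - b.1) / nn)
        = (d + 1) * D1 hprof * nn * (|cG D a c cq.1 (fin D cq.1 cq.2) cq.2 hP hc.hq y b|
            * Real.exp (δ * supNorm (y.1 - b.1) / nn))
          + nn * (|dstar ((ℓ + 1) ^ fin D cq.1 cq.2) μ (cG D a c cq.1 (fin D cq.1 cq.2) cq.2 hP hc.hq) y b|
            * Real.exp (δ * supNorm (y.1 - b.1) / nn)) := by
      intro b
      rw [abs_of_nonneg (hr0 b), hr]
      ring
    simp_rw [hsplit]
    rw [Finset.sum_add_distrib, ← Finset.mul_sum, ← Finset.mul_sum]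
    have e1 : ∑ b, |cG D a c cq.1 (fin D cq.1 cq.2) cq.2 hP hc.hq y b| * Real.exp (δ * supNorm (y.1 - b.1) / nn)
        ≤ c' := by rw [hnn]; exact hrow
    have e2 : ∑ b, |dstar ((ℓ + 1) ^ fin D cq.1 cq.2) μ (cG D a c cq.1 (fin D cq.1 cq.2) cq.2 hP hc.hq) y b|
        * Real.exp (δ * supNorm (y.1 - b.1) / nn) ≤ cs := by rw [hnn]; exact hrowd
    calc (d + 1) * D1 hprof * nn * ∑ b, |cG D a c cq.1 (fin D cq.1 cq.2) cq.2 hP hc.hq y b|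
            * Real.exp (δ * supNorm (y.1 - b.1) / nn)
          + nn * ∑ b, |dstar ((ℓ + 1) ^ fin D cq.1 cq.2) μ (cG D a c cq.1 (fin D cq.1 cq.2) cq.2 hP hc.hq) y b|
            * Real.exp (δ * supNorm (y.1 - b.1) / nn)
        ≤ (d + 1) * D1 hprof * nn * c' + nn * cs :=
          add_le_add (mul_le_mul_of_nonneg_left e1 (by positivity)) (mul_le_mul_of_nonneg_left e2 hnn0.le)
      _ = nn * ((d + 1) * D1 hprof * c' + cs) := by ring
  -- the row as a sum over the cube
  have hsumx : ∑ x', colKer D a c hP cq hc μ x x' * lam x'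
      = ∑ b, colKer D a c hP cq hc μ x (castP (fin_data hc).2.1 hc.hj.2 (embC D hP cq hc b))
          * lam (castP (fin_data hc).2.1 hc.hj.2 (embC D hP cq hc b)) :=
    sum_eq_sum_cube hP cq hc _ fun x' hx' => by rw [colKer_off hℓ hP hMh cq hc μ x x' hx', zero_mul]
  rw [hsumx]
  have hF' : ∀ b, |(fun b => |lam (castP (fin_data hc).2.1 hc.hj.2 (embC D hP cq hc b))|) b| ≤ F := fun b => by
    simp only [abs_abs]; exact hF b
  have hD' : ∀ b, (fun b => |lam (castP (fin_data hc).2.1 hc.hj.2 (embC D hP cq hc b))|) b ≠ 0 →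
      Dd ≤ supNorm (y.1 - b.1) := fun b hb => hD b (abs_ne_zero.1 hb)
  have hcol := sum_mul_le_of_wrow hnn0 hF0 r (fun b => |lam (castP (fin_data hc).2.1 hc.hj.2 (embC D hP cq hc b))|)
    (fun b => supNorm (y.1 - b.1)) hwrow hF' hD' hδ
  rw [← hnn]
  calc |∑ b, colKer D a c hP cq hc μ x (castP (fin_data hc).2.1 hc.hj.2 (embC D hP cq hc b))
          * lam (castP (fin_data hc).2.1 hc.hj.2 (embC D hP cq hc b))|
      ≤ ∑ b, |colKer D a c hP cq hc μ x (castP (fin_data hc).2.1 hc.hj.2 (embC D hP cq hc b))|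
          * |lam (castP (fin_data hc).2.1 hc.hj.2 (embC D hP cq hc b))| := by
        refine (Finset.abs_sum_le_sum_abs _ _).trans (le_of_eq (Finset.sum_congr rfl fun b _ => abs_mul _ _))
    _ ≤ ∑ b, r b * |lam (castP (fin_data hc).2.1 hc.hj.2 (embC D hP cq hc b))| :=
        Finset.sum_le_sum fun b _ => mul_le_mul_of_nonneg_right
          (by have h := abs_colKer_img_le (a := a) (c := c) hℓ hP hMh cq hc μ hy b; rw [← hnn] at h; exact h)
          (abs_nonneg _)
    _ ≤ abs (∑ b, r b * |lam (castP (fin_data hc).2.1 hc.hj.2 (embC D hP cq hc b))|) := le_abs_self _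
    _ ≤ nn * ((d + 1) * D1 hprof * c' + cs) * Real.exp (-(δ * Dd / nn)) * F := hcol

end ColKer

/-! ## §3 One term of `G′₀ᵀ∂ᵀ` over a pair of rows: single rows, near pairs, every pair -/

section RowPair

variable {ℓ Mh k R : ℕ} {P : Fin (d + 1) → ℕ} {D : Domains d ℓ Mh k P R} {a c : ℕ → ℝ}

/-- **ONE ROW OF ONE TERM OF `G′₀ᵀ∂ᵀ`** against a block-supported `λ` (any box site `x`; the term vanishes unless
`h_□(x) ≠ 0`): `|(v_□G′(□)h_□∂ᵀλ)(x)| ≤ L^{i_□}·((d+1)D₁c′ + c_s)·e^{2δ}·e^{−δd(y,y′)/(d+1)}·sup|λ|` (rates `δ ≤ δ₁, δ₂`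
of the two cube inputs). [cite: Balaban1984PropagatorsII, (2.43) p.230, (2.66)–(2.67) p.234 (entries 3, 5)] -/
theorem aXt_row_le (hℓ : 1 ≤ ℓ) (hR : 2 * (ℓ + 1) ≤ R) (hP : ∀ μ, 1 ≤ P μ) (hMh : 1 ≤ Mh)
    (cq : ℕ × (Fin (d + 1) → ℤ)) (hc : CubeData D cq) (μ : Fin (d + 1)) {δ₁ δ₂ δ c' cs : ℝ} (hδ : 0 ≤ δ)
    (h1 : δ ≤ δ₁) (h2 : δ ≤ δ₂) (hc'0 : 0 ≤ c') (hcs0 : 0 ≤ cs)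
    (h243 : ∀ b, roww δ₁ ((ℓ + 1) ^ fin D cq.1 cq.2) (cG D a c cq.1 (fin D cq.1 cq.2) cq.2 hP hc.hq) b ≤ c')
    (h243s : ∀ b, roww δ₂ ((ℓ + 1) ^ fin D cq.1 cq.2)
      (dstar ((ℓ + 1) ^ fin D cq.1 cq.2) μ (cG D a c cq.1 (fin D cq.1 cq.2) cq.2 hP hc.hq)) b ≤ cs)
    (y' : ↥(bset D)) (lam : ↥(boxDom (N0 ℓ Mh k P)) → ℝ) (B : ℝ) (hlam : BlockSupp (g := geom D) (blkOf D) lam y' B)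
    (x : ↥(boxDom (N0 ℓ Mh k P))) :
    |(((aX D a c hP cq hc)ᵀ * (dMat (N0 ℓ Mh k P) μ)ᵀ) *ᵥ lam) x|
      ≤ (((ℓ + 1) ^ fin D cq.1 cq.2 : ℕ) : ℝ) * ((d + 1) * D1 hprof * c' + cs) * (Real.exp δ * Real.exp δ)
        * Real.exp (-(δ / (d + 1) * (geom D).dist (blkOf D x) y')) * B := by
  obtain ⟨hi1, hij, hji, -, -⟩ := fin_data hc
  have hjk := hc.hj.2
  have hD1 := D1_nonneg contDiff_hprof hasCompactSupport_hprof
  have hlamB : ∀ w, |lam w| ≤ B := fun w => BlockSupp.abs_le hlam w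
  have hB0 : 0 ≤ B := hlam.nonneg
  have hn1 : (1 : ℝ) ≤ (((ℓ + 1) ^ fin D cq.1 cq.2 : ℕ) : ℝ) := by exact_mod_cast Nat.one_le_pow _ _ (by omega)
  have hn0 : (0 : ℝ) < (((ℓ + 1) ^ fin D cq.1 cq.2 : ℕ) : ℝ) := lt_of_lt_of_le one_pos hn1
  obtain ⟨dist0, hdist0⟩ : ∃ t : ℝ, t = (((bond D).dist (blkOf D x) y' : ℕ) : ℝ) := ⟨_, rfl⟩
  have hgeom : (geom D).dist (blkOf D x) y' = dist0 := by rw [hdist0]; rfl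
  have hdist0nn : 0 ≤ dist0 := by rw [hdist0]; positivity
  rw [hgeom, aXt_dMatt_mulVec, abs_mul]
  have hRHS0 : 0 ≤ (((ℓ + 1) ^ fin D cq.1 cq.2 : ℕ) : ℝ) * ((d + 1) * D1 hprof * c' + cs) * (Real.exp δ * Real.exp δ)
      * Real.exp (-(δ / (d + 1) * dist0)) * B := by positivity
  by_cases hux : uX (ℓ := ℓ) (Mh := Mh) (k := k) (P := P) cq x = 0
  · rw [vX_eq_zero_of_uX cq hux, abs_zero, zero_mul]; exact hRHS0
  obtain ⟨y, hy⟩ := img_of_uX_ne_zero hℓ hP hMh cq hc hux (Or.inr rfl)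
  have hzval : ∀ w : ↥(boxDom (N0 ℓ Mh k P)), ((castP (ℓ := ℓ) (Mh := Mh) (P := P) hij hjk).symm w).1 = w.1 :=
    fun w => by unfold castP; exact boxCast_symm_apply_val _ _
  have hyx : (embC D hP cq hc y).1 = x.1 := by rw [hy, hzval]
  have hxin : InCube ℓ Mh k P cq.1 cq.2 x.1 := by
    rw [← hzval x]; exact (inCube_iff_exists_emb (Mh := Mh) hP hij hc.hq _).2 ⟨y, hy⟩
  obtain ⟨Dd, hDd⟩ : ∃ t : ℝ, t = (((ℓ + 1) ^ fin D cq.1 cq.2 : ℕ) : ℝ) * (dist0 / (d + 1) - 1) := ⟨_, rfl⟩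
  have hD : ∀ b, lam (castP (fin_data hc).2.1 hc.hj.2 (embC D hP cq hc b)) ≠ 0 → Dd ≤ supNorm (y.1 - b.1) := by
    intro b hb
    set x'' : ↥(boxDom (N0 ℓ Mh k P)) := castP (fin_data hc).2.1 hc.hj.2 (embC D hP cq hc b) with hx''
    have hx''val : x''.1 = (embC D hP cq hc b).1 := by rw [hx'']; unfold castP; exact boxCast_apply_val _ _
    have hx''in : InCube ℓ Mh k P cq.1 cq.2 x''.1 := by
      rw [hx''val]; exact (inCube_iff_exists_emb (Mh := Mh) hP hij hc.hq _).2 ⟨b, rfl⟩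
    have hblk : blkOf D x'' = y' := by
      by_contra hne; exact hb (hlam.off x'' hne)
    have h := Dd_le_supNorm hℓ hR hP hMh hc x x'' hxin hx''in y' hblk
    have hsub : x.1 - x''.1 = y.1 - b.1 := by
      rw [hx''val, ← hyx]; unfold embC; exact emb_sub_emb _ hc.hq y b
    rw [hsub, ← hdist0] at h
    rw [hDd]
    exact h
  have hcore := core_le (a := a) (c := c) hℓ hP hMh cq hc μ hδ h1 h2 h243 h243s lam hB0 (fun b => hlamB _) hy hD
  have hexp : Real.exp (-(δ * Dd / (((ℓ + 1) ^ fin D cq.1 cq.2 : ℕ) : ℝ)))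
      ≤ Real.exp δ * Real.exp δ * Real.exp (-(δ / (d + 1) * dist0)) := by
    rw [hDd]; exact exp_Dd_le hδ le_rfl hn1 hdist0nn d
  have hvX : |vX D cq x| ≤ 1 := abs_vX_le_one cq x
  have hQ0 : 0 ≤ (((ℓ + 1) ^ fin D cq.1 cq.2 : ℕ) : ℝ) * ((d + 1) * D1 hprof * c' + cs) := by positivity
  calc |vX D cq x| * |∑ x', colKer D a c hP cq hc μ x x' * lam x'|
      ≤ 1 * ((((ℓ + 1) ^ fin D cq.1 cq.2 : ℕ) : ℝ) * ((d + 1) * D1 hprof * c' + cs)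
          * Real.exp (-(δ * Dd / (((ℓ + 1) ^ fin D cq.1 cq.2 : ℕ) : ℝ))) * B) :=
        mul_le_mul hvX hcore (abs_nonneg _) zero_le_one
    _ ≤ 1 * ((((ℓ + 1) ^ fin D cq.1 cq.2 : ℕ) : ℝ) * ((d + 1) * D1 hprof * c' + cs)
          * (Real.exp δ * Real.exp δ * Real.exp (-(δ / (d + 1) * dist0))) * B) := by
        refine mul_le_mul_of_nonneg_left ?_ zero_le_one
        exact mul_le_mul_of_nonneg_right (mul_le_mul_of_nonneg_left hexp hQ0) hB0
    _ = (((ℓ + 1) ^ fin D cq.1 cq.2 : ℕ) : ℝ) * ((d + 1) * D1 hprof * c' + cs) * (Real.exp δ * Real.exp δ)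
        * Real.exp (-(δ / (d + 1) * dist0)) * B := by ring

set_option maxHeartbeats 1600000 in
/-- **THE NEAR PAIRS OF ROWS OF THE COLUMN KERNEL** (deterministic form): for two sites `x = □-image of b`,
`x̂ = □-image of b̂` (`b̂ ≠ b`, `|b̂ − b|_∞ + 1 ≤ 2L^{i_□}`), given the differenced rows of `G′(□)` (`≤ c_d`, rate `δ₂`) and
the COLUMN Hölder clause of `G′(□)` (`≤ c_H`, rate `δ₃`; `B6Ineq243HolderDualTwoLevelBox`), a common rate `δ ≤ δ₂, δ₃`, a
vector `λ` with `|λ| ≤ F` on the cube image supported at sup-distance `≥ D` from both `b` and `b̂`: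
`|x̂−x|_∞^{−α}·|Σ_{x′}(k_□(x̂,x′) − k_□(x,x′))λ(x′)| ≤ ((d+1)²D₁e^{2δ}c_d·(|x̂−x|^{−α}|x̂−x|)·L^{i_□}/L^{j_□} + (L^{i_□})^{1−α}c_H)·e^{−δD/L^{i_□}}·F`
— the product rule in the row pair: `∂h_□(x′)·(long row difference of G′(□))` (telescoped,
`B6Prop22HolderTwoLevelBox.wsum_longDiff_le`) and `h_□(x′+e)·(mixed difference: long in the row, unit in the column)`.
[cite: Balaban1984PropagatorsII, (2.43) p.230, (2.64)–(2.67) p.234 (fifth entry); Balaban1983RegularityDecay, Theorem (1.9) p.573] -/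
theorem core_pair_le (hℓ : 1 ≤ ℓ) (hP : ∀ μ, 1 ≤ P μ) (hMh : 1 ≤ Mh) (cq : ℕ × (Fin (d + 1) → ℤ))
    (hc : CubeData D cq) (μ : Fin (d + 1)) {α : ℝ} {δ₂ δ₃ δ cd cH : ℝ} (hδ : 0 ≤ δ) (h2 : δ ≤ δ₂)
    (h3 : δ ≤ δ₃) (hcd : 0 ≤ cd)
    (h243d : ∀ (i : Fin (d + 1)) (u ue : ↥(Box d ℓ (fin D cq.1 cq.2)
        (fun ν => (ℓ + 1) * cubeM' (MhP ℓ Mh cq.1 (fin D cq.1 cq.2)) (Pj ℓ k P cq.1) cq.2 ν))),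
      ue.1 = u.1 + Pi.single i 1 →
      wsum δ₂ ((ℓ + 1) ^ fin D cq.1 cq.2) u (fun z => (((ℓ + 1) ^ fin D cq.1 cq.2 : ℕ) : ℝ)
        * (cG D a c cq.1 (fin D cq.1 cq.2) cq.2 hP hc.hq ue z - cG D a c cq.1 (fin D cq.1 cq.2) cq.2 hP hc.hq u z)) ≤ cd)
    (hH : ∀ (u u' : ↥(Box d ℓ (fin D cq.1 cq.2)
        (fun ν => (ℓ + 1) * cubeM' (MhP ℓ Mh cq.1 (fin D cq.1 cq.2)) (Pj ℓ k P cq.1) cq.2 ν))), u'.1 ≠ u.1 →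
      ∑ z, |((((ℓ + 1) ^ fin D cq.1 cq.2 : ℕ) : ℝ) / supNorm (u'.1 - u.1)) ^ α
            * ((((ℓ + 1) ^ fin D cq.1 cq.2 : ℕ) : ℝ)
              * ((cG D a c cq.1 (fin D cq.1 cq.2) cq.2 hP hc.hq u' (fwd _ μ z) - cG D a c cq.1 (fin D cq.1 cq.2) cq.2 hP hc.hq u' z)
                - (cG D a c cq.1 (fin D cq.1 cq.2) cq.2 hP hc.hq u (fwd _ μ z)
                  - cG D a c cq.1 (fin D cq.1 cq.2) cq.2 hP hc.hq u z)))|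
          * Real.exp (δ₃ * min (supNorm (u.1 - z.1)) (supNorm (u'.1 - z.1)) / (((ℓ + 1) ^ fin D cq.1 cq.2 : ℕ) : ℝ))
        ≤ cH)
    (lam : ↥(boxDom (N0 ℓ Mh k P)) → ℝ) {F Dd : ℝ} (hF0 : 0 ≤ F)
    (hF : ∀ b', |lam (castP (fin_data hc).2.1 hc.hj.2 (embC D hP cq hc b'))| ≤ F)
    {x xh : ↥(boxDom (N0 ℓ Mh k P))}
    {b bh : ↥(Box d ℓ (fin D cq.1 cq.2)
      (fun ν => (ℓ + 1) * cubeM' (MhP ℓ Mh cq.1 (fin D cq.1 cq.2)) (Pj ℓ k P cq.1) cq.2 ν))}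
    (hb : embC D hP cq hc b = (castP (ℓ := ℓ) (Mh := Mh) (P := P) (fin_data hc).2.1 hc.hj.2).symm x)
    (hbh : embC D hP cq hc bh = (castP (ℓ := ℓ) (Mh := Mh) (P := P) (fin_data hc).2.1 hc.hj.2).symm xh)
    (hne : bh.1 ≠ b.1) (hnear : supNorm (bh.1 - b.1) + 1 ≤ 2 * (((ℓ + 1) ^ fin D cq.1 cq.2 : ℕ) : ℝ))
    (hDb : ∀ b', lam (castP (fin_data hc).2.1 hc.hj.2 (embC D hP cq hc b')) ≠ 0 → Dd ≤ supNorm (b.1 - b'.1))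
    (hDbh : ∀ b', lam (castP (fin_data hc).2.1 hc.hj.2 (embC D hP cq hc b')) ≠ 0 → Dd ≤ supNorm (bh.1 - b'.1)) :
    (supNorm (bh.1 - b.1)) ^ (-α)
        * |∑ x', (colKer D a c hP cq hc μ xh x' - colKer D a c hP cq hc μ x x') * lam x'|
      ≤ ((d + 1) * ((d + 1) * D1 hprof) * (Real.exp δ * Real.exp δ) * cd
            * ((supNorm (bh.1 - b.1)) ^ (-α) * supNorm (bh.1 - b.1))
            * ((((ℓ + 1) ^ fin D cq.1 cq.2 : ℕ) : ℝ) / (((ℓ + 1) ^ cq.1 : ℕ) : ℝ))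
          + (((ℓ + 1) ^ fin D cq.1 cq.2 : ℕ) : ℝ) ^ (1 - α) * cH)
        * Real.exp (-(δ * Dd / (((ℓ + 1) ^ fin D cq.1 cq.2 : ℕ) : ℝ))) * F := by
  obtain ⟨hi1, hij, hji, -, -⟩ := fin_data hc
  have hjk := hc.hj.2
  have hD1 := D1_nonneg contDiff_hprof hasCompactSupport_hprof
  have hn1' : 1 ≤ (ℓ + 1) ^ fin D cq.1 cq.2 := Nat.one_le_pow _ _ (by omega)
  obtain ⟨nn, hnn⟩ : ∃ t : ℝ, t = (((ℓ + 1) ^ fin D cq.1 cq.2 : ℕ) : ℝ) := ⟨_, rfl⟩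
  have hncast : nn = ((ℓ : ℝ) + 1) ^ fin D cq.1 cq.2 := by rw [hnn]; push_cast; ring
  have hn1 : (1 : ℝ) ≤ nn := by rw [hnn]; exact_mod_cast hn1'
  have hn0 : (0 : ℝ) < nn := lt_of_lt_of_le one_pos hn1
  rw [← hnn] at hnear hH ⊢
  obtain ⟨s, hs⟩ : ∃ t : ℝ, t = supNorm (bh.1 - b.1) := ⟨_, rfl⟩
  have hs1 : 1 ≤ s := by rw [hs]; exact B4StripSumsHolder.one_le_supNorm (sub_ne_zero.2 hne)
  have hs0 : 0 < s := lt_of_lt_of_le one_pos hs1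
  rw [← hs] at hnear ⊢
  have hW0 : 0 ≤ s ^ (-α) := Real.rpow_nonneg hs0.le _
  obtain ⟨Nj, hNj⟩ : ∃ t : ℝ, t = (((ℓ + 1) ^ cq.1 : ℕ) : ℝ) := ⟨_, rfl⟩
  rw [← hNj]
  have hNj1' : 1 ≤ (ℓ + 1) ^ cq.1 := Nat.one_le_pow _ _ (by omega)
  have hNj1 : (1 : ℝ) ≤ Nj := by rw [hNj]; exact_mod_cast hNj1'
  have hNj0 : 0 < Nj := lt_of_lt_of_le one_pos hNj1
  have hM1 : 1 ≤ (ℓ + 1) * Mh := Nat.one_le_iff_ne_zero.2 (Nat.mul_ne_zero_iff.2 ⟨by omega, by omega⟩)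
  have hzval : ∀ w : ↥(boxDom (N0 ℓ Mh k P)), ((castP (ℓ := ℓ) (Mh := Mh) (P := P) hij hjk).symm w).1 = w.1 :=
    fun w => by unfold castP; exact boxCast_symm_apply_val _ _
  have hbx : (embC D hP cq hc b).1 = x.1 := by rw [hb, hzval]
  have hbhx : (embC D hP cq hc bh).1 = xh.1 := by rw [hbh, hzval]
  obtain ⟨Gc, hGc⟩ : ∃ T, T = cG D a c cq.1 (fin D cq.1 cq.2) cq.2 hP hc.hq := ⟨_, rfl⟩
  rw [← hGc] at h243d hH
  -- the two pointwise majorants on the cube image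
  obtain ⟨r₂, hr₂⟩ : ∃ f : ↥(Box d ℓ (fin D cq.1 cq.2)
      (fun ν => (ℓ + 1) * cubeM' (MhP ℓ Mh cq.1 (fin D cq.1 cq.2)) (Pj ℓ k P cq.1) cq.2 ν)) → ℝ,
      f = fun b' => (d + 1) * D1 hprof / Nj * (s ^ (-α) * (nn * nn)) * (Gc bh b' - Gc b b') := ⟨_, rfl⟩
  obtain ⟨r₃, hr₃⟩ : ∃ f : ↥(Box d ℓ (fin D cq.1 cq.2)
      (fun ν => (ℓ + 1) * cubeM' (MhP ℓ Mh cq.1 (fin D cq.1 cq.2)) (Pj ℓ k P cq.1) cq.2 ν)) → ℝ,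
      f = fun b' => s ^ (-α) * (nn * nn) * ((Gc bh (fwd _ μ b') - Gc bh b') - (Gc b (fwd _ μ b') - Gc b b')) :=
    ⟨_, rfl⟩
  have hpt : ∀ b', |s ^ (-α) * (colKer D a c hP cq hc μ xh (castP (fin_data hc).2.1 hc.hj.2 (embC D hP cq hc b'))
      - colKer D a c hP cq hc μ x (castP (fin_data hc).2.1 hc.hj.2 (embC D hP cq hc b')))| ≤ |r₂ b'| + |r₃ b'| := by
    intro b'
    set x' : ↥(boxDom (N0 ℓ Mh k P)) := castP (fin_data hc).2.1 hc.hj.2 (embC D hP cq hc b') with hx'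
    have hb' : embC D hP cq hc b' = (castP (ℓ := ℓ) (Mh := Mh) (P := P) hij hjk).symm x' := by
      rw [hx', Equiv.symm_apply_apply]
    have hx'val : x'.1 = (embC D hP cq hc b').1 := by rw [hx']; unfold castP; exact boxCast_apply_val _ _
    unfold colKer
    by_cases hxe : x'.1 + Pi.single μ 1 ∈ boxDom (N0 ℓ Mh k P)
    swap
    · rw [dif_neg hxe, dif_neg hxe, sub_zero, mul_zero, abs_zero]; positivity
    rw [dif_pos hxe, dif_pos hxe, gX_apply_img hP cq hc hbh hb', gX_apply_img hP cq hc hb hb', ← hGc]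
    have hn2eq : ((((ℓ : ℝ) + 1)) ^ fin D cq.1 cq.2) ^ 2 = nn * nn := by rw [hncast]; ring
    rw [hn2eq]
    -- `|∂h| ≤ (d+1)D₁/N_j`
    have hdu : |uX (ℓ := ℓ) (Mh := Mh) (k := k) (P := P) cq ⟨x'.1 + Pi.single μ 1, hxe⟩
        - uX (ℓ := ℓ) (Mh := Mh) (k := k) (P := P) cq x'| ≤ (d + 1) * D1 hprof / Nj := by
      have h := abs_hq_sub_le (d := d) hNj1' hM1 cq.2 x'.1 (x'.1 + Pi.single μ 1)
      have hsn : supNorm (x'.1 + Pi.single μ 1 - x'.1) ≤ 1 := by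
        rw [add_sub_cancel_left]; exact supNorm_single_le μ
      have hMr : (1 : ℝ) ≤ (((ℓ + 1) * Mh : ℕ) : ℝ) := by exact_mod_cast hM1
      have hA0 : 0 ≤ (d + 1) * D1 hprof / (((ℓ + 1) * Mh : ℕ) : ℝ) := by positivity
      have h5 : (d + 1) * D1 hprof / (((ℓ + 1) * Mh : ℕ) : ℝ) * supNorm (x'.1 + Pi.single μ 1 - x'.1)
          ≤ (d + 1) * D1 hprof :=
        calc (d + 1) * D1 hprof / (((ℓ + 1) * Mh : ℕ) : ℝ) * supNorm (x'.1 + Pi.single μ 1 - x'.1)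
            ≤ (d + 1) * D1 hprof / (((ℓ + 1) * Mh : ℕ) : ℝ) * 1 := mul_le_mul_of_nonneg_left hsn hA0
          _ = (d + 1) * D1 hprof / (((ℓ + 1) * Mh : ℕ) : ℝ) := mul_one _
          _ ≤ (d + 1) * D1 hprof := div_le_self (by positivity) hMr
      rw [← hNj] at h
      exact h.trans (div_le_div_of_nonneg_right h5 hNj0.le)
    -- the second bracket: zero unless `h(x′+e) ≠ 0`, in which case `x′+e` is the image of `fwd b′`
    have hp2 : |s ^ (-α) * (uX (ℓ := ℓ) (Mh := Mh) (k := k) (P := P) cq ⟨x'.1 + Pi.single μ 1, hxe⟩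
        * ((gX D a c hP cq hc xh ⟨x'.1 + Pi.single μ 1, hxe⟩ - nn * nn * Gc bh b')
          - (gX D a c hP cq hc x ⟨x'.1 + Pi.single μ 1, hxe⟩ - nn * nn * Gc b b')))| ≤ |r₃ b'| := by
      by_cases hu : uX (ℓ := ℓ) (Mh := Mh) (k := k) (P := P) cq ⟨x'.1 + Pi.single μ 1, hxe⟩ = 0
      · rw [hu, zero_mul, mul_zero, abs_zero]; exact abs_nonneg _
      obtain ⟨be, hbe⟩ := img_of_uX_ne_zero hℓ hP hMh cq hc hu (Or.inr rfl)
      have hbeval : (embC D hP cq hc be).1 = x'.1 + Pi.single μ 1 := by rw [hbe, hzval]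
      have hbe1 : be.1 = b'.1 + Pi.single μ 1 := by
        have h1 : (embC D hP cq hc be).1 - (embC D hP cq hc b').1 = be.1 - b'.1 := by
          unfold embC; exact emb_sub_emb _ hc.hq be b'
        rw [hbeval, ← hx'val, add_sub_cancel_left, eq_comm, sub_eq_iff_eq_add'] at h1
        exact h1
      have hfwd : fwd _ μ b' = be := fwd_eq_of_nbr μ b' be hbe1
      rw [gX_apply_img hP cq hc hbh hbe, gX_apply_img hP cq hc hb hbe, ← hGc, hn2eq, hr₃]
      dsimp only
      rw [hfwd]
      have huXe : |uX (ℓ := ℓ) (Mh := Mh) (k := k) (P := P) cq ⟨x'.1 + Pi.single μ 1, hxe⟩| ≤ 1 :=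
        abs_hq_le_one _ _ _ _
      have e : s ^ (-α) * (uX (ℓ := ℓ) (Mh := Mh) (k := k) (P := P) cq ⟨x'.1 + Pi.single μ 1, hxe⟩
          * ((nn * nn * Gc bh be - nn * nn * Gc bh b') - (nn * nn * Gc b be - nn * nn * Gc b b')))
          = uX (ℓ := ℓ) (Mh := Mh) (k := k) (P := P) cq ⟨x'.1 + Pi.single μ 1, hxe⟩
            * (s ^ (-α) * (nn * nn) * ((Gc bh be - Gc bh b') - (Gc b be - Gc b b'))) := by ring
      rw [e, abs_mul]
      calc |uX cq ⟨x'.1 + Pi.single μ 1, hxe⟩| * |s ^ (-α) * (nn * nn) * ((Gc bh be - Gc bh b') - (Gc b be - Gc b b'))|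
          ≤ 1 * |s ^ (-α) * (nn * nn) * ((Gc bh be - Gc bh b') - (Gc b be - Gc b b'))| :=
            mul_le_mul_of_nonneg_right huXe (abs_nonneg _)
        _ = _ := one_mul _
    have hp1 : |s ^ (-α) * ((uX (ℓ := ℓ) (Mh := Mh) (k := k) (P := P) cq ⟨x'.1 + Pi.single μ 1, hxe⟩
        - uX (ℓ := ℓ) (Mh := Mh) (k := k) (P := P) cq x') * (nn * nn * Gc bh b' - nn * nn * Gc b b'))| ≤ |r₂ b'| := by
      rw [hr₂]
      dsimp only
      have e : s ^ (-α) * ((uX (ℓ := ℓ) (Mh := Mh) (k := k) (P := P) cq ⟨x'.1 + Pi.single μ 1, hxe⟩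
          - uX (ℓ := ℓ) (Mh := Mh) (k := k) (P := P) cq x') * (nn * nn * Gc bh b' - nn * nn * Gc b b'))
          = (uX (ℓ := ℓ) (Mh := Mh) (k := k) (P := P) cq ⟨x'.1 + Pi.single μ 1, hxe⟩
            - uX (ℓ := ℓ) (Mh := Mh) (k := k) (P := P) cq x') * (s ^ (-α) * (nn * nn) * (Gc bh b' - Gc b b')) := by
        ring
      have er : (d + 1) * D1 hprof / Nj * (s ^ (-α) * (nn * nn)) * (Gc bh b' - Gc b b')
          = ((d + 1) * D1 hprof / Nj) * (s ^ (-α) * (nn * nn) * (Gc bh b' - Gc b b')) := by ring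
      rw [e, abs_mul, er, abs_mul ((d + 1) * D1 hprof / Nj),
        abs_of_nonneg (by positivity : (0 : ℝ) ≤ (d + 1) * D1 hprof / Nj)]
      exact mul_le_mul_of_nonneg_right hdu (abs_nonneg _)
    have esplit : s ^ (-α) * ((uX (ℓ := ℓ) (Mh := Mh) (k := k) (P := P) cq ⟨x'.1 + Pi.single μ 1, hxe⟩
          - uX (ℓ := ℓ) (Mh := Mh) (k := k) (P := P) cq x') * (nn * nn * Gc bh b')
        + uX (ℓ := ℓ) (Mh := Mh) (k := k) (P := P) cq ⟨x'.1 + Pi.single μ 1, hxe⟩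
          * (gX D a c hP cq hc xh ⟨x'.1 + Pi.single μ 1, hxe⟩ - nn * nn * Gc bh b')
        - ((uX (ℓ := ℓ) (Mh := Mh) (k := k) (P := P) cq ⟨x'.1 + Pi.single μ 1, hxe⟩
          - uX (ℓ := ℓ) (Mh := Mh) (k := k) (P := P) cq x') * (nn * nn * Gc b b')
        + uX (ℓ := ℓ) (Mh := Mh) (k := k) (P := P) cq ⟨x'.1 + Pi.single μ 1, hxe⟩
          * (gX D a c hP cq hc x ⟨x'.1 + Pi.single μ 1, hxe⟩ - nn * nn * Gc b b')))
        = s ^ (-α) * ((uX (ℓ := ℓ) (Mh := Mh) (k := k) (P := P) cq ⟨x'.1 + Pi.single μ 1, hxe⟩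
            - uX (ℓ := ℓ) (Mh := Mh) (k := k) (P := P) cq x') * (nn * nn * Gc bh b' - nn * nn * Gc b b'))
          + s ^ (-α) * (uX (ℓ := ℓ) (Mh := Mh) (k := k) (P := P) cq ⟨x'.1 + Pi.single μ 1, hxe⟩
            * ((gX D a c hP cq hc xh ⟨x'.1 + Pi.single μ 1, hxe⟩ - nn * nn * Gc bh b')
              - (gX D a c hP cq hc x ⟨x'.1 + Pi.single μ 1, hxe⟩ - nn * nn * Gc b b'))) := by ring
    rw [esplit]
    exact (abs_add_le _ _).trans (add_le_add hp1 hp2)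
  -- the weighted sums of the two majorants
  have hsum2 : ∑ b', |(fun b' => |r₂ b'|) b'| * Real.exp (δ * supNorm (b.1 - b'.1) / nn)
      ≤ (d + 1) * ((d + 1) * D1 hprof) * (Real.exp δ * Real.exp δ) * cd * (s ^ (-α) * s) * (nn / Nj) := by
    have hlong := wsum_longDiff_le hδ hn1' Gc hcd (fun i u ue hue => by
      have h := h243d i u ue hue
      refine (wsum_mono_rate h2 _ _ _).trans ?_
      exact h) b bh (s := 2 * nn) (by rw [← hs]; linarith only [hnear])
    unfold wsum at hlong
    rw [← hnn, ← hs] at hlong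
    have he : Real.exp (δ * (2 * nn) / nn) = Real.exp δ * Real.exp δ := by
      rw [← Real.exp_add]; congr 1; field_simp; ring
    rw [he] at hlong
    have hsplit : ∀ b', |(fun b' => |r₂ b'|) b'| * Real.exp (δ * supNorm (b.1 - b'.1) / nn)
        = (d + 1) * D1 hprof / Nj * (s ^ (-α) * (nn * nn))
          * (|(fun c => Gc bh c - Gc b c) b'| * Real.exp (δ * supNorm (b.1 - b'.1) / nn)) := by
      intro b'
      simp only [abs_abs, hr₂]
      rw [abs_mul, abs_mul, abs_of_nonneg (by positivity : (0 : ℝ) ≤ (d + 1) * D1 hprof / Nj),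
        abs_of_nonneg (by positivity : (0 : ℝ) ≤ s ^ (-α) * (nn * nn))]
      ring
    simp_rw [hsplit]
    rw [← Finset.mul_sum]
    have h0 : 0 ≤ (d + 1) * D1 hprof / Nj * (s ^ (-α) * (nn * nn)) := by positivity
    refine (mul_le_mul_of_nonneg_left hlong h0).trans (le_of_eq ?_)
    field_simp
  have hsum3 : ∑ b', |(fun b' => |r₃ b'|) b'| * Real.exp (δ * min (supNorm (b.1 - b'.1)) (supNorm (bh.1 - b'.1)) / nn)
      ≤ nn ^ (1 - α) * cH := by
    have hHb := hH b bh hne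
    rw [← hs] at hHb
    have hWid : s ^ (-α) * (nn * nn) = nn ^ (1 - α) * ((nn / s) ^ α * nn) := by
      rw [Real.div_rpow hn0.le hs0.le, Real.rpow_neg hs0.le]
      have h1 : nn ^ (1 - α) * nn ^ α = nn := by
        rw [← Real.rpow_add hn0, sub_add_cancel, Real.rpow_one]
      rw [show nn ^ (1 - α) * (nn ^ α / s ^ α * nn) = (nn ^ (1 - α) * nn ^ α) * nn / s ^ α by ring, h1,
        div_eq_mul_inv]
      ring
    have hsplit : ∀ b', |(fun b' => |r₃ b'|) b'| * Real.exp (δ * min (supNorm (b.1 - b'.1)) (supNorm (bh.1 - b'.1)) / nn)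
        = nn ^ (1 - α) * (|(nn / s) ^ α * (nn * ((Gc bh (fwd _ μ b') - Gc bh b') - (Gc b (fwd _ μ b') - Gc b b')))|
          * Real.exp (δ * min (supNorm (b.1 - b'.1)) (supNorm (bh.1 - b'.1)) / nn)) := by
      intro b'
      simp only [abs_abs, hr₃]
      rw [hWid, mul_assoc (nn ^ (1 - α)), abs_mul (nn ^ (1 - α)), abs_of_nonneg (Real.rpow_nonneg hn0.le _)]
      ring
    simp_rw [hsplit]
    rw [← Finset.mul_sum]
    refine mul_le_mul_of_nonneg_left ?_ (Real.rpow_nonneg hn0.le _)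
    refine le_trans (Finset.sum_le_sum fun b' _ => mul_le_mul_of_nonneg_left ?_ (abs_nonneg _)) hHb
    rw [Real.exp_le_exp]
    refine div_le_div_of_nonneg_right (mul_le_mul_of_nonneg_right h3 ?_) hn0.le
    exact le_min (supNorm_nonneg _) (supNorm_nonneg _)
  -- the two decaying sums against `|λ|`
  have hF' : ∀ b', |(fun b' => |lam (castP (fin_data hc).2.1 hc.hj.2 (embC D hP cq hc b'))|) b'| ≤ F := fun b' => by
    simp only [abs_abs]; exact hF b'
  have hDb' : ∀ b', (fun b' => |lam (castP (fin_data hc).2.1 hc.hj.2 (embC D hP cq hc b'))|) b' ≠ 0 →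
      Dd ≤ supNorm (b.1 - b'.1) := fun b' hb' => hDb b' (abs_ne_zero.1 hb')
  have hDmin : ∀ b', (fun b' => |lam (castP (fin_data hc).2.1 hc.hj.2 (embC D hP cq hc b'))|) b' ≠ 0 →
      Dd ≤ min (supNorm (b.1 - b'.1)) (supNorm (bh.1 - b'.1)) := fun b' hb' =>
    le_min (hDb b' (abs_ne_zero.1 hb')) (hDbh b' (abs_ne_zero.1 hb'))
  have hS2 := sum_mul_le_of_wrow hn0 hF0 (fun b' => |r₂ b'|)
    (fun b' => |lam (castP (fin_data hc).2.1 hc.hj.2 (embC D hP cq hc b'))|) (fun b' => supNorm (b.1 - b'.1))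
    hsum2 hF' hDb' hδ
  have hS3 := sum_mul_le_of_wrow hn0 hF0 (fun b' => |r₃ b'|)
    (fun b' => |lam (castP (fin_data hc).2.1 hc.hj.2 (embC D hP cq hc b'))|)
    (fun b' => min (supNorm (b.1 - b'.1)) (supNorm (bh.1 - b'.1))) hsum3 hF' hDmin hδ
  -- the row pair as a sum over the cube
  have hsumx : ∑ x', (colKer D a c hP cq hc μ xh x' - colKer D a c hP cq hc μ x x') * lam x'
      = ∑ b', (colKer D a c hP cq hc μ xh (castP (fin_data hc).2.1 hc.hj.2 (embC D hP cq hc b'))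
          - colKer D a c hP cq hc μ x (castP (fin_data hc).2.1 hc.hj.2 (embC D hP cq hc b')))
          * lam (castP (fin_data hc).2.1 hc.hj.2 (embC D hP cq hc b')) :=
    sum_eq_sum_cube hP cq hc _ fun x' hx' => by
      rw [colKer_off hℓ hP hMh cq hc μ xh x' hx', colKer_off hℓ hP hMh cq hc μ x x' hx', sub_zero, zero_mul]
  rw [hsumx]
  conv_lhs => rw [← abs_of_nonneg hW0, ← abs_mul, Finset.mul_sum]
  calc |∑ b', s ^ (-α) * ((colKer D a c hP cq hc μ xh (castP (fin_data hc).2.1 hc.hj.2 (embC D hP cq hc b'))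
          - colKer D a c hP cq hc μ x (castP (fin_data hc).2.1 hc.hj.2 (embC D hP cq hc b')))
          * lam (castP (fin_data hc).2.1 hc.hj.2 (embC D hP cq hc b')))|
      ≤ ∑ b', |s ^ (-α) * (colKer D a c hP cq hc μ xh (castP (fin_data hc).2.1 hc.hj.2 (embC D hP cq hc b'))
          - colKer D a c hP cq hc μ x (castP (fin_data hc).2.1 hc.hj.2 (embC D hP cq hc b')))|
          * |lam (castP (fin_data hc).2.1 hc.hj.2 (embC D hP cq hc b'))| := by
        refine (Finset.abs_sum_le_sum_abs _ _).trans (le_of_eq (Finset.sum_congr rfl fun b' _ => ?_))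
        rw [← abs_mul]; ring_nf
    _ ≤ ∑ b', (|r₂ b'| + |r₃ b'|) * |lam (castP (fin_data hc).2.1 hc.hj.2 (embC D hP cq hc b'))| :=
        Finset.sum_le_sum fun b' _ => mul_le_mul_of_nonneg_right (hpt b') (abs_nonneg _)
    _ = ∑ b', |r₂ b'| * |lam (castP (fin_data hc).2.1 hc.hj.2 (embC D hP cq hc b'))|
        + ∑ b', |r₃ b'| * |lam (castP (fin_data hc).2.1 hc.hj.2 (embC D hP cq hc b'))| := by
        rw [← Finset.sum_add_distrib]; exact Finset.sum_congr rfl fun b' _ => by ring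
    _ ≤ abs (∑ b', |r₂ b'| * |lam (castP (fin_data hc).2.1 hc.hj.2 (embC D hP cq hc b'))|)
        + abs (∑ b', |r₃ b'| * |lam (castP (fin_data hc).2.1 hc.hj.2 (embC D hP cq hc b'))|) :=
        add_le_add (le_abs_self _) (le_abs_self _)
    _ ≤ (d + 1) * ((d + 1) * D1 hprof) * (Real.exp δ * Real.exp δ) * cd * (s ^ (-α) * s) * (nn / Nj)
          * Real.exp (-(δ * Dd / nn)) * F
        + nn ^ (1 - α) * cH * Real.exp (-(δ * Dd / nn)) * F := add_le_add hS2 hS3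
    _ = ((d + 1) * ((d + 1) * D1 hprof) * (Real.exp δ * Real.exp δ) * cd * (s ^ (-α) * s) * (nn / Nj)
          + nn ^ (1 - α) * cH) * Real.exp (-(δ * Dd / nn)) * F := by ring

set_option maxHeartbeats 1600000 in
/-- **ONE TERM OF `G′₀ᵀ∂ᵀ` OVER A PAIR OF ROWS IN ONE BLOCK** (the per-term input of the fifth entry of (2.67) for the
`k`-level operator): uniformly in the lineage, for every `α ∈ [0,1)` there are `δ₅, Q > 0` with
`|x̂−x|_∞^{−α}·|((v_□G′(□)h_□∂ᵀ)λ)(x̂) − ((v_□G′(□)h_□∂ᵀ)λ)(x)| ≤ (L^{j})^{1−α}·Q·e^{−δ₅d(y,y′)/(d+1)}·sup|λ|`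
for `x ≠ x̂` in one `j`-block `y` and `λ` supported in the block `y′` — near pairs (`|x̂−x| + 1 ≤ 2L^{i_□}`) by the
product rule `(v_□(x̂) − v_□(x))·core(x̂) + v_□(x)·(core(x̂) − core(x))` (`core_le`, `core_pair_le`,
`|v_□(x̂) − v_□(x)| ≤ (d+1)D₁|x̂−x|/L^{j_□}`), far pairs by two single rows (`aXt_row_le`) and
`|x̂−x|^{−α}L^{j} ≤ L·(L^{j})^{1−α}`.
[cite: Balaban1984PropagatorsII, Proposition 2.2 (2.67) p.234 (fifth entry), (2.43) p.230; Balaban1983RegularityDecay,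
Theorem (1.9) p.573] -/
theorem aXt_dd_le (d ℓ : ℕ) (hℓ : 1 ≤ ℓ) (aminus aplus a2minus a2plus : ℝ) (ha : 0 < aminus) (ha2 : 0 < a2minus)
    (α : ℝ) (hα0 : 0 ≤ α) (hα1 : α < 1) :
    ∃ δ₅ Q : ℝ, 0 < δ₅ ∧ 0 < Q ∧ ∀ (k Mh R : ℕ), 3 ≤ Mh → 2 * (ℓ + 1) ≤ R →
      ∀ (P : Fin (d + 1) → ℕ) (hP : ∀ μ, 1 ≤ P μ) (D : Domains d ℓ Mh k P R) (a c : ℕ → ℝ),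
        (∀ i, 1 ≤ i → aminus ≤ a i ∧ a i ≤ aplus) → (∀ i, 1 ≤ i → a2minus ≤ c i ∧ c i ≤ a2plus) →
        ∀ (μ : Fin (d + 1)) (y' : ↥(bset D)) (lam : ↥(boxDom (N0 ℓ Mh k P)) → ℝ) (B : ℝ),
          BlockSupp (g := geom D) (blkOf D) lam y' B →
          ∀ (x x' : ↥(boxDom (N0 ℓ Mh k P))), x'.1 ≠ x.1 → blkOf D x' = blkOf D x →
          ∀ (cq : ℕ × (Fin (d + 1) → ℤ)) (hc : CubeData D cq),
            (supNorm (x'.1 - x.1)) ^ (-α)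
                * |((((aX D a c hP cq hc)ᵀ * (dMat (N0 ℓ Mh k P) μ)ᵀ) *ᵥ lam) x'
                    - (((aX D a c hP cq hc)ᵀ * (dMat (N0 ℓ Mh k P) μ)ᵀ) *ᵥ lam) x)|
              ≤ (((ℓ : ℝ) + 1) ^ D.lev x.1) ^ (1 - α)
                * (Q * Real.exp (-(δ₅ / (d + 1) * (geom D).dist (blkOf D x) y')) * B) := by
  obtain ⟨δ'', c', hδ'', hc', h243⟩ := ineq243_twoLevel_roww d ℓ hℓ aminus aplus 0 a2minus a2plus ha ha2
  obtain ⟨δs, cs, hδs, hcs, h243s⟩ := ineq243_twoLevel_dstar_roww d ℓ hℓ aminus aplus 0 a2minus a2plus ha ha2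
  obtain ⟨δd, cd, hδd, hcd, h243d⟩ := ineq243_twoLevel_deriv_wsum d ℓ hℓ aminus aplus 0 a2minus a2plus ha ha2
  obtain ⟨δH, cH, hδH, hcH, hH⟩ :=
    ineq243_twoLevel_holderDual_wsum2 d ℓ hℓ aminus aplus 0 a2minus a2plus ha ha2 α hα0 hα1
  have hD1 := D1_nonneg contDiff_hprof hasCompactSupport_hprof
  obtain ⟨δ₅, hδ₅⟩ : ∃ t : ℝ, t = min (min δ'' δs) (min δd δH) := ⟨_, rfl⟩
  have hδ₅pos : 0 < δ₅ := by rw [hδ₅]; exact lt_min (lt_min hδ'' hδs) (lt_min hδd hδH)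
  have h51 : δ₅ ≤ δ'' := by rw [hδ₅]; exact (min_le_left _ _).trans (min_le_left _ _)
  have h52 : δ₅ ≤ δs := by rw [hδ₅]; exact (min_le_left _ _).trans (min_le_right _ _)
  have h53 : δ₅ ≤ δd := by rw [hδ₅]; exact (min_le_right _ _).trans (min_le_left _ _)
  have h54 : δ₅ ≤ δH := by rw [hδ₅]; exact (min_le_right _ _).trans (min_le_right _ _)
  obtain ⟨Q'', hQ''⟩ : ∃ t : ℝ, t = (d + 1) * D1 hprof * c' + cs := ⟨_, rfl⟩
  have hQ''0 : 0 ≤ Q'' := by rw [hQ'']; have := hc'.le; have := hcs.le; positivity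
  obtain ⟨EE, hEE⟩ : ∃ t : ℝ, t = Real.exp δ₅ * Real.exp δ₅ := ⟨_, rfl⟩
  have hEE1 : 1 ≤ EE := by
    rw [hEE]; have h1 : (1 : ℝ) ≤ Real.exp δ₅ := Real.one_le_exp hδ₅pos.le; nlinarith
  have hEE0 : 0 ≤ EE := zero_le_one.trans hEE1
  obtain ⟨Qp, hQp⟩ : ∃ t : ℝ, t = ((d + 1) * ((d + 1) * D1 hprof) * EE * cd + cH) * EE := ⟨_, rfl⟩
  have hQp0 : 0 ≤ Qp := by rw [hQp]; have := hcd.le; have := hcH.le; positivity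
  refine ⟨δ₅, (d + 1) * D1 hprof * (Q'' * EE) + Qp + 2 * ((ℓ : ℝ) + 1) * (Q'' * EE) + 1, hδ₅pos, by positivity, ?_⟩
  intro k Mh R hMh hR P hP D a c haw hcw μ y' lam B hlam x x' hne hblk cq hc
  obtain ⟨hi1, hij, hji, -, -⟩ := fin_data hc
  have hjk := hc.hj.2
  have hMh1 : 1 ≤ Mh := le_trans (by norm_num) hMh
  have hL1 : (1 : ℝ) ≤ (ℓ : ℝ) + 1 := by linarith [(Nat.cast_nonneg ℓ : (0 : ℝ) ≤ ℓ)]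
  have hB0 : 0 ≤ B := hlam.nonneg
  have hlamB : ∀ w, |lam w| ≤ B := fun w => BlockSupp.abs_le hlam w
  obtain ⟨dist0, hdist0⟩ : ∃ t : ℝ, t = (((bond D).dist (blkOf D x) y' : ℕ) : ℝ) := ⟨_, rfl⟩
  have hgeom : (geom D).dist (blkOf D x) y' = dist0 := by rw [hdist0]; rfl
  have hgeom' : (geom D).dist (blkOf D x') y' = dist0 := by rw [hblk, hgeom]
  have hdist0nn : 0 ≤ dist0 := by rw [hdist0]; positivity
  rw [hgeom]
  obtain ⟨E5, hE5⟩ : ∃ t : ℝ, t = Real.exp (-(δ₅ / (d + 1) * dist0)) := ⟨_, rfl⟩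
  rw [← hE5]
  have hE50 : 0 ≤ E5 := by rw [hE5]; exact (Real.exp_pos _).le
  obtain ⟨LJ, hLJ⟩ : ∃ t : ℝ, t = ((ℓ : ℝ) + 1) ^ D.lev x.1 := ⟨_, rfl⟩
  rw [← hLJ]
  have hLJ0 : 0 < LJ := by rw [hLJ]; positivity
  have hLJα0 : 0 ≤ LJ ^ (1 - α) := Real.rpow_nonneg hLJ0.le _
  have hRHS0 : 0 ≤ LJ ^ (1 - α)
      * (((d + 1) * D1 hprof * (Q'' * EE) + Qp + 2 * ((ℓ : ℝ) + 1) * (Q'' * EE) + 1) * E5 * B) := by positivity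
  obtain ⟨s, hs⟩ : ∃ t : ℝ, t = supNorm (x'.1 - x.1) := ⟨_, rfl⟩
  have hs1 : 1 ≤ s := by rw [hs]; exact B4StripSumsHolder.one_le_supNorm (sub_ne_zero.2 hne)
  have hs0 : 0 < s := lt_of_lt_of_le one_pos hs1
  rw [← hs]
  have hW0 : 0 ≤ s ^ (-α) := Real.rpow_nonneg hs0.le _
  -- the trivial case: `h_□` vanishes at both points
  by_cases h0 : uX (ℓ := ℓ) (Mh := Mh) (k := k) (P := P) cq x = 0 ∧ uX (ℓ := ℓ) (Mh := Mh) (k := k) (P := P) cq x' = 0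
  · rw [aXt_dMatt_mulVec hP cq hc μ lam x, aXt_dMatt_mulVec hP cq hc μ lam x', vX_eq_zero_of_uX cq h0.1,
      vX_eq_zero_of_uX cq h0.2]
    simp only [zero_mul, sub_self, abs_zero, mul_zero]
    exact hRHS0
  have hu : uX (ℓ := ℓ) (Mh := Mh) (k := k) (P := P) cq x ≠ 0 ∨ uX (ℓ := ℓ) (Mh := Mh) (k := k) (P := P) cq x' ≠ 0 := by
    by_contra h'; push Not at h'; exact h0 ⟨h'.1, h'.2⟩
  -- the level window at `x`
  have hlevx' : D.lev x'.1 = D.lev x.1 := congrArg (fun s : ↥(bset D) => s.1.1) hblk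
  have hzval : ∀ w : ↥(boxDom (N0 ℓ Mh k P)), ((castP (ℓ := ℓ) (Mh := Mh) (P := P) hij hjk).symm w).1 = w.1 :=
    fun w => by unfold castP; exact boxCast_symm_apply_val _ _
  have hinc : ∀ (w : ↥(boxDom (N0 ℓ Mh k P))) (bw : ↥(Box d ℓ (fin D cq.1 cq.2)
      (fun ν => (ℓ + 1) * cubeM' (MhP ℓ Mh cq.1 (fin D cq.1 cq.2)) (Pj ℓ k P cq.1) cq.2 ν))),
      embC D hP cq hc bw = (castP (ℓ := ℓ) (Mh := Mh) (P := P) hij hjk).symm w → InCube ℓ Mh k P cq.1 cq.2 w.1 :=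
    fun w bw hbw => by rw [← hzval w]; exact (inCube_iff_exists_emb (Mh := Mh) hP hij hc.hq _).2 ⟨bw, hbw⟩
  have hwin : fin D cq.1 cq.2 ≤ D.lev x.1 ∧ D.lev x.1 ≤ fin D cq.1 cq.2 + 1 := by
    rcases hu with h | h
    · obtain ⟨bw, hbw⟩ := img_of_uX_ne_zero hℓ hP hMh1 cq hc h (Or.inr rfl)
      exact lev_window_of_inCube hℓ hR hP hMh1 hc x.2 (hinc x bw hbw)
    · obtain ⟨bw, hbw⟩ := img_of_uX_ne_zero hℓ hP hMh1 cq hc h (Or.inr rfl)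
      rw [← hlevx']; exact lev_window_of_inCube hℓ hR hP hMh1 hc x'.2 (hinc x' bw hbw)
  obtain ⟨nn, hnn⟩ : ∃ t : ℝ, t = (((ℓ + 1) ^ fin D cq.1 cq.2 : ℕ) : ℝ) := ⟨_, rfl⟩
  have hncast : nn = ((ℓ : ℝ) + 1) ^ fin D cq.1 cq.2 := by rw [hnn]; push_cast; ring
  have hn1' : 1 ≤ (ℓ + 1) ^ fin D cq.1 cq.2 := Nat.one_le_pow _ _ (by omega)
  have hn1 : (1 : ℝ) ≤ nn := by rw [hnn]; exact_mod_cast hn1'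
  have hn0 : (0 : ℝ) < nn := lt_of_lt_of_le one_pos hn1
  have hnLJ : nn ≤ LJ := by rw [hncast, hLJ]; exact pow_le_pow_right₀ hL1 hwin.1
  have hT : LJ ≤ ((ℓ : ℝ) + 1) * nn := by
    rw [hLJ, hncast, ← pow_succ']; exact pow_le_pow_right₀ hL1 hwin.2
  obtain ⟨Nj, hNj⟩ : ∃ t : ℝ, t = (((ℓ + 1) ^ cq.1 : ℕ) : ℝ) := ⟨_, rfl⟩
  have hNj1' : 1 ≤ (ℓ + 1) ^ cq.1 := Nat.one_le_pow _ _ (by omega)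
  have hNj0 : 0 < Nj := by rw [hNj]; exact_mod_cast hNj1'
  have hnNj : nn ≤ Nj := by
    rw [hnn, hNj]; exact_mod_cast Nat.pow_le_pow_right (by omega) hij
  have hM1 : 1 ≤ (ℓ + 1) * Mh := Nat.one_le_iff_ne_zero.2 (Nat.mul_ne_zero_iff.2 ⟨by omega, by omega⟩)
  -- the per-cube inputs
  have hcM' : ∀ ν, 1 ≤ cubeM' (MhP ℓ Mh cq.1 (fin D cq.1 cq.2)) (Pj ℓ k P cq.1) cq.2 ν := fun ν =>
    Nat.one_le_iff_ne_zero.2 (Nat.mul_ne_zero_iff.2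
      ⟨by have := one_le_MhP (ℓ := ℓ) hMh1 cq.1 (fin D cq.1 cq.2); omega,
        by have := (one_le_cubeW (one_le_Pj hP cq.1) hc.hq ν).1; omega⟩)
  have h243c : ∀ b, roww δ'' ((ℓ + 1) ^ fin D cq.1 cq.2) (cG D a c cq.1 (fin D cq.1 cq.2) cq.2 hP hc.hq) b ≤ c' :=
    fun b => h243 (fin D cq.1 cq.2) hi1 (a (fin D cq.1 cq.2)) 0 (c (fin D cq.1 cq.2)) (haw _ hi1).1 (haw _ hi1).2
      le_rfl le_rfl (hcw _ hi1).1 (hcw _ hi1).2 _ hcM' _ b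
  have h243sc : ∀ b, roww δs ((ℓ + 1) ^ fin D cq.1 cq.2)
      (dstar ((ℓ + 1) ^ fin D cq.1 cq.2) μ (cG D a c cq.1 (fin D cq.1 cq.2) cq.2 hP hc.hq)) b ≤ cs :=
    fun b => h243s (fin D cq.1 cq.2) hi1 (a (fin D cq.1 cq.2)) 0 (c (fin D cq.1 cq.2)) (haw _ hi1).1 (haw _ hi1).2
      le_rfl le_rfl (hcw _ hi1).1 (hcw _ hi1).2 _ hcM'
      (lamLoc ℓ (MhP ℓ Mh cq.1 (fin D cq.1 cq.2)) (Pj ℓ k P cq.1) cq.2 (one_le_Pj hP cq.1) hc.hq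
        (LamG D cq.1 (fin D cq.1 cq.2))) μ b
  have hrow := aXt_row_le (a := a) (c := c) hℓ hR hP hMh1 cq hc μ hδ₅pos.le h51 h52 hc'.le hcs.le h243c h243sc
    y' lam B hlam
  have hrowx := hrow x
  have hrowx' := hrow x'
  rw [hgeom, ← hE5, ← hnn, ← hQ'', ← hEE] at hrowx
  rw [hgeom', ← hE5, ← hnn, ← hQ'', ← hEE] at hrowx'
  by_cases hnear : s + 1 ≤ 2 * nn
  · -- NEAR PAIRS: both points lie in the cube image
    obtain ⟨b, b', hb, hb'⟩ : ∃ b b', embC D hP cq hc b = (castP (ℓ := ℓ) (Mh := Mh) (P := P) hij hjk).symm x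
        ∧ embC D hP cq hc b' = (castP (ℓ := ℓ) (Mh := Mh) (P := P) hij hjk).symm x' := by
      have hd1 : supNorm (x'.1 - x.1) ≤ 2 * (((ℓ + 1) ^ fin D cq.1 cq.2 : ℕ) : ℝ) := by
        rw [← hs, ← hnn]; linarith only [hnear]
      have hd2 : supNorm (x.1 - x'.1) ≤ 2 * (((ℓ + 1) ^ fin D cq.1 cq.2 : ℕ) : ℝ) := by
        rw [supNorm_sub_comm]; exact hd1
      have hd0 : ∀ w : ↥(boxDom (N0 ℓ Mh k P)), supNorm (w.1 - w.1) ≤ 2 * (((ℓ + 1) ^ fin D cq.1 cq.2 : ℕ) : ℝ) := by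
        intro w
        have h0 : supNorm (w.1 - w.1) = 0 := by rw [sub_self]; unfold B4ContourShift.supNorm; simp
        rw [h0]; positivity
      rcases hu with h | h
      · obtain ⟨b, hb⟩ := img_of_near hℓ hP hMh cq hc h (hd0 x)
        obtain ⟨b', hb'⟩ := img_of_near hℓ hP hMh cq hc h hd1
        exact ⟨b, b', hb, hb'⟩
      · obtain ⟨b, hb⟩ := img_of_near hℓ hP hMh cq hc h hd2
        obtain ⟨b', hb'⟩ := img_of_near hℓ hP hMh cq hc h (hd0 x')
        exact ⟨b, b', hb, hb'⟩
    have hbx : (embC D hP cq hc b).1 = x.1 := by rw [hb, hzval]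
    have hb'x : (embC D hP cq hc b').1 = x'.1 := by rw [hb', hzval]
    have hsubE : ∀ u v, (embC D hP cq hc u).1 - (embC D hP cq hc v).1 = u.1 - v.1 := fun u v => by
      unfold embC; exact emb_sub_emb _ hc.hq u v
    have hb'b : b'.1 - b.1 = x'.1 - x.1 := by rw [← hsubE b' b, hb'x, hbx]
    have hsb : supNorm (b'.1 - b.1) = s := by rw [hb'b, hs]
    have hneb : b'.1 ≠ b.1 := fun h => hne (by
      have := hb'b; rw [h, sub_self] at this; exact (sub_eq_zero.1 this.symm))
    have hxin : InCube ℓ Mh k P cq.1 cq.2 x.1 := hinc x b hb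
    have hx'in : InCube ℓ Mh k P cq.1 cq.2 x'.1 := hinc x' b' hb'
    -- support distances of `λ` read on the cube, from `x` and from `x̂`
    obtain ⟨Dd, hDd⟩ : ∃ t : ℝ, t = nn * (dist0 / (d + 1) - 1) := ⟨_, rfl⟩
    have hDgen : ∀ (w : ↥(boxDom (N0 ℓ Mh k P))) (bw : ↥(Box d ℓ (fin D cq.1 cq.2)
        (fun ν => (ℓ + 1) * cubeM' (MhP ℓ Mh cq.1 (fin D cq.1 cq.2)) (Pj ℓ k P cq.1) cq.2 ν))),
        (embC D hP cq hc bw).1 = w.1 → InCube ℓ Mh k P cq.1 cq.2 w.1 → (geom D).dist (blkOf D w) y' = dist0 →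
        ∀ z, lam (castP (fin_data hc).2.1 hc.hj.2 (embC D hP cq hc z)) ≠ 0 → Dd ≤ supNorm (bw.1 - z.1) := by
      intro w bw hbw hwin' hwd z hz
      set x'' : ↥(boxDom (N0 ℓ Mh k P)) := castP (fin_data hc).2.1 hc.hj.2 (embC D hP cq hc z) with hx''
      have hx''val : x''.1 = (embC D hP cq hc z).1 := by
        rw [hx'']; unfold castP; exact boxCast_apply_val _ _
      have hx''in : InCube ℓ Mh k P cq.1 cq.2 x''.1 := by
        rw [hx''val]
        exact (inCube_iff_exists_emb (Mh := Mh) hP hij hc.hq _).2 ⟨z, rfl⟩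
      have hblk'' : blkOf D x'' = y' := by
        by_contra hne'
        exact hz (hlam.off x'' hne')
      have h := Dd_le_supNorm hℓ hR hP hMh1 hc w x'' hwin' hx''in y' hblk''
      have hsub : w.1 - x''.1 = bw.1 - z.1 := by rw [hx''val, ← hbw]; exact hsubE bw z
      rw [hsub] at h
      have hd' : (((bond D).dist (blkOf D w) y' : ℕ) : ℝ) = dist0 := hwd
      rw [hd', ← hnn, ← hDd] at h
      exact h
    have hD_b := hDgen x b hbx hxin hgeom
    have hD_b' := hDgen x' b' hb'x hx'in hgeom'
    have hexp : Real.exp (-(δ₅ * Dd / nn)) ≤ EE * E5 := by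
      rw [hDd, hEE, hE5]; exact exp_Dd_le hδ₅pos.le le_rfl hn1 hdist0nn d
    -- the core at `x̂` and the core pair
    have hcore' := core_le (a := a) (c := c) hℓ hP hMh1 cq hc μ hδ₅pos.le h51 h52 h243c h243sc lam hB0
      (fun z => hlamB _) hb' hD_b'
    rw [← hnn, ← hQ''] at hcore'
    have hpair := core_pair_le (a := a) (c := c) hℓ hP hMh1 cq hc μ (α := α) hδ₅pos.le h53 h54 hcd.le
      (fun i u ue hue => h243d (fin D cq.1 cq.2) hi1 (a (fin D cq.1 cq.2)) 0 (c (fin D cq.1 cq.2)) (haw _ hi1).1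
        (haw _ hi1).2 le_rfl le_rfl (hcw _ hi1).1 (hcw _ hi1).2 _ hcM' _ i u ue hue)
      (fun u u' hne' => hH (fin D cq.1 cq.2) hi1 (a (fin D cq.1 cq.2)) 0 (c (fin D cq.1 cq.2))
        (haw _ hi1).1 (haw _ hi1).2 le_rfl le_rfl (hcw _ hi1).1 (hcw _ hi1).2 _ hcM' _ μ u u' hne')
      lam hB0 (fun z => hlamB _) hb hb' hneb (by rw [hsb, ← hnn]; exact hnear) hD_b hD_b'
    rw [hsb, ← hnn, ← hNj, ← hEE] at hpair
    -- the cut-off difference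
    have hdv : |vX D cq x' - vX D cq x| ≤ (d + 1) * D1 hprof * s / Nj := by
      refine (abs_vX_sub_le (D := D) cq hlevx').trans ?_
      have h := abs_hq_sub_le (d := d) hNj1' hM1 cq.2 x.1 x'.1
      rw [← hNj, ← hs] at h
      refine h.trans (div_le_div_of_nonneg_right ?_ hNj0.le)
      have hMr : (1 : ℝ) ≤ (((ℓ + 1) * Mh : ℕ) : ℝ) := by exact_mod_cast hM1
      exact mul_le_mul_of_nonneg_right (div_le_self (by positivity) hMr) hs0.le
    have hvx : |vX D cq x| ≤ 1 := abs_vX_le_one cq x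
    -- the Hölder weights
    have hWs : s ^ (-α) * s ≤ LJ ^ (1 - α) := by
      refine rpow_neg_mul_self_le hs0 ?_ hα1.le
      have h := supNorm_le_of_blkOf_eq (D := D) hblk
      have e : (((ℓ + 1) ^ D.lev x.1 : ℕ) : ℝ) = LJ := by rw [hLJ]; push_cast; ring
      rw [← hs, e] at h
      exact h.trans (sub_le_self _ zero_le_one)
    have hnα : nn ^ (1 - α) ≤ LJ ^ (1 - α) := rpow_one_sub_le hn0.le hnLJ hα1.le
    have hnNj' : nn / Nj ≤ 1 := by rw [div_le_one hNj0]; exact hnNj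
    -- the product rule
    rw [aXt_dMatt_mulVec hP cq hc μ lam x, aXt_dMatt_mulVec hP cq hc μ lam x']
    obtain ⟨Cx, hCx⟩ : ∃ t : ℝ, t = ∑ z, colKer D a c hP cq hc μ x z * lam z := ⟨_, rfl⟩
    obtain ⟨Cx', hCx'⟩ : ∃ t : ℝ, t = ∑ z, colKer D a c hP cq hc μ x' z * lam z := ⟨_, rfl⟩
    have hdiffC : ∑ z, (colKer D a c hP cq hc μ x' z - colKer D a c hP cq hc μ x z) * lam z = Cx' - Cx := by
      rw [hCx, hCx', ← Finset.sum_sub_distrib]; exact Finset.sum_congr rfl fun z _ => by ring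
    rw [hdiffC] at hpair
    rw [← hCx'] at hcore'
    rw [← hCx, ← hCx']
    have e1 : s ^ (-α) * |vX D cq x' * Cx' - vX D cq x * Cx|
        = |s ^ (-α) * (vX D cq x' - vX D cq x) * Cx' + vX D cq x * (s ^ (-α) * (Cx' - Cx))| := by
      rw [← abs_of_nonneg hW0, ← abs_mul, abs_of_nonneg hW0]; ring_nf
    rw [e1]
    have hA : |s ^ (-α) * (vX D cq x' - vX D cq x) * Cx'|
        ≤ (d + 1) * D1 hprof * (Q'' * EE) * (LJ ^ (1 - α) * (E5 * B)) := by
      rw [abs_mul, abs_mul, abs_of_nonneg hW0]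
      calc s ^ (-α) * |vX D cq x' - vX D cq x| * |Cx'|
          ≤ s ^ (-α) * ((d + 1) * D1 hprof * s / Nj) * (nn * Q'' * Real.exp (-(δ₅ * Dd / nn)) * B) :=
            mul_le_mul (mul_le_mul_of_nonneg_left hdv hW0) hcore' (abs_nonneg _) (by positivity)
        _ = (d + 1) * D1 hprof * Q'' * ((s ^ (-α) * s) * (nn / Nj)) * (Real.exp (-(δ₅ * Dd / nn)) * B) := by
            field_simp
        _ ≤ (d + 1) * D1 hprof * Q'' * (LJ ^ (1 - α) * 1) * ((EE * E5) * B) := by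
            refine mul_le_mul (mul_le_mul_of_nonneg_left (mul_le_mul hWs hnNj' (by positivity) hLJα0)
              (by positivity)) (mul_le_mul_of_nonneg_right hexp hB0) (by positivity) (by positivity)
        _ = (d + 1) * D1 hprof * (Q'' * EE) * (LJ ^ (1 - α) * (E5 * B)) := by ring
    have hBterm : |vX D cq x * (s ^ (-α) * (Cx' - Cx))| ≤ Qp * (LJ ^ (1 - α) * (E5 * B)) := by
      rw [abs_mul]
      have hp' : |s ^ (-α) * (Cx' - Cx)|
          ≤ ((d + 1) * ((d + 1) * D1 hprof) * EE * cd * (s ^ (-α) * s) * (nn / Nj) + nn ^ (1 - α) * cH)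
            * Real.exp (-(δ₅ * Dd / nn)) * B := by
        rw [abs_mul, abs_of_nonneg hW0]; exact hpair
      have hcd0 := hcd.le
      have hcH0 := hcH.le
      calc |vX D cq x| * |s ^ (-α) * (Cx' - Cx)|
          ≤ 1 * (((d + 1) * ((d + 1) * D1 hprof) * EE * cd * (s ^ (-α) * s) * (nn / Nj) + nn ^ (1 - α) * cH)
              * Real.exp (-(δ₅ * Dd / nn)) * B) := mul_le_mul hvx hp' (abs_nonneg _) zero_le_one
        _ ≤ 1 * (((d + 1) * ((d + 1) * D1 hprof) * EE * cd * (LJ ^ (1 - α) * 1) + LJ ^ (1 - α) * cH)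
              * (EE * E5) * B) := by
            refine mul_le_mul_of_nonneg_left ?_ zero_le_one
            have hC0 : 0 ≤ (d + 1) * ((d + 1) * D1 hprof) * EE * cd := by positivity
            have h1 : (d + 1) * ((d + 1) * D1 hprof) * EE * cd * (s ^ (-α) * s) * (nn / Nj)
                ≤ (d + 1) * ((d + 1) * D1 hprof) * EE * cd * (LJ ^ (1 - α) * 1) := by
              rw [mul_assoc ((d + 1) * ((d + 1) * D1 hprof) * EE * cd)]
              exact mul_le_mul_of_nonneg_left (mul_le_mul hWs hnNj' (by positivity) hLJα0) hC0
            refine mul_le_mul (mul_le_mul (add_le_add h1 (mul_le_mul_of_nonneg_right hnα hcH0)) hexp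
              (by positivity) (by positivity)) le_rfl hB0 (by positivity)
        _ = Qp * (LJ ^ (1 - α) * (E5 * B)) := by rw [hQp]; ring
    calc |s ^ (-α) * (vX D cq x' - vX D cq x) * Cx' + vX D cq x * (s ^ (-α) * (Cx' - Cx))|
        ≤ (d + 1) * D1 hprof * (Q'' * EE) * (LJ ^ (1 - α) * (E5 * B)) + Qp * (LJ ^ (1 - α) * (E5 * B)) :=
          (abs_add_le _ _).trans (add_le_add hA hBterm)
      _ = LJ ^ (1 - α) * (((d + 1) * D1 hprof * (Q'' * EE) + Qp) * E5 * B) := by ring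
      _ ≤ LJ ^ (1 - α)
          * (((d + 1) * D1 hprof * (Q'' * EE) + Qp + 2 * ((ℓ : ℝ) + 1) * (Q'' * EE) + 1) * E5 * B) := by
          refine mul_le_mul_of_nonneg_left (mul_le_mul_of_nonneg_right (mul_le_mul_of_nonneg_right ?_ hE50) hB0)
            hLJα0
          have : 0 ≤ 2 * ((ℓ : ℝ) + 1) * (Q'' * EE) := by positivity
          linarith
  · -- FAR PAIRS: two single rows
    have hns : nn ≤ s := by push Not at hnear; linarith
    have hWL : s ^ (-α) * LJ ≤ ((ℓ : ℝ) + 1) * LJ ^ (1 - α) := rpow_far_le hn0 hns hLJ0 hT hL1 hα0 hα1.le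
    have hWn : s ^ (-α) * nn ≤ ((ℓ : ℝ) + 1) * LJ ^ (1 - α) := (mul_le_mul_of_nonneg_left hnLJ hW0).trans hWL
    calc s ^ (-α) * |(((aX D a c hP cq hc)ᵀ * (dMat (N0 ℓ Mh k P) μ)ᵀ) *ᵥ lam) x'
            - (((aX D a c hP cq hc)ᵀ * (dMat (N0 ℓ Mh k P) μ)ᵀ) *ᵥ lam) x|
        ≤ s ^ (-α) * (nn * Q'' * EE * E5 * B + nn * Q'' * EE * E5 * B) :=
          mul_le_mul_of_nonneg_left ((abs_sub _ _).trans (add_le_add hrowx' hrowx)) hW0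
      _ = (s ^ (-α) * nn) * (2 * (Q'' * EE) * E5 * B) := by ring
      _ ≤ (((ℓ : ℝ) + 1) * LJ ^ (1 - α)) * (2 * (Q'' * EE) * E5 * B) :=
          mul_le_mul_of_nonneg_right hWn (by positivity)
      _ = LJ ^ (1 - α) * ((2 * ((ℓ : ℝ) + 1) * (Q'' * EE)) * E5 * B) := by ring
      _ ≤ LJ ^ (1 - α)
          * (((d + 1) * D1 hprof * (Q'' * EE) + Qp + 2 * ((ℓ : ℝ) + 1) * (Q'' * EE) + 1) * E5 * B) := by
          refine mul_le_mul_of_nonneg_left (mul_le_mul_of_nonneg_right (mul_le_mul_of_nonneg_right ?_ hE50) hB0)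
            hLJα0
          have : 0 ≤ (d + 1) * D1 hprof * (Q'' * EE) := by positivity
          linarith

end RowPair

/-! ## §4 One term of `Rᵀ` over a pair of COLUMNS (level-weighted input): near pairs, single columns, every pair -/

section ColPair

variable {ℓ Mh k R : ℕ} {P : Fin (d + 1) → ℕ} {D : Domains d ℓ Mh k P R} {a c : ℕ → ℝ}

set_option maxHeartbeats 1600000 in
/-- **THE NEAR PAIRS OF COLUMNS OF ONE TERM OF `R`** (deterministic form): for `x = □-image of b`, `x̂ = □-image of b̂`
(`b̂ ≠ b`, `|b̂−b|_∞ ≤ L^{i_□}`), given the weighted rows `c′`, differenced rows `c_d`, `∂^*`-rows `c_s` of `G′(□)`, the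
COLUMN Hölder clause `c_T` of `G′(□)` at the pair, the Lipschitz/Laplacian sizes `κ₁, κ₂` of `h_□`, the jump
`|v_□(x̂) − v_□(x)| ≤ κ|b̂−b|/L^{i_□}`, and a vector `g` with `|g| ≤ G` on the cube image supported at sup-distance `≥ D`
from `b` and `b̂`:
`|x̂−x|^{−α}·|((K_□(h_□)G′(□)v_□)ᵀg)(x̂) − (…)(x)| ≤ (L^{i_□})^{−α}·A·e^{−δD/L^{i_□}}·G`,
`A = κ₁(1+e^{δ})(d+1)(κc_s + c_T) + (κ₂ + (a+c)Le^{δL}κ₁)(κc′ + 2c′ + (d+1)e^{δ}c_d)` — the column pair is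
`Σ_z (K_□(h_□)u)(z)g(z)` with the two-row vector `u = (L^{i}/|b̂−b|)^α(v(x̂)G′(□)(b̂,·) − v(x)G′(□)(b,·))`
(`B6Prop22DualHolderTwoLevelBox.wsum2_kComm_le`, `cube_pair_wsum2_le`, `cube_pair_diff_wsum2_le`).
[cite: Balaban1984PropagatorsII, (2.38) p.229, (2.40)/(2.44) p.230, (2.64)–(2.67) p.234 (fifth entry)] -/
theorem bXt_pair_near_le (hP : ∀ μ, 1 ≤ P μ) (cq : ℕ × (Fin (d + 1) → ℤ)) (hc : CubeData D cq)
    {α : ℝ} (hα0 : 0 ≤ α) (hα1 : α ≤ 1) {δ c' cd cs cT κ κ₁ κ₂ : ℝ} (hδ : 0 ≤ δ) (hc' : 0 ≤ c') (hcd : 0 ≤ cd)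
    (hκ : 0 ≤ κ) (hκ₁ : 0 ≤ κ₁) (hκ₂ : 0 ≤ κ₂) (haj : 0 < a (fin D cq.1 cq.2)) (hc0 : 0 ≤ c (fin D cq.1 cq.2))
    (hG : ∀ b, roww δ ((ℓ + 1) ^ fin D cq.1 cq.2) (cG D a c cq.1 (fin D cq.1 cq.2) cq.2 hP hc.hq) b ≤ c')
    (hGd : ∀ (i : Fin (d + 1)) (v ve : ↥(Box d ℓ (fin D cq.1 cq.2)
        (fun ν => (ℓ + 1) * cubeM' (MhP ℓ Mh cq.1 (fin D cq.1 cq.2)) (Pj ℓ k P cq.1) cq.2 ν))),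
      ve.1 = v.1 + Pi.single i 1 →
      wsum δ ((ℓ + 1) ^ fin D cq.1 cq.2) v (fun z => (((ℓ + 1) ^ fin D cq.1 cq.2 : ℕ) : ℝ)
        * (cG D a c cq.1 (fin D cq.1 cq.2) cq.2 hP hc.hq ve z - cG D a c cq.1 (fin D cq.1 cq.2) cq.2 hP hc.hq v z)) ≤ cd)
    (hGs : ∀ (μ : Fin (d + 1)) b, roww δ ((ℓ + 1) ^ fin D cq.1 cq.2)
      (dstar ((ℓ + 1) ^ fin D cq.1 cq.2) μ (cG D a c cq.1 (fin D cq.1 cq.2) cq.2 hP hc.hq)) b ≤ cs)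
    (hLip : ∀ z z' : ↥(Box d ℓ (fin D cq.1 cq.2)
        (fun ν => (ℓ + 1) * cubeM' (MhP ℓ Mh cq.1 (fin D cq.1 cq.2)) (Pj ℓ k P cq.1) cq.2 ν)),
      |hLoc ℓ (fin D cq.1 cq.2) (MhP ℓ Mh cq.1 (fin D cq.1 cq.2)) (Pj ℓ k P cq.1) cq.2 z'
          - hLoc ℓ (fin D cq.1 cq.2) (MhP ℓ Mh cq.1 (fin D cq.1 cq.2)) (Pj ℓ k P cq.1) cq.2 z|
        ≤ κ₁ * supNorm (z'.1 - z.1) / (((ℓ + 1) ^ fin D cq.1 cq.2 : ℕ) : ℝ))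
    (hLap : ∀ z : ↥(Box d ℓ (fin D cq.1 cq.2)
        (fun ν => (ℓ + 1) * cubeM' (MhP ℓ Mh cq.1 (fin D cq.1 cq.2)) (Pj ℓ k P cq.1) cq.2 ν)),
      |((((ℓ + 1) ^ fin D cq.1 cq.2 : ℕ) : ℝ)) ^ 2 * ∑ z' ∈ boxNbrs _ z,
          (hLoc ℓ (fin D cq.1 cq.2) (MhP ℓ Mh cq.1 (fin D cq.1 cq.2)) (Pj ℓ k P cq.1) cq.2 z'
            - hLoc ℓ (fin D cq.1 cq.2) (MhP ℓ Mh cq.1 (fin D cq.1 cq.2)) (Pj ℓ k P cq.1) cq.2 z)| ≤ κ₂)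
    (g : ↥(boxDom (N0 ℓ Mh k P)) → ℝ) {G Dd : ℝ} (hG0 : 0 ≤ G)
    (hgG : ∀ b', |g (castP (fin_data hc).2.1 hc.hj.2 (embC D hP cq hc b'))| ≤ G)
    {x xh : ↥(boxDom (N0 ℓ Mh k P))}
    {b bh : ↥(Box d ℓ (fin D cq.1 cq.2)
      (fun ν => (ℓ + 1) * cubeM' (MhP ℓ Mh cq.1 (fin D cq.1 cq.2)) (Pj ℓ k P cq.1) cq.2 ν))}
    (hb : embC D hP cq hc b = (castP (ℓ := ℓ) (Mh := Mh) (P := P) (fin_data hc).2.1 hc.hj.2).symm x)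
    (hbh : embC D hP cq hc bh = (castP (ℓ := ℓ) (Mh := Mh) (P := P) (fin_data hc).2.1 hc.hj.2).symm xh)
    (hne : bh.1 ≠ b.1) (hnear : supNorm (bh.1 - b.1) ≤ (((ℓ + 1) ^ fin D cq.1 cq.2 : ℕ) : ℝ))
    (htt : |vX D cq xh - vX D cq x| ≤ κ * supNorm (bh.1 - b.1) / (((ℓ + 1) ^ fin D cq.1 cq.2 : ℕ) : ℝ))
    (hT : ∀ μ : Fin (d + 1), wsum2 δ ((ℓ + 1) ^ fin D cq.1 cq.2) b bh (fun w =>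
      ((((ℓ + 1) ^ fin D cq.1 cq.2 : ℕ) : ℝ) / supNorm (bh.1 - b.1)) ^ α
        * ((((ℓ + 1) ^ fin D cq.1 cq.2 : ℕ) : ℝ)
          * ((cG D a c cq.1 (fin D cq.1 cq.2) cq.2 hP hc.hq bh (fwd _ μ w) - cG D a c cq.1 (fin D cq.1 cq.2) cq.2 hP hc.hq bh w)
            - (cG D a c cq.1 (fin D cq.1 cq.2) cq.2 hP hc.hq b (fwd _ μ w)
              - cG D a c cq.1 (fin D cq.1 cq.2) cq.2 hP hc.hq b w)))) ≤ cT)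
    (hDb : ∀ b', g (castP (fin_data hc).2.1 hc.hj.2 (embC D hP cq hc b')) ≠ 0 → Dd ≤ supNorm (b.1 - b'.1))
    (hDbh : ∀ b', g (castP (fin_data hc).2.1 hc.hj.2 (embC D hP cq hc b')) ≠ 0 → Dd ≤ supNorm (bh.1 - b'.1)) :
    (supNorm (bh.1 - b.1)) ^ (-α) * |((bX D a c hP cq hc)ᵀ *ᵥ g) xh - ((bX D a c hP cq hc)ᵀ *ᵥ g) x|
      ≤ (((ℓ + 1) ^ fin D cq.1 cq.2 : ℕ) : ℝ) ^ (-α)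
        * (κ₁ * (1 + Real.exp δ) * ((d + 1) * (κ * cs + cT))
          + (κ₂ + (a (fin D cq.1 cq.2) + c (fin D cq.1 cq.2)) * ((ℓ : ℝ) + 1) * Real.exp (δ * ((ℓ : ℝ) + 1)) * κ₁)
            * (κ * c' + (2 * c' + ((d : ℝ) + 1) * Real.exp δ * cd)))
        * Real.exp (-(δ * Dd / (((ℓ + 1) ^ fin D cq.1 cq.2 : ℕ) : ℝ))) * G := by
  obtain ⟨hi1, hij, hji, -, -⟩ := fin_data hc
  have hjk := hc.hj.2
  have hn1' : 1 ≤ (ℓ + 1) ^ fin D cq.1 cq.2 := Nat.one_le_pow _ _ (by omega)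
  have hn1 : (1 : ℝ) ≤ (((ℓ + 1) ^ fin D cq.1 cq.2 : ℕ) : ℝ) := by exact_mod_cast hn1'
  have hn0 : (0 : ℝ) < (((ℓ + 1) ^ fin D cq.1 cq.2 : ℕ) : ℝ) := lt_of_lt_of_le one_pos hn1
  have hs1 : 1 ≤ supNorm (bh.1 - b.1) := B4StripSumsHolder.one_le_supNorm (sub_ne_zero.2 hne)
  have hs0 : 0 < supNorm (bh.1 - b.1) := lt_of_lt_of_le one_pos hs1
  have hzval : ∀ w : ↥(boxDom (N0 ℓ Mh k P)), ((castP (ℓ := ℓ) (Mh := Mh) (P := P) hij hjk).symm w).1 = w.1 :=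
    fun w => by unfold castP; exact boxCast_symm_apply_val _ _
  have hbx : (embC D hP cq hc b).1 = x.1 := by rw [hb, hzval]
  have hbhx : (embC D hP cq hc bh).1 = xh.1 := by rw [hbh, hzval]
  obtain ⟨Gc, hGc⟩ : ∃ T, T = cG D a c cq.1 (fin D cq.1 cq.2) cq.2 hP hc.hq := ⟨_, rfl⟩
  rw [← hGc] at hG hGd hGs hT
  obtain ⟨Kc, hKc⟩ : ∃ K, K = kComm (cOp D a c cq.1 (fin D cq.1 cq.2) cq.2 hP hc.hq)
      (hLoc ℓ (fin D cq.1 cq.2) (MhP ℓ Mh cq.1 (fin D cq.1 cq.2)) (Pj ℓ k P cq.1) cq.2) := ⟨_, rfl⟩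
  -- the two columns
  rw [bX_transpose_mulVec_img hP cq hc g hbh, bX_transpose_mulVec_img hP cq hc g hb, ← hGc, ← hKc]
  have ht_eq : ((fun z => vFun D cq.1 cq.2 z.1) ∘ embC D hP cq hc) b = vX D cq x := by
    show vFun D cq.1 cq.2 (embC D hP cq hc b).1 = vFun D cq.1 cq.2 x.1
    rw [hbx]
  have hth_eq : ((fun z => vFun D cq.1 cq.2 z.1) ∘ embC D hP cq hc) bh = vX D cq xh := by
    show vFun D cq.1 cq.2 (embC D hP cq hc bh).1 = vFun D cq.1 cq.2 xh.1
    rw [hbhx]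
  rw [ht_eq, hth_eq]
  obtain ⟨t, ht'⟩ : ∃ r : ℝ, r = vX D cq x := ⟨_, rfl⟩
  obtain ⟨th, hth'⟩ : ∃ r : ℝ, r = vX D cq xh := ⟨_, rfl⟩
  rw [← ht', ← hth'] at htt ⊢
  have ht1 : |t| ≤ 1 := by rw [ht']; exact abs_vX_le_one cq x
  -- the Hölder weight `(n/s)^α` and the two-row vector `u`
  obtain ⟨W', hW'⟩ : ∃ r : ℝ, r = ((((ℓ + 1) ^ fin D cq.1 cq.2 : ℕ) : ℝ) / supNorm (bh.1 - b.1)) ^ α := ⟨_, rfl⟩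
  have hW'0 : 0 ≤ W' := by rw [hW']; exact Real.rpow_nonneg (div_nonneg hn0.le hs0.le) _
  have hWeq : (supNorm (bh.1 - b.1)) ^ (-α) = (((ℓ + 1) ^ fin D cq.1 cq.2 : ℕ) : ℝ) ^ (-α) * W' := by
    rw [hW']; exact rpow_neg_eq hn0 hs0
  obtain ⟨u, hu⟩ : ∃ f : ↥(Box d ℓ (fin D cq.1 cq.2)
      (fun ν => (ℓ + 1) * cubeM' (MhP ℓ Mh cq.1 (fin D cq.1 cq.2)) (Pj ℓ k P cq.1) cq.2 ν)) → ℝ,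
      f = fun w => W' * (th * Gc bh w - t * Gc b w) := ⟨_, rfl⟩
  -- the difference of the two columns is `Σ_z (K u)(z)·g(z)`
  have hdiff : W' * (th * ∑ z, (Kc *ᵥ fun z' => Gc bh z') z * g (castP (fin_data hc).2.1 hc.hj.2 (embC D hP cq hc z))
        - t * ∑ z, (Kc *ᵥ fun z' => Gc b z') z * g (castP (fin_data hc).2.1 hc.hj.2 (embC D hP cq hc z)))
      = ∑ z, (Kc *ᵥ u) z * g (castP (fin_data hc).2.1 hc.hj.2 (embC D hP cq hc z)) := by
    have hlin : ∀ z, (Kc *ᵥ u) z = W' * (th * (Kc *ᵥ fun z' => Gc bh z') z - t * (Kc *ᵥ fun z' => Gc b z') z) := by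
      intro z
      rw [hu]
      simp only [Matrix.mulVec, dotProduct]
      rw [Finset.mul_sum, Finset.mul_sum, ← Finset.sum_sub_distrib, Finset.mul_sum]
      exact Finset.sum_congr rfl fun w _ => by ring
    simp_rw [hlin]
    rw [Finset.mul_sum, Finset.mul_sum, ← Finset.sum_sub_distrib, Finset.mul_sum]
    exact Finset.sum_congr rfl fun z _ => by ring
  -- the two-centre weighted `ℓ¹` of `K u`
  have hK := wsum2_kComm_le hn1' haj hc0 (m2 := 0) (κ₂ := κ₂)
    (isBlockUnion_lamLoc (one_le_Pj hP cq.1) hc.hq (isBlockUnion_LamG (D := D) hij hjk)) hδ hκ₁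
    (hLoc ℓ (fin D cq.1 cq.2) (MhP ℓ Mh cq.1 (fin D cq.1 cq.2)) (Pj ℓ k P cq.1) cq.2) hLip hLap u b bh
  have hU : wsum2 δ ((ℓ + 1) ^ fin D cq.1 cq.2) b bh u ≤ κ * c' + (2 * c' + ((d : ℝ) + 1) * Real.exp δ * cd) := by
    rw [hu, hW']
    exact cube_pair_wsum2_le hδ hn1' Gc hc' hcd hG hGd hα0 hα1 b bh hne hnear hκ ht1 htt
  have hUd : ∀ μ : Fin (d + 1), wsum2 δ ((ℓ + 1) ^ fin D cq.1 cq.2) b bh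
      (fun w => (((ℓ + 1) ^ fin D cq.1 cq.2 : ℕ) : ℝ) * (u (fwd _ μ w) - u w)) ≤ κ * cs + cT := by
    intro μ
    have h := cube_pair_diff_wsum2_le hδ hn1' Gc μ (hGs μ) hα1 b bh hne hnear (hT μ) hκ ht1 htt
    rw [hu, hW']
    exact h
  have hcT : 0 ≤ cT := (wsum2_nonneg _ _ _ _ _).trans (hT 0)
  have hsum : ∑ μ : Fin (d + 1), wsum2 δ ((ℓ + 1) ^ fin D cq.1 cq.2) b bh
      (fun w => (((ℓ + 1) ^ fin D cq.1 cq.2 : ℕ) : ℝ) * (u (fwd _ μ w) - u w)) ≤ (d + 1) * (κ * cs + cT) := by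
    calc ∑ μ : Fin (d + 1), wsum2 δ ((ℓ + 1) ^ fin D cq.1 cq.2) b bh
          (fun w => (((ℓ + 1) ^ fin D cq.1 cq.2 : ℕ) : ℝ) * (u (fwd _ μ w) - u w))
        ≤ ∑ _μ : Fin (d + 1), (κ * cs + cT) := Finset.sum_le_sum fun μ _ => hUd μ
      _ = (d + 1) * (κ * cs + cT) := by
          rw [Finset.sum_const, Finset.card_univ, Fintype.card_fin, nsmul_eq_mul]; push_cast; ring
  have hco : 0 ≤ κ₂ + (a (fin D cq.1 cq.2) + c (fin D cq.1 cq.2)) * ((ℓ : ℝ) + 1) * Real.exp (δ * ((ℓ : ℝ) + 1)) * κ₁ := by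
    positivity
  have hA : wsum2 δ ((ℓ + 1) ^ fin D cq.1 cq.2) b bh (fun z => (Kc *ᵥ u) z)
      ≤ κ₁ * (1 + Real.exp δ) * ((d + 1) * (κ * cs + cT))
        + (κ₂ + (a (fin D cq.1 cq.2) + c (fin D cq.1 cq.2)) * ((ℓ : ℝ) + 1) * Real.exp (δ * ((ℓ : ℝ) + 1)) * κ₁)
          * (κ * c' + (2 * c' + ((d : ℝ) + 1) * Real.exp δ * cd)) := by
    have t1 := mul_le_mul_of_nonneg_left hsum (mul_nonneg hκ₁ (by positivity : (0 : ℝ) ≤ 1 + Real.exp δ))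
    have t2 := mul_le_mul_of_nonneg_left hU hco
    rw [hKc]
    exact hK.trans (add_le_add t1 t2)
  -- the decaying sum against `g`
  have hS := sum_mul_le_of_wrow hn0 hG0 (fun z => (Kc *ᵥ u) z)
    (fun z => g (castP (fin_data hc).2.1 hc.hj.2 (embC D hP cq hc z)))
    (fun z => min (supNorm (b.1 - z.1)) (supNorm (bh.1 - z.1))) (by unfold wsum2 at hA; exact hA) hgG
    (fun z hz => le_min (hDb z hz) (hDbh z hz)) hδ
  rw [hWeq, mul_assoc, ← abs_of_nonneg hW'0, ← abs_mul, hdiff]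
  calc (((ℓ + 1) ^ fin D cq.1 cq.2 : ℕ) : ℝ) ^ (-α)
        * |∑ z, (Kc *ᵥ u) z * g (castP (fin_data hc).2.1 hc.hj.2 (embC D hP cq hc z))|
      ≤ (((ℓ + 1) ^ fin D cq.1 cq.2 : ℕ) : ℝ) ^ (-α)
        * ((κ₁ * (1 + Real.exp δ) * ((d + 1) * (κ * cs + cT))
          + (κ₂ + (a (fin D cq.1 cq.2) + c (fin D cq.1 cq.2)) * ((ℓ : ℝ) + 1) * Real.exp (δ * ((ℓ : ℝ) + 1)) * κ₁)
            * (κ * c' + (2 * c' + ((d : ℝ) + 1) * Real.exp δ * cd)))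
          * Real.exp (-(δ * Dd / (((ℓ + 1) ^ fin D cq.1 cq.2 : ℕ) : ℝ))) * G) :=
        mul_le_mul_of_nonneg_left hS (Real.rpow_nonneg hn0.le _)
    _ = _ := by ring

set_option maxHeartbeats 800000 in
/-- **ONE COLUMN OF ONE TERM OF `R` ON THE LEVEL-WEIGHTED INPUT** (the per-term content of
`B6Prop22AdjMultiLevelBox.sOp_majorant`, exported): uniformly in the lineage there are `δ₇, K₇ > 0` with
`|((K_□(h_□)G′(□)v_□)ᵀ(Λf))(x)| ≤ L^{j+1}·(K₇/M_h)·e^{−δ₇d(y,y′)/(d+1)}·sup|f|` (`Λ = diag(L^{lev})`, `x ∈ B^j(y)`,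
`f` supported in the block `y′`) — the three terms of (2.40) on the weighted `ℓ¹` and the level window of the cube.
[cite: Balaban1984PropagatorsII, (2.40)/(2.44) p.230, (2.49)/(2.51) p.232, (2.64) p.234] -/
theorem bXt_col_le (d ℓ : ℕ) (hℓ : 1 ≤ ℓ) (aminus aplus a2minus a2plus : ℝ) (ha : 0 < aminus) (ha2 : 0 < a2minus) :
    ∃ δ₇ K₇ : ℝ, 0 < δ₇ ∧ 0 < K₇ ∧ ∀ (k Mh R : ℕ), 3 ≤ Mh → 2 * (ℓ + 1) ≤ R →
      ∀ (P : Fin (d + 1) → ℕ) (hP : ∀ μ, 1 ≤ P μ) (D : Domains d ℓ Mh k P R) (a c : ℕ → ℝ),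
        (∀ i, 1 ≤ i → aminus ≤ a i ∧ a i ≤ aplus) → (∀ i, 1 ≤ i → a2minus ≤ c i ∧ c i ≤ a2plus) →
        ∀ (y' : ↥(bset D)) (f : ↥(boxDom (N0 ℓ Mh k P)) → ℝ) (B : ℝ),
          BlockSupp (g := geom D) (blkOf D) f y' B →
          ∀ (x : ↥(boxDom (N0 ℓ Mh k P))) (cq : ℕ × (Fin (d + 1) → ℤ)) (hc : CubeData D cq),
            |((bX D a c hP cq hc)ᵀ *ᵥ (levW D 1 *ᵥ f)) x|
              ≤ ((ℓ : ℝ) + 1) ^ (D.lev x.1 + 1)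
                * (K₇ / Mh * Real.exp (-(δ₇ / (d + 1) * (geom D).dist (blkOf D x) y')) * B) := by
  obtain ⟨δa, c', hδa, hc', h243⟩ := ineq243_twoLevel_roww d ℓ hℓ aminus aplus 0 a2minus a2plus ha ha2
  obtain ⟨δb, cs, hδb, hcs, h243s⟩ := ineq243_twoLevel_dstar_roww d ℓ hℓ aminus aplus 0 a2minus a2plus ha ha2
  have hD1 := D1_nonneg contDiff_hprof hasCompactSupport_hprof
  have hD2 := D2_nonneg contDiff_hprof hasCompactSupport_hprof
  obtain ⟨δ, hδdef⟩ : ∃ δ : ℝ, δ = min δa δb := ⟨_, rfl⟩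
  have hδ0 : 0 < δ := by rw [hδdef]; exact lt_min hδa hδb
  have hδa' : δ ≤ δa := by rw [hδdef]; exact min_le_left _ _
  have hδb' : δ ≤ δb := by rw [hδdef]; exact min_le_right _ _
  have hL0 : (0 : ℝ) < (ℓ : ℝ) + 1 := by positivity
  have hL1 : (1 : ℝ) ≤ (ℓ : ℝ) + 1 := by linarith [(Nat.cast_nonneg ℓ : (0 : ℝ) ≤ ℓ)]
  obtain ⟨A₁, hA₁⟩ : ∃ A₁ : ℝ, A₁ = (d + 1) * D1 hprof := ⟨_, rfl⟩
  obtain ⟨A₂, hA₂⟩ : ∃ A₂ : ℝ, A₂ = (d + 1) * D2 hprof := ⟨_, rfl⟩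
  obtain ⟨ap, hap⟩ : ∃ ap : ℝ, ap = (|aplus| + |a2plus|) * ((ℓ : ℝ) + 1) * Real.exp (δ * ((ℓ : ℝ) + 1)) :=
    ⟨_, rfl⟩
  have hA₁0 : 0 ≤ A₁ := by rw [hA₁]; positivity
  have hA₂0 : 0 ≤ A₂ := by rw [hA₂]; positivity
  have hap0 : 0 ≤ ap := by rw [hap]; positivity
  obtain ⟨CR₀, hCR₀⟩ : ∃ CR₀ : ℝ, CR₀ = A₁ * ((1 + Real.exp δ) * ((d + 1) * cs)) + (A₂ + ap * A₁) * c' := ⟨_, rfl⟩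
  have hCR₀0 : 0 ≤ CR₀ := by rw [hCR₀]; positivity
  refine ⟨δ, Real.exp δ * CR₀ / ((ℓ : ℝ) + 1) + 1, hδ0, by positivity, ?_⟩
  intro k Mh R hMh hR P hP D a c haw hcw y' lam B hlam x cq hc
  have hMh1 : 1 ≤ Mh := le_trans (by norm_num) hMh
  have hMhr : (1 : ℝ) ≤ Mh := by exact_mod_cast hMh1
  have hMh0 : (0 : ℝ) < Mh := by linarith
  have hlamB : ∀ w, |lam w| ≤ B := fun w => BlockSupp.abs_le hlam w
  have hB0 : 0 ≤ B := hlam.nonneg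
  obtain ⟨M, hM⟩ : ∃ M : ℝ, M = ((ℓ : ℝ) + 1) * Mh := ⟨_, rfl⟩
  have hM1 : (1 : ℝ) ≤ M := by rw [hM]; nlinarith
  have hMpos : 0 < M := by linarith
  obtain ⟨f, hfdef⟩ : ∃ g : ↥(boxDom (N0 ℓ Mh k P)) → ℝ, g = levW D 1 *ᵥ lam := ⟨_, rfl⟩
  rw [← hfdef]
  have hf : ∀ z, f z = ((ℓ : ℝ) + 1) ^ D.lev z.1 * lam z := by
    intro z; rw [hfdef]; unfold levW; rw [Matrix.mulVec_diagonal, zpow_one]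
  obtain ⟨dist0, hdist0⟩ : ∃ t : ℝ, t = (((bond D).dist (blkOf D x) y' : ℕ) : ℝ) := ⟨_, rfl⟩
  have hgeom : (geom D).dist (blkOf D x) y' = dist0 := by rw [hdist0]; rfl
  have hdist0nn : 0 ≤ dist0 := by rw [hdist0]; positivity
  rw [hgeom]
  have hKM : Real.exp δ * (CR₀ / M) ≤ (Real.exp δ * CR₀ / ((ℓ : ℝ) + 1) + 1) / Mh := by
    rw [hM, mul_div_assoc', ← div_div]
    exact div_le_div_of_nonneg_right (by linarith) hMh0.le
  have hRHS0 : 0 ≤ ((ℓ : ℝ) + 1) ^ (D.lev x.1 + 1)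
      * ((Real.exp δ * CR₀ / ((ℓ : ℝ) + 1) + 1) / Mh * Real.exp (-(δ / (d + 1) * dist0)) * B) := by positivity
  obtain ⟨hi1, hij, hji, -, -⟩ := fin_data hc
  have hjk := hc.hj.2
  by_cases himg : ∃ b, embC D hP cq hc b = (castP (ℓ := ℓ) (Mh := Mh) (P := P) hij hjk).symm x
  swap
  · push Not at himg
    rw [bX_transpose_mulVec_off hP cq hc f himg, abs_zero]; exact hRHS0
  obtain ⟨b, hb⟩ := himg
  rw [bX_transpose_mulVec_img hP cq hc f hb, abs_mul]
  have hzval : ∀ w : ↥(boxDom (N0 ℓ Mh k P)), ((castP (ℓ := ℓ) (Mh := Mh) (P := P) hij hjk).symm w).1 = w.1 :=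
    fun w => by unfold castP; exact boxCast_symm_apply_val _ _
  have hbx : (embC D hP cq hc b).1 = x.1 := by rw [hb, hzval]
  have hxin : InCube ℓ Mh k P cq.1 cq.2 x.1 := by
    rw [← hzval x]; exact (inCube_iff_exists_emb (Mh := Mh) hP hij hc.hq _).2 ⟨b, hb⟩
  have hlevwin := lev_window_of_inCube hℓ hR hP hMh1 hc x.2 hxin
  have hMh' : 1 ≤ MhP ℓ Mh cq.1 (fin D cq.1 cq.2) := one_le_MhP hMh1 _ _
  have hMhle : Mh ≤ MhP ℓ Mh cq.1 (fin D cq.1 cq.2) := by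
    unfold MhP; exact Nat.le_mul_of_pos_right _ (Nat.one_le_pow _ _ (by omega))
  have hcM' : ∀ ν, 1 ≤ cubeM' (MhP ℓ Mh cq.1 (fin D cq.1 cq.2)) (Pj ℓ k P cq.1) cq.2 ν := fun ν =>
    Nat.one_le_iff_ne_zero.2 (Nat.mul_ne_zero_iff.2
      ⟨by omega, by have := (one_le_cubeW (one_le_Pj hP cq.1) hc.hq ν).1; omega⟩)
  have hn1 : 1 ≤ (ℓ + 1) ^ fin D cq.1 cq.2 := Nat.one_le_pow _ _ (by omega)
  have hn : (0 : ℝ) < (((ℓ + 1) ^ fin D cq.1 cq.2 : ℕ) : ℝ) := by positivity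
  have haj : 0 < a (fin D cq.1 cq.2) := lt_of_lt_of_le ha (haw _ hi1).1
  have ha0 : 0 ≤ c (fin D cq.1 cq.2) := (lt_of_lt_of_le ha2 (hcw _ hi1).1).le
  obtain ⟨Dd, hDd⟩ : ∃ t : ℝ, t = (((ℓ + 1) ^ fin D cq.1 cq.2 : ℕ) : ℝ) * (dist0 / (d + 1) - 1) := ⟨_, rfl⟩
  have hw : |((fun z => vFun D cq.1 cq.2 z.1) ∘ embC D hP cq hc) b| ≤ 1 := abs_vFun_le_one _ _ _
  obtain ⟨M', hM'⟩ : ∃ M' : ℝ, M' = ((ℓ : ℝ) + 1) * (MhP ℓ Mh cq.1 (fin D cq.1 cq.2) : ℝ) := ⟨_, rfl⟩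
  have hMM' : M ≤ M' := by
    rw [hM, hM']; exact mul_le_mul_of_nonneg_left (by exact_mod_cast hMhle) hL0.le
  have hM'pos : 0 < M' := lt_of_lt_of_le hMpos hMM'
  obtain ⟨κ₁, hκ₁⟩ : ∃ κ₁ : ℝ, κ₁ = A₁ / M' := ⟨_, rfl⟩
  obtain ⟨κ₂, hκ₂⟩ : ∃ κ₂ : ℝ, κ₂ = (d + 1) * (D2 hprof / M' ^ 2) := ⟨_, rfl⟩
  have hκ₁0 : 0 ≤ κ₁ := by rw [hκ₁]; positivity
  have hκ₂0 : 0 ≤ κ₂ := by rw [hκ₂]; positivity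
  have hK := wsum_kComm_le hn1 haj ha0 (m2 := 0) (κ₂ := κ₂)
    (isBlockUnion_lamLoc (one_le_Pj hP cq.1) hc.hq (isBlockUnion_LamG (D := D) hij hjk)) hδ0.le hκ₁0
    (hLoc ℓ (fin D cq.1 cq.2) (MhP ℓ Mh cq.1 (fin D cq.1 cq.2)) (Pj ℓ k P cq.1) cq.2)
    (fun z z' => by rw [hκ₁, hA₁, hM']; exact hLoc_lipschitz hMh' cq.2 z z')
    (fun z => by rw [hκ₂, hM']; exact hLoc_laplacian_le hℓ hi1 hMh' (one_le_Pj hP cq.1) hc.hq z)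
    (fun z' => cG D a c cq.1 (fin D cq.1 cq.2) cq.2 hP hc.hq b z') b
  have hsumGD : ∑ μ : Fin (d + 1), wsum δ ((ℓ + 1) ^ fin D cq.1 cq.2) b (fun z => ((((ℓ + 1) ^ fin D cq.1 cq.2 : ℕ)) : ℝ)
      * (cG D a c cq.1 (fin D cq.1 cq.2) cq.2 hP hc.hq b (fwd _ μ z) - cG D a c cq.1 (fin D cq.1 cq.2) cq.2 hP hc.hq b z))
      ≤ (d + 1) * cs := by
    calc ∑ μ : Fin (d + 1), wsum δ ((ℓ + 1) ^ fin D cq.1 cq.2) b (fun z => ((((ℓ + 1) ^ fin D cq.1 cq.2 : ℕ)) : ℝ)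
          * (cG D a c cq.1 (fin D cq.1 cq.2) cq.2 hP hc.hq b (fwd _ μ z) - cG D a c cq.1 (fin D cq.1 cq.2) cq.2 hP hc.hq b z))
        ≤ ∑ _μ : Fin (d + 1), cs := Finset.sum_le_sum fun μ _ => by
          have := (roww_mono hδb' _ _ _).trans (h243s (fin D cq.1 cq.2) hi1 (a (fin D cq.1 cq.2)) 0
            (c (fin D cq.1 cq.2)) (haw _ hi1).1 (haw _ hi1).2 le_rfl le_rfl (hcw _ hi1).1 (hcw _ hi1).2 _ hcM'
            (lamLoc ℓ (MhP ℓ Mh cq.1 (fin D cq.1 cq.2)) (Pj ℓ k P cq.1) cq.2 (one_le_Pj hP cq.1) hc.hq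
              (LamG D cq.1 (fin D cq.1 cq.2))) μ b)
          rw [roww_dstar] at this
          exact this
      _ = (d + 1) * cs := by
          rw [Finset.sum_const, Finset.card_univ, Fintype.card_fin, nsmul_eq_mul]; push_cast; ring
  have hG0 : wsum δ ((ℓ + 1) ^ fin D cq.1 cq.2) b (fun z' => cG D a c cq.1 (fin D cq.1 cq.2) cq.2 hP hc.hq b z') ≤ c' :=
    (roww_mono hδa' _ _ _).trans (h243 (fin D cq.1 cq.2) hi1 (a (fin D cq.1 cq.2)) 0 (c (fin D cq.1 cq.2))
      (haw _ hi1).1 (haw _ hi1).2 le_rfl le_rfl (hcw _ hi1).1 (hcw _ hi1).2 _ hcM' _ b)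
  have hco : 0 ≤ κ₂ + (a (fin D cq.1 cq.2) + c (fin D cq.1 cq.2)) * ((ℓ : ℝ) + 1) * Real.exp (δ * ((ℓ : ℝ) + 1)) * κ₁ := by
    positivity
  have hwsum : wsum δ ((ℓ + 1) ^ fin D cq.1 cq.2) b
      (fun z => (kComm (cOp D a c cq.1 (fin D cq.1 cq.2) cq.2 hP hc.hq)
        (hLoc ℓ (fin D cq.1 cq.2) (MhP ℓ Mh cq.1 (fin D cq.1 cq.2)) (Pj ℓ k P cq.1) cq.2)
        *ᵥ (fun z' => cG D a c cq.1 (fin D cq.1 cq.2) cq.2 hP hc.hq b z')) z) ≤ CR₀ / M := by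
    have t1 := mul_le_mul_of_nonneg_left hsumGD (mul_nonneg hκ₁0 (by positivity : (0 : ℝ) ≤ 1 + Real.exp δ))
    have t2 := mul_le_mul_of_nonneg_left hG0 hco
    refine (hK.trans (add_le_add t1 t2)).trans ?_
    have hκ₁' : κ₁ ≤ A₁ / M := by rw [hκ₁]; exact div_le_div_of_nonneg_left hA₁0 hMpos hMM'
    have hκ₂' : κ₂ ≤ A₂ / M := by
      rw [hκ₂, hA₂]
      have hM'1 : (1 : ℝ) ≤ M' := hM1.trans hMM'
      have hM2 : D2 hprof / M' ^ 2 ≤ D2 hprof / M := by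
        apply div_le_div_of_nonneg_left hD2 hMpos
        calc M ≤ M' := hMM'
          _ = M' * 1 := (mul_one _).symm
          _ ≤ M' * M' := mul_le_mul_of_nonneg_left hM'1 hM'pos.le
          _ = M' ^ 2 := (sq _).symm
      calc ((d : ℝ) + 1) * (D2 hprof / M' ^ 2) ≤ (d + 1) * (D2 hprof / M) :=
            mul_le_mul_of_nonneg_left hM2 (by positivity)
        _ = (d + 1) * D2 hprof / M := mul_div_assoc' _ _ _
    have hajp : (a (fin D cq.1 cq.2) + c (fin D cq.1 cq.2)) * ((ℓ : ℝ) + 1) * Real.exp (δ * ((ℓ : ℝ) + 1)) ≤ ap := by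
      rw [hap]
      have : a (fin D cq.1 cq.2) + c (fin D cq.1 cq.2) ≤ |aplus| + |a2plus| :=
        add_le_add ((haw _ hi1).2.trans (le_abs_self _)) ((hcw _ hi1).2.trans (le_abs_self _))
      exact mul_le_mul_of_nonneg_right (mul_le_mul_of_nonneg_right this hL0.le) (Real.exp_pos _).le
    have h1 : (κ₂ + (a (fin D cq.1 cq.2) + c (fin D cq.1 cq.2)) * ((ℓ : ℝ) + 1) * Real.exp (δ * ((ℓ : ℝ) + 1)) * κ₁) * c'
        ≤ (A₂ / M + ap * (A₁ / M)) * c' :=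
      mul_le_mul_of_nonneg_right (add_le_add hκ₂' (mul_le_mul hajp hκ₁' hκ₁0 hap0)) hc'.le
    have h0 : κ₁ * (1 + Real.exp δ) * ((d + 1) * cs) ≤ A₁ / M * (1 + Real.exp δ) * ((d + 1) * cs) :=
      mul_le_mul_of_nonneg_right (mul_le_mul_of_nonneg_right hκ₁' (by positivity)) (by positivity)
    have h2 : A₁ / M * (1 + Real.exp δ) * ((d + 1) * cs) + (A₂ / M + ap * (A₁ / M)) * c' = CR₀ / M := by
      rw [hCR₀]; field_simp
    rw [← h2]
    exact add_le_add h0 h1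
  -- the vector `z ↦ f(□-image of z)`: bound `L^{lev x + 1}·B` and support distance `Dd`
  have hF : ∀ z, |f (castP (fin_data hc).2.1 hc.hj.2 (embC D hP cq hc z))| ≤ ((ℓ : ℝ) + 1) ^ (D.lev x.1 + 1) * B := by
    intro z
    rw [hf, abs_mul, abs_of_nonneg (by positivity)]
    set x'' : ↥(boxDom (N0 ℓ Mh k P)) := castP (fin_data hc).2.1 hc.hj.2 (embC D hP cq hc z) with hx''
    have hx''val : x''.1 = (embC D hP cq hc z).1 := by rw [hx'']; unfold castP; exact boxCast_apply_val _ _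
    have hx''in : InCube ℓ Mh k P cq.1 cq.2 x''.1 := by
      rw [hx''val]; exact (inCube_iff_exists_emb (Mh := Mh) hP hij hc.hq _).2 ⟨z, rfl⟩
    have hlev'' := lev_window_of_inCube hℓ hR hP hMh1 hc x''.2 hx''in
    have hpow : ((ℓ : ℝ) + 1) ^ D.lev x''.1 ≤ ((ℓ : ℝ) + 1) ^ (D.lev x.1 + 1) :=
      pow_le_pow_right₀ hL1 (by omega)
    exact mul_le_mul hpow (hlamB _) (abs_nonneg _) (by positivity)
  have hD : ∀ z, f (castP (fin_data hc).2.1 hc.hj.2 (embC D hP cq hc z)) ≠ 0 → Dd ≤ supNorm (b.1 - z.1) := by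
    intro z hz
    set x'' : ↥(boxDom (N0 ℓ Mh k P)) := castP (fin_data hc).2.1 hc.hj.2 (embC D hP cq hc z) with hx''
    have hμx : lam x'' ≠ 0 := by
      intro h0; apply hz; rw [hf, h0, mul_zero]
    have hx''val : x''.1 = (embC D hP cq hc z).1 := by rw [hx'']; unfold castP; exact boxCast_apply_val _ _
    have hx''in : InCube ℓ Mh k P cq.1 cq.2 x''.1 := by
      rw [hx''val]; exact (inCube_iff_exists_emb (Mh := Mh) hP hij hc.hq _).2 ⟨z, rfl⟩
    have hblk : blkOf D x'' = y' := by
      by_contra hne; exact hμx (hlam.off x'' hne)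
    have h := Dd_le_supNorm hℓ hR hP hMh1 hc x x'' hxin hx''in y' hblk
    have hsub : x.1 - x''.1 = b.1 - z.1 := by
      rw [hx''val, ← hbx]; unfold embC; exact emb_sub_emb _ hc.hq b z
    rw [hsub, ← hdist0] at h
    rw [hDd]
    exact h
  have hcol := sum_mul_le_of_wrow hn (by positivity)
    (fun z => (kComm (cOp D a c cq.1 (fin D cq.1 cq.2) cq.2 hP hc.hq)
        (hLoc ℓ (fin D cq.1 cq.2) (MhP ℓ Mh cq.1 (fin D cq.1 cq.2)) (Pj ℓ k P cq.1) cq.2)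
        *ᵥ (fun z' => cG D a c cq.1 (fin D cq.1 cq.2) cq.2 hP hc.hq b z')) z)
    (fun z => f (castP (fin_data hc).2.1 hc.hj.2 (embC D hP cq hc z)))
    (fun z => supNorm (b.1 - z.1)) (by unfold wsum at hwsum; exact hwsum) hF hD hδ0.le
  have hexp : Real.exp (-(δ * Dd / (((ℓ + 1) ^ fin D cq.1 cq.2 : ℕ) : ℝ)))
      = Real.exp δ * Real.exp (-(δ / (d + 1) * dist0)) := by rw [hDd]; exact exp_Dd_eq hn d
  rw [hexp] at hcol
  calc |((fun z => vFun D cq.1 cq.2 z.1) ∘ embC D hP cq hc) b|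
        * |∑ z, (kComm (cOp D a c cq.1 (fin D cq.1 cq.2) cq.2 hP hc.hq)
            (hLoc ℓ (fin D cq.1 cq.2) (MhP ℓ Mh cq.1 (fin D cq.1 cq.2)) (Pj ℓ k P cq.1) cq.2)
            *ᵥ (fun z' => cG D a c cq.1 (fin D cq.1 cq.2) cq.2 hP hc.hq b z')) z
            * f (castP (fin_data hc).2.1 hc.hj.2 (embC D hP cq hc z))|
      ≤ 1 * (CR₀ / M * (Real.exp δ * Real.exp (-(δ / (d + 1) * dist0))) * (((ℓ : ℝ) + 1) ^ (D.lev x.1 + 1) * B)) :=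
        mul_le_mul hw hcol (abs_nonneg _) zero_le_one
    _ = ((ℓ : ℝ) + 1) ^ (D.lev x.1 + 1) * ((Real.exp δ * (CR₀ / M)) * Real.exp (-(δ / (d + 1) * dist0)) * B) := by
        ring
    _ ≤ ((ℓ : ℝ) + 1) ^ (D.lev x.1 + 1)
        * ((Real.exp δ * CR₀ / ((ℓ : ℝ) + 1) + 1) / Mh * Real.exp (-(δ / (d + 1) * dist0)) * B) := by
        refine mul_le_mul_of_nonneg_left ?_ (by positivity)
        exact mul_le_mul_of_nonneg_right (mul_le_mul_of_nonneg_right hKM (Real.exp_pos _).le) hB0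

/-- a column of one term of `R` at a site not carrying `h_□` vanishes.
[cite: Balaban1984PropagatorsII, (2.38) p.229, (2.44) p.230, dictionary] -/
theorem bXt_col_eq_zero_of_uX (hP : ∀ μ, 1 ≤ P μ) (cq : ℕ × (Fin (d + 1) → ℤ)) (hc : CubeData D cq)
    (g : ↥(boxDom (N0 ℓ Mh k P)) → ℝ) {x : ↥(boxDom (N0 ℓ Mh k P))}
    (hu : uX (ℓ := ℓ) (Mh := Mh) (k := k) (P := P) cq x = 0) : ((bX D a c hP cq hc)ᵀ *ᵥ g) x = 0 := by
  obtain ⟨hi1, hij, hji, -, -⟩ := fin_data hc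
  have hjk := hc.hj.2
  by_cases himg : ∃ b, embC D hP cq hc b = (castP (ℓ := ℓ) (Mh := Mh) (P := P) hij hjk).symm x
  · obtain ⟨b, hb⟩ := himg
    rw [bX_transpose_mulVec_img hP cq hc g hb]
    have hbx : (embC D hP cq hc b).1 = x.1 := by rw [hb]; unfold castP; exact boxCast_symm_apply_val _ _
    have hv : ((fun z => vFun D cq.1 cq.2 z.1) ∘ embC D hP cq hc) b = vX D cq x := by
      show vFun D cq.1 cq.2 (embC D hP cq hc b).1 = vFun D cq.1 cq.2 x.1
      rw [hbx]
    rw [hv, vX_eq_zero_of_uX cq hu, zero_mul]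
  · push Not at himg
    exact bX_transpose_mulVec_off hP cq hc g himg

set_option maxHeartbeats 1600000 in
/-- **ONE TERM OF `Rᵀ` ON THE LEVEL-WEIGHTED INPUT OVER A PAIR OF COLUMNS IN ONE BLOCK** (the per-term smallness
input of the fifth entry of (2.67) for the `k`-level operator): uniformly in the lineage, for every `α ∈ [0,1)` there
are `δ₆, Q > 0` with
`|x̂−x|_∞^{−α}·|((K_□(h_□)G′(□)v_□)ᵀ(Λf))(x̂) − (…)(x)| ≤ (L^{j})^{1−α}·(Q/M_h)·e^{−δ₆d(y,y′)/(d+1)}·sup|f|`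
for `x ≠ x̂` in one `j`-block `y` and `f` supported in the block `y′` — near pairs (`|x̂−x| ≤ L^{i_□}`) by
`bXt_pair_near_le` with `κ, κ₁ = O(M^{−1})`, `κ₂ = O(M^{−2})` and `(L^{i})^{−α}L^{j+1} ≤ L²(L^{j})^{1−α}`; far pairs by two
single columns (`bXt_col_le`) and `|x̂−x|^{−α}L^{j+1} ≤ L²(L^{j})^{1−α}`.
[cite: Balaban1984PropagatorsII, Proposition 2.2 (2.67) p.234 (fifth entry), (2.44) p.230, (2.49)/(2.51) p.232;
Balaban1983RegularityDecay, Theorem (1.9) p.573] -/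
theorem bXt_dd_le (d ℓ : ℕ) (hℓ : 1 ≤ ℓ) (aminus aplus a2minus a2plus : ℝ) (ha : 0 < aminus) (ha2 : 0 < a2minus)
    (α : ℝ) (hα0 : 0 ≤ α) (hα1 : α < 1) :
    ∃ δ₆ Q : ℝ, 0 < δ₆ ∧ 0 < Q ∧ ∀ (k Mh R : ℕ), 3 ≤ Mh → 2 * (ℓ + 1) ≤ R →
      ∀ (P : Fin (d + 1) → ℕ) (hP : ∀ μ, 1 ≤ P μ) (D : Domains d ℓ Mh k P R) (a c : ℕ → ℝ),
        (∀ i, 1 ≤ i → aminus ≤ a i ∧ a i ≤ aplus) → (∀ i, 1 ≤ i → a2minus ≤ c i ∧ c i ≤ a2plus) →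
        ∀ (y' : ↥(bset D)) (f : ↥(boxDom (N0 ℓ Mh k P)) → ℝ) (B : ℝ),
          BlockSupp (g := geom D) (blkOf D) f y' B →
          ∀ (x x' : ↥(boxDom (N0 ℓ Mh k P))), x'.1 ≠ x.1 → blkOf D x' = blkOf D x →
          ∀ (cq : ℕ × (Fin (d + 1) → ℤ)) (hc : CubeData D cq),
            (supNorm (x'.1 - x.1)) ^ (-α)
                * |((bX D a c hP cq hc)ᵀ *ᵥ (levW D 1 *ᵥ f)) x' - ((bX D a c hP cq hc)ᵀ *ᵥ (levW D 1 *ᵥ f)) x|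
              ≤ (((ℓ : ℝ) + 1) ^ D.lev x.1) ^ (1 - α)
                * (Q / Mh * Real.exp (-(δ₆ / (d + 1) * (geom D).dist (blkOf D x) y')) * B) := by
  obtain ⟨δa, c', hδa, hc', h243⟩ := ineq243_twoLevel_roww d ℓ hℓ aminus aplus 0 a2minus a2plus ha ha2
  obtain ⟨δs, cs, hδs, hcs, h243s⟩ := ineq243_twoLevel_dstar_roww d ℓ hℓ aminus aplus 0 a2minus a2plus ha ha2
  obtain ⟨δd, cd, hδd, hcd, h243d⟩ := ineq243_twoLevel_deriv_wsum d ℓ hℓ aminus aplus 0 a2minus a2plus ha ha2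
  obtain ⟨δH, cH, hδH, hcH, hH⟩ :=
    ineq243_twoLevel_holderDual_wsum2 d ℓ hℓ aminus aplus 0 a2minus a2plus ha ha2 α hα0 hα1
  obtain ⟨δ₇, K₇, hδ₇, hK₇, hcol⟩ := bXt_col_le d ℓ hℓ aminus aplus a2minus a2plus ha ha2
  have hD1 := D1_nonneg contDiff_hprof hasCompactSupport_hprof
  have hD2 := D2_nonneg contDiff_hprof hasCompactSupport_hprof
  obtain ⟨δ, hδdef⟩ : ∃ t : ℝ, t = min (min δa δs) (min δd δH) := ⟨_, rfl⟩
  have hδpos : 0 < δ := by rw [hδdef]; exact lt_min (lt_min hδa hδs) (lt_min hδd hδH)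
  have h1a : δ ≤ δa := by rw [hδdef]; exact (min_le_left _ _).trans (min_le_left _ _)
  have h1s : δ ≤ δs := by rw [hδdef]; exact (min_le_left _ _).trans (min_le_right _ _)
  have h1d : δ ≤ δd := by rw [hδdef]; exact (min_le_right _ _).trans (min_le_left _ _)
  have h1H : δ ≤ δH := by rw [hδdef]; exact (min_le_right _ _).trans (min_le_right _ _)
  obtain ⟨δ₆, hδ₆⟩ : ∃ t : ℝ, t = min δ δ₇ := ⟨_, rfl⟩
  have hδ₆pos : 0 < δ₆ := by rw [hδ₆]; exact lt_min hδpos hδ₇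
  have h6δ : δ₆ ≤ δ := by rw [hδ₆]; exact min_le_left _ _
  have h67 : δ₆ ≤ δ₇ := by rw [hδ₆]; exact min_le_right _ _
  have hL0 : (0 : ℝ) < (ℓ : ℝ) + 1 := by positivity
  have hL1 : (1 : ℝ) ≤ (ℓ : ℝ) + 1 := by linarith [(Nat.cast_nonneg ℓ : (0 : ℝ) ≤ ℓ)]
  -- the `M`-free constants
  obtain ⟨A₁, hA₁⟩ : ∃ A₁ : ℝ, A₁ = (d + 1) * D1 hprof := ⟨_, rfl⟩
  obtain ⟨A₂, hA₂⟩ : ∃ A₂ : ℝ, A₂ = (d + 1) * D2 hprof := ⟨_, rfl⟩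
  obtain ⟨ap, hap⟩ : ∃ ap : ℝ, ap = (|aplus| + |a2plus|) * ((ℓ : ℝ) + 1) * Real.exp (δ * ((ℓ : ℝ) + 1)) :=
    ⟨_, rfl⟩
  have hA₁0 : 0 ≤ A₁ := by rw [hA₁]; positivity
  have hA₂0 : 0 ≤ A₂ := by rw [hA₂]; positivity
  have hap0 : 0 ≤ ap := by rw [hap]; positivity
  obtain ⟨EE, hEE⟩ : ∃ t : ℝ, t = Real.exp δ * Real.exp δ := ⟨_, rfl⟩
  have hEE0 : 0 ≤ EE := by rw [hEE]; positivity
  have hcs0 := hcs.le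
  have hcH0 := hcH.le
  have hc'0 := hc'.le
  have hcd0 := hcd.le
  obtain ⟨CP, hCP⟩ : ∃ t : ℝ, t = A₁ * (1 + Real.exp δ) * ((d + 1) * (A₁ * cs + cH))
      + (A₂ + ap * A₁) * (A₁ * c' + (2 * c' + ((d : ℝ) + 1) * Real.exp δ * cd)) := ⟨_, rfl⟩
  have hCP0 : 0 ≤ CP := by rw [hCP]; positivity
  refine ⟨δ₆, ((ℓ : ℝ) + 1) ^ 2 * EE * CP + 2 * ((ℓ : ℝ) + 1) ^ 2 * K₇ + 1, hδ₆pos, by positivity, ?_⟩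
  intro k Mh R hMh hR P hP D a c haw hcw y' lam B hlam x x' hne hblk cq hc
  obtain ⟨hi1, hij, hji, -, -⟩ := fin_data hc
  have hjk := hc.hj.2
  have hMh1 : 1 ≤ Mh := le_trans (by norm_num) hMh
  have hMhr : (1 : ℝ) ≤ Mh := by exact_mod_cast hMh1
  have hMh0 : (0 : ℝ) < Mh := by linarith
  have hB0 : 0 ≤ B := hlam.nonneg
  have hlamB : ∀ w, |lam w| ≤ B := fun w => BlockSupp.abs_le hlam w
  obtain ⟨dist0, hdist0⟩ : ∃ t : ℝ, t = (((bond D).dist (blkOf D x) y' : ℕ) : ℝ) := ⟨_, rfl⟩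
  have hgeom : (geom D).dist (blkOf D x) y' = dist0 := by rw [hdist0]; rfl
  have hgeom' : (geom D).dist (blkOf D x') y' = dist0 := by rw [hblk, hgeom]
  have hdist0nn : 0 ≤ dist0 := by rw [hdist0]; positivity
  rw [hgeom]
  obtain ⟨E6, hE6⟩ : ∃ t : ℝ, t = Real.exp (-(δ₆ / (d + 1) * dist0)) := ⟨_, rfl⟩
  rw [← hE6]
  have hE60 : 0 ≤ E6 := by rw [hE6]; exact (Real.exp_pos _).le
  have hE7 : Real.exp (-(δ₇ / (d + 1) * dist0)) ≤ E6 := by rw [hE6]; exact exp_rate_mono h67 hdist0nn d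
  obtain ⟨LJ, hLJ⟩ : ∃ t : ℝ, t = ((ℓ : ℝ) + 1) ^ D.lev x.1 := ⟨_, rfl⟩
  have hLJ0 : 0 < LJ := by rw [hLJ]; positivity
  have hLJα0 : 0 ≤ LJ ^ (1 - α) := Real.rpow_nonneg hLJ0.le _
  have hLJ1 : ((ℓ : ℝ) + 1) ^ (D.lev x.1 + 1) = ((ℓ : ℝ) + 1) * LJ := by rw [hLJ, pow_succ']
  have hRHS0 : 0 ≤ LJ ^ (1 - α)
      * ((((ℓ : ℝ) + 1) ^ 2 * EE * CP + 2 * ((ℓ : ℝ) + 1) ^ 2 * K₇ + 1) / Mh * E6 * B) := by positivity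
  obtain ⟨s, hs⟩ : ∃ t : ℝ, t = supNorm (x'.1 - x.1) := ⟨_, rfl⟩
  have hs1 : 1 ≤ s := by rw [hs]; exact B4StripSumsHolder.one_le_supNorm (sub_ne_zero.2 hne)
  have hs0 : 0 < s := lt_of_lt_of_le one_pos hs1
  have hW0 : 0 ≤ s ^ (-α) := Real.rpow_nonneg hs0.le _
  obtain ⟨g, hgdef⟩ : ∃ t : ↥(boxDom (N0 ℓ Mh k P)) → ℝ, t = levW D 1 *ᵥ lam := ⟨_, rfl⟩
  have hgz : ∀ z, g z = ((ℓ : ℝ) + 1) ^ D.lev z.1 * lam z := by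
    intro z; rw [hgdef]; unfold levW; rw [Matrix.mulVec_diagonal, zpow_one]
  have hcolx := hcol k Mh R hMh hR P hP D a c haw hcw y' lam B hlam x cq hc
  have hcolx' := hcol k Mh R hMh hR P hP D a c haw hcw y' lam B hlam x' cq hc
  rw [← hgdef, hgeom, hLJ1] at hcolx
  have hlevx' : D.lev x'.1 = D.lev x.1 := congrArg (fun s : ↥(bset D) => s.1.1) hblk
  rw [← hgdef, hgeom', hlevx', hLJ1] at hcolx'
  rw [← hgdef, ← hLJ, ← hs]
  -- the trivial case
  by_cases h0 : uX (ℓ := ℓ) (Mh := Mh) (k := k) (P := P) cq x = 0 ∧ uX (ℓ := ℓ) (Mh := Mh) (k := k) (P := P) cq x' = 0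
  · rw [bXt_col_eq_zero_of_uX (D := D) (a := a) (c := c) hP cq hc g h0.1,
      bXt_col_eq_zero_of_uX (D := D) (a := a) (c := c) hP cq hc g h0.2]
    simp only [sub_self, abs_zero, mul_zero]
    exact hRHS0
  have hu : uX (ℓ := ℓ) (Mh := Mh) (k := k) (P := P) cq x ≠ 0 ∨ uX (ℓ := ℓ) (Mh := Mh) (k := k) (P := P) cq x' ≠ 0 := by
    by_contra h'; push Not at h'; exact h0 ⟨h'.1, h'.2⟩
  -- the level window at `x`
  have hzval : ∀ w : ↥(boxDom (N0 ℓ Mh k P)), ((castP (ℓ := ℓ) (Mh := Mh) (P := P) hij hjk).symm w).1 = w.1 :=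
    fun w => by unfold castP; exact boxCast_symm_apply_val _ _
  have hinc : ∀ (w : ↥(boxDom (N0 ℓ Mh k P))) (bw : ↥(Box d ℓ (fin D cq.1 cq.2)
      (fun ν => (ℓ + 1) * cubeM' (MhP ℓ Mh cq.1 (fin D cq.1 cq.2)) (Pj ℓ k P cq.1) cq.2 ν))),
      embC D hP cq hc bw = (castP (ℓ := ℓ) (Mh := Mh) (P := P) hij hjk).symm w → InCube ℓ Mh k P cq.1 cq.2 w.1 :=
    fun w bw hbw => by rw [← hzval w]; exact (inCube_iff_exists_emb (Mh := Mh) hP hij hc.hq _).2 ⟨bw, hbw⟩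
  have hwin : fin D cq.1 cq.2 ≤ D.lev x.1 ∧ D.lev x.1 ≤ fin D cq.1 cq.2 + 1 := by
    rcases hu with h | h
    · obtain ⟨bw, hbw⟩ := img_of_uX_ne_zero hℓ hP hMh1 cq hc h (Or.inr rfl)
      exact lev_window_of_inCube hℓ hR hP hMh1 hc x.2 (hinc x bw hbw)
    · obtain ⟨bw, hbw⟩ := img_of_uX_ne_zero hℓ hP hMh1 cq hc h (Or.inr rfl)
      rw [← hlevx']; exact lev_window_of_inCube hℓ hR hP hMh1 hc x'.2 (hinc x' bw hbw)
  obtain ⟨nn, hnn⟩ : ∃ t : ℝ, t = (((ℓ + 1) ^ fin D cq.1 cq.2 : ℕ) : ℝ) := ⟨_, rfl⟩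
  have hncast : nn = ((ℓ : ℝ) + 1) ^ fin D cq.1 cq.2 := by rw [hnn]; push_cast; ring
  have hn1' : 1 ≤ (ℓ + 1) ^ fin D cq.1 cq.2 := Nat.one_le_pow _ _ (by omega)
  have hn1 : (1 : ℝ) ≤ nn := by rw [hnn]; exact_mod_cast hn1'
  have hn0 : (0 : ℝ) < nn := lt_of_lt_of_le one_pos hn1
  have hnLJ : nn ≤ LJ := by rw [hncast, hLJ]; exact pow_le_pow_right₀ hL1 hwin.1
  have hT : LJ ≤ ((ℓ : ℝ) + 1) * nn := by
    rw [hLJ, hncast, ← pow_succ']; exact pow_le_pow_right₀ hL1 hwin.2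
  obtain ⟨Nj, hNj⟩ : ∃ t : ℝ, t = (((ℓ + 1) ^ cq.1 : ℕ) : ℝ) := ⟨_, rfl⟩
  have hNj1' : 1 ≤ (ℓ + 1) ^ cq.1 := Nat.one_le_pow _ _ (by omega)
  have hNj0 : 0 < Nj := by rw [hNj]; exact_mod_cast hNj1'
  have hnNj : nn ≤ Nj := by
    rw [hnn, hNj]; exact_mod_cast Nat.pow_le_pow_right (by omega) hij
  obtain ⟨M, hM⟩ : ∃ M : ℝ, M = ((ℓ : ℝ) + 1) * Mh := ⟨_, rfl⟩
  have hM1 : (1 : ℝ) ≤ M := by rw [hM]; nlinarith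
  have hMpos : 0 < M := by linarith
  have hMhM : (Mh : ℝ) ≤ M := by rw [hM]; nlinarith
  have hM1n : 1 ≤ (ℓ + 1) * Mh := Nat.one_le_iff_ne_zero.2 (Nat.mul_ne_zero_iff.2 ⟨by omega, by omega⟩)
  have hMc : (((ℓ + 1) * Mh : ℕ) : ℝ) = M := by rw [hM]; push_cast; ring
  -- the Hölder weights of both regimes: `w^{−α}·L^{j+1} ≤ L²(L^j)^{1−α}` for `n ≤ w`
  have hfarW : ∀ w : ℝ, nn ≤ w → w ^ (-α) * (((ℓ : ℝ) + 1) * LJ) ≤ ((ℓ : ℝ) + 1) ^ 2 * LJ ^ (1 - α) := by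
    intro w hw
    have h := rpow_far_le hn0 hw hLJ0 hT hL1 hα0 hα1.le
    calc w ^ (-α) * (((ℓ : ℝ) + 1) * LJ) = ((ℓ : ℝ) + 1) * (w ^ (-α) * LJ) := by ring
      _ ≤ ((ℓ : ℝ) + 1) * (((ℓ : ℝ) + 1) * LJ ^ (1 - α)) := mul_le_mul_of_nonneg_left h hL0.le
      _ = ((ℓ : ℝ) + 1) ^ 2 * LJ ^ (1 - α) := by ring
  have hQ1 : ((ℓ : ℝ) + 1) ^ 2 * EE * CP ≤ ((ℓ : ℝ) + 1) ^ 2 * EE * CP + 2 * ((ℓ : ℝ) + 1) ^ 2 * K₇ + 1 := by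
    have : 0 ≤ 2 * ((ℓ : ℝ) + 1) ^ 2 * K₇ := by positivity
    linarith
  have hQ2 : 2 * ((ℓ : ℝ) + 1) ^ 2 * K₇ ≤ ((ℓ : ℝ) + 1) ^ 2 * EE * CP + 2 * ((ℓ : ℝ) + 1) ^ 2 * K₇ + 1 := by
    have : 0 ≤ ((ℓ : ℝ) + 1) ^ 2 * EE * CP := by positivity
    linarith
  by_cases hnear : s ≤ nn
  · -- NEAR PAIRS: both points lie in the cube image
    obtain ⟨b, b', hb, hb'⟩ : ∃ b b', embC D hP cq hc b = (castP (ℓ := ℓ) (Mh := Mh) (P := P) hij hjk).symm x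
        ∧ embC D hP cq hc b' = (castP (ℓ := ℓ) (Mh := Mh) (P := P) hij hjk).symm x' := by
      have hd1 : supNorm (x'.1 - x.1) ≤ 2 * (((ℓ + 1) ^ fin D cq.1 cq.2 : ℕ) : ℝ) := by
        rw [← hs, ← hnn]; linarith only [hnear, hn0]
      have hd2 : supNorm (x.1 - x'.1) ≤ 2 * (((ℓ + 1) ^ fin D cq.1 cq.2 : ℕ) : ℝ) := by
        rw [supNorm_sub_comm]; exact hd1
      have hd0 : ∀ w : ↥(boxDom (N0 ℓ Mh k P)), supNorm (w.1 - w.1) ≤ 2 * (((ℓ + 1) ^ fin D cq.1 cq.2 : ℕ) : ℝ) := by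
        intro w
        have h0' : supNorm (w.1 - w.1) = 0 := by rw [sub_self]; unfold B4ContourShift.supNorm; simp
        rw [h0']; positivity
      rcases hu with h | h
      · obtain ⟨b, hb⟩ := img_of_near hℓ hP hMh cq hc h (hd0 x)
        obtain ⟨b', hb'⟩ := img_of_near hℓ hP hMh cq hc h hd1
        exact ⟨b, b', hb, hb'⟩
      · obtain ⟨b, hb⟩ := img_of_near hℓ hP hMh cq hc h hd2
        obtain ⟨b', hb'⟩ := img_of_near hℓ hP hMh cq hc h (hd0 x')
        exact ⟨b, b', hb, hb'⟩
    have hbx : (embC D hP cq hc b).1 = x.1 := by rw [hb, hzval]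
    have hb'x : (embC D hP cq hc b').1 = x'.1 := by rw [hb', hzval]
    have hsubE : ∀ u v, (embC D hP cq hc u).1 - (embC D hP cq hc v).1 = u.1 - v.1 := fun u v => by
      unfold embC; exact emb_sub_emb _ hc.hq u v
    have hb'b : b'.1 - b.1 = x'.1 - x.1 := by rw [← hsubE b' b, hb'x, hbx]
    have hsb : supNorm (b'.1 - b.1) = s := by rw [hb'b, hs]
    have hneb : b'.1 ≠ b.1 := fun h => hne (by
      have := hb'b; rw [h, sub_self] at this; exact (sub_eq_zero.1 this.symm))
    have hxin : InCube ℓ Mh k P cq.1 cq.2 x.1 := hinc x b hb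
    have hx'in : InCube ℓ Mh k P cq.1 cq.2 x'.1 := hinc x' b' hb'
    -- the per-cube inputs
    have hMh' : 1 ≤ MhP ℓ Mh cq.1 (fin D cq.1 cq.2) := one_le_MhP hMh1 _ _
    have hMhle : Mh ≤ MhP ℓ Mh cq.1 (fin D cq.1 cq.2) := by
      unfold MhP; exact Nat.le_mul_of_pos_right _ (Nat.one_le_pow _ _ (by omega))
    have hcM' : ∀ ν, 1 ≤ cubeM' (MhP ℓ Mh cq.1 (fin D cq.1 cq.2)) (Pj ℓ k P cq.1) cq.2 ν := fun ν =>
      Nat.one_le_iff_ne_zero.2 (Nat.mul_ne_zero_iff.2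
        ⟨by omega, by have := (one_le_cubeW (one_le_Pj hP cq.1) hc.hq ν).1; omega⟩)
    have haj : 0 < a (fin D cq.1 cq.2) := lt_of_lt_of_le ha (haw _ hi1).1
    have hc0 : 0 ≤ c (fin D cq.1 cq.2) := (lt_of_lt_of_le ha2 (hcw _ hi1).1).le
    obtain ⟨M', hM'⟩ : ∃ M' : ℝ, M' = ((ℓ : ℝ) + 1) * (MhP ℓ Mh cq.1 (fin D cq.1 cq.2) : ℝ) := ⟨_, rfl⟩
    have hMM' : M ≤ M' := by
      rw [hM, hM']; exact mul_le_mul_of_nonneg_left (by exact_mod_cast hMhle) hL0.le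
    have hM'pos : 0 < M' := lt_of_lt_of_le hMpos hMM'
    obtain ⟨κ₁, hκ₁⟩ : ∃ κ₁ : ℝ, κ₁ = A₁ / M' := ⟨_, rfl⟩
    obtain ⟨κ₂, hκ₂⟩ : ∃ κ₂ : ℝ, κ₂ = (d + 1) * (D2 hprof / M' ^ 2) := ⟨_, rfl⟩
    obtain ⟨κ, hκ⟩ : ∃ κ : ℝ, κ = A₁ / M := ⟨_, rfl⟩
    have hκ₁0 : 0 ≤ κ₁ := by rw [hκ₁]; positivity
    have hκ₂0 : 0 ≤ κ₂ := by rw [hκ₂]; positivity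
    have hκ0 : 0 ≤ κ := by rw [hκ]; positivity
    have hG : ∀ w, roww δ ((ℓ + 1) ^ fin D cq.1 cq.2) (cG D a c cq.1 (fin D cq.1 cq.2) cq.2 hP hc.hq) w ≤ c' :=
      fun w => (roww_mono h1a _ _ _).trans (h243 (fin D cq.1 cq.2) hi1 (a (fin D cq.1 cq.2)) 0 (c (fin D cq.1 cq.2))
        (haw _ hi1).1 (haw _ hi1).2 le_rfl le_rfl (hcw _ hi1).1 (hcw _ hi1).2 _ hcM' _ w)
    have hGs : ∀ (μ : Fin (d + 1)) w, roww δ ((ℓ + 1) ^ fin D cq.1 cq.2)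
        (dstar ((ℓ + 1) ^ fin D cq.1 cq.2) μ (cG D a c cq.1 (fin D cq.1 cq.2) cq.2 hP hc.hq)) w ≤ cs :=
      fun μ w => (roww_mono h1s _ _ _).trans (h243s (fin D cq.1 cq.2) hi1 (a (fin D cq.1 cq.2)) 0
        (c (fin D cq.1 cq.2)) (haw _ hi1).1 (haw _ hi1).2 le_rfl le_rfl (hcw _ hi1).1 (hcw _ hi1).2 _ hcM'
        (lamLoc ℓ (MhP ℓ Mh cq.1 (fin D cq.1 cq.2)) (Pj ℓ k P cq.1) cq.2 (one_le_Pj hP cq.1) hc.hq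
          (LamG D cq.1 (fin D cq.1 cq.2))) μ w)
    have hGd : ∀ (i : Fin (d + 1)) (v ve : ↥(Box d ℓ (fin D cq.1 cq.2)
        (fun ν => (ℓ + 1) * cubeM' (MhP ℓ Mh cq.1 (fin D cq.1 cq.2)) (Pj ℓ k P cq.1) cq.2 ν))),
        ve.1 = v.1 + Pi.single i 1 →
        wsum δ ((ℓ + 1) ^ fin D cq.1 cq.2) v (fun z => (((ℓ + 1) ^ fin D cq.1 cq.2 : ℕ) : ℝ)
          * (cG D a c cq.1 (fin D cq.1 cq.2) cq.2 hP hc.hq ve z - cG D a c cq.1 (fin D cq.1 cq.2) cq.2 hP hc.hq v z))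
          ≤ cd :=
      fun i v ve hve => (wsum_mono_rate h1d _ _ _).trans (h243d (fin D cq.1 cq.2) hi1 (a (fin D cq.1 cq.2)) 0
        (c (fin D cq.1 cq.2)) (haw _ hi1).1 (haw _ hi1).2 le_rfl le_rfl (hcw _ hi1).1 (hcw _ hi1).2 _ hcM' _ i
        v ve hve)
    have hTT : ∀ μ : Fin (d + 1), wsum2 δ ((ℓ + 1) ^ fin D cq.1 cq.2) b b' (fun w =>
        ((((ℓ + 1) ^ fin D cq.1 cq.2 : ℕ) : ℝ) / supNorm (b'.1 - b.1)) ^ α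
          * ((((ℓ + 1) ^ fin D cq.1 cq.2 : ℕ) : ℝ)
            * ((cG D a c cq.1 (fin D cq.1 cq.2) cq.2 hP hc.hq b' (fwd _ μ w)
                - cG D a c cq.1 (fin D cq.1 cq.2) cq.2 hP hc.hq b' w)
              - (cG D a c cq.1 (fin D cq.1 cq.2) cq.2 hP hc.hq b (fwd _ μ w)
                - cG D a c cq.1 (fin D cq.1 cq.2) cq.2 hP hc.hq b w)))) ≤ cH :=
      fun μ => (wsum2_mono_rate h1H _ _ _ _).trans (hH (fin D cq.1 cq.2) hi1 (a (fin D cq.1 cq.2)) 0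
        (c (fin D cq.1 cq.2)) (haw _ hi1).1 (haw _ hi1).2 le_rfl le_rfl (hcw _ hi1).1 (hcw _ hi1).2 _ hcM' _ μ
        b b' hneb)
    -- the input vector on the cube image: bound and support distances
    have hgG : ∀ z, |g (castP (fin_data hc).2.1 hc.hj.2 (embC D hP cq hc z))| ≤ ((ℓ : ℝ) + 1) * LJ * B := by
      intro z
      rw [hgz, abs_mul, abs_of_nonneg (by positivity)]
      set x'' : ↥(boxDom (N0 ℓ Mh k P)) := castP (fin_data hc).2.1 hc.hj.2 (embC D hP cq hc z) with hx''
      have hx''val : x''.1 = (embC D hP cq hc z).1 := by rw [hx'']; unfold castP; exact boxCast_apply_val _ _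
      have hx''in : InCube ℓ Mh k P cq.1 cq.2 x''.1 := by
        rw [hx''val]; exact (inCube_iff_exists_emb (Mh := Mh) hP hij hc.hq _).2 ⟨z, rfl⟩
      have hlev'' := lev_window_of_inCube hℓ hR hP hMh1 hc x''.2 hx''in
      have hpow : ((ℓ : ℝ) + 1) ^ D.lev x''.1 ≤ ((ℓ : ℝ) + 1) * LJ := by
        rw [← hLJ1]; exact pow_le_pow_right₀ hL1 (by omega)
      exact mul_le_mul hpow (hlamB _) (abs_nonneg _) (by positivity)
    obtain ⟨Dd, hDd⟩ : ∃ t : ℝ, t = nn * (dist0 / (d + 1) - 1) := ⟨_, rfl⟩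
    have hDgen : ∀ (w : ↥(boxDom (N0 ℓ Mh k P))) (bw : ↥(Box d ℓ (fin D cq.1 cq.2)
        (fun ν => (ℓ + 1) * cubeM' (MhP ℓ Mh cq.1 (fin D cq.1 cq.2)) (Pj ℓ k P cq.1) cq.2 ν))),
        (embC D hP cq hc bw).1 = w.1 → InCube ℓ Mh k P cq.1 cq.2 w.1 → (geom D).dist (blkOf D w) y' = dist0 →
        ∀ z, g (castP (fin_data hc).2.1 hc.hj.2 (embC D hP cq hc z)) ≠ 0 → Dd ≤ supNorm (bw.1 - z.1) := by
      intro w bw hbw hwin' hwd z hz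
      set x'' : ↥(boxDom (N0 ℓ Mh k P)) := castP (fin_data hc).2.1 hc.hj.2 (embC D hP cq hc z) with hx''
      have hμx : lam x'' ≠ 0 := by
        intro h0'; apply hz; rw [hgz, h0', mul_zero]
      have hx''val : x''.1 = (embC D hP cq hc z).1 := by
        rw [hx'']; unfold castP; exact boxCast_apply_val _ _
      have hx''in : InCube ℓ Mh k P cq.1 cq.2 x''.1 := by
        rw [hx''val]
        exact (inCube_iff_exists_emb (Mh := Mh) hP hij hc.hq _).2 ⟨z, rfl⟩
      have hblk'' : blkOf D x'' = y' := by
        by_contra hne'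
        exact hμx (hlam.off x'' hne')
      have h := Dd_le_supNorm hℓ hR hP hMh1 hc w x'' hwin' hx''in y' hblk''
      have hsub : w.1 - x''.1 = bw.1 - z.1 := by rw [hx''val, ← hbw]; exact hsubE bw z
      rw [hsub] at h
      have hd' : (((bond D).dist (blkOf D w) y' : ℕ) : ℝ) = dist0 := hwd
      rw [hd', ← hnn, ← hDd] at h
      exact h
    have hD_b := hDgen x b hbx hxin hgeom
    have hD_b' := hDgen x' b' hb'x hx'in hgeom'
    -- the jump of the cut-off between the two columns
    have htt : |vX D cq x' - vX D cq x| ≤ κ * supNorm (b'.1 - b.1) / (((ℓ + 1) ^ fin D cq.1 cq.2 : ℕ) : ℝ) := by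
      refine (abs_vX_sub_le (D := D) cq hlevx').trans ?_
      have h := abs_hq_sub_le (d := d) hNj1' hM1n cq.2 x.1 x'.1
      rw [← hNj, ← hs, hMc] at h
      rw [hsb, ← hnn, hκ, hA₁]
      refine h.trans ?_
      exact div_le_div_of_nonneg_left (by positivity) hn0 hnNj
    have key := bXt_pair_near_le (D := D) (a := a) (c := c) hP cq hc hα0 hα1.le hδpos.le hc'0 hcd0 hκ0 hκ₁0 hκ₂0
      haj hc0 hG hGd hGs
      (fun z z' => by rw [hκ₁, hA₁, hM']; exact hLoc_lipschitz hMh' cq.2 z z')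
      (fun z => by rw [hκ₂, hM']; exact hLoc_laplacian_le hℓ hi1 hMh' (one_le_Pj hP cq.1) hc.hq z)
      g (by positivity) hgG hb hb' hneb (by rw [hsb, ← hnn]; exact hnear) htt hTT hD_b hD_b'
    rw [hsb, ← hnn] at key
    -- sizes: `A ≤ C_P/M`, `e^{−δD/n} ≤ e^{2δ}E`, `n^{−α}L^{j+1} ≤ L²(L^j)^{1−α}`
    have hκ₁' : κ₁ ≤ A₁ / M := by rw [hκ₁]; exact div_le_div_of_nonneg_left hA₁0 hMpos hMM'
    have hκ' : κ ≤ A₁ := by rw [hκ]; exact div_le_self hA₁0 hM1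
    have hκ₂' : κ₂ ≤ A₂ / M := by
      rw [hκ₂, hA₂]
      have hM'1 : (1 : ℝ) ≤ M' := hM1.trans hMM'
      have hM2 : D2 hprof / M' ^ 2 ≤ D2 hprof / M := by
        apply div_le_div_of_nonneg_left hD2 hMpos
        calc M ≤ M' := hMM'
          _ = M' * 1 := (mul_one _).symm
          _ ≤ M' * M' := mul_le_mul_of_nonneg_left hM'1 hM'pos.le
          _ = M' ^ 2 := (sq _).symm
      calc ((d : ℝ) + 1) * (D2 hprof / M' ^ 2) ≤ (d + 1) * (D2 hprof / M) :=
            mul_le_mul_of_nonneg_left hM2 (by positivity)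
        _ = (d + 1) * D2 hprof / M := mul_div_assoc' _ _ _
    have hajp : (a (fin D cq.1 cq.2) + c (fin D cq.1 cq.2)) * ((ℓ : ℝ) + 1) * Real.exp (δ * ((ℓ : ℝ) + 1)) ≤ ap := by
      rw [hap]
      have : a (fin D cq.1 cq.2) + c (fin D cq.1 cq.2) ≤ |aplus| + |a2plus| :=
        add_le_add ((haw _ hi1).2.trans (le_abs_self _)) ((hcw _ hi1).2.trans (le_abs_self _))
      exact mul_le_mul_of_nonneg_right (mul_le_mul_of_nonneg_right this hL0.le) (Real.exp_pos _).le
    have hAle : κ₁ * (1 + Real.exp δ) * ((d + 1) * (κ * cs + cH))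
        + (κ₂ + (a (fin D cq.1 cq.2) + c (fin D cq.1 cq.2)) * ((ℓ : ℝ) + 1) * Real.exp (δ * ((ℓ : ℝ) + 1)) * κ₁)
          * (κ * c' + (2 * c' + ((d : ℝ) + 1) * Real.exp δ * cd)) ≤ CP / M := by
      have t1 : κ₁ * (1 + Real.exp δ) * ((d + 1) * (κ * cs + cH))
          ≤ A₁ / M * (1 + Real.exp δ) * ((d + 1) * (A₁ * cs + cH)) :=
        mul_le_mul (mul_le_mul_of_nonneg_right hκ₁' (by positivity))
          (mul_le_mul_of_nonneg_left (add_le_add (mul_le_mul_of_nonneg_right hκ' hcs0) le_rfl) (by positivity))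
          (by positivity) (by positivity)
      have t2 : (κ₂ + (a (fin D cq.1 cq.2) + c (fin D cq.1 cq.2)) * ((ℓ : ℝ) + 1) * Real.exp (δ * ((ℓ : ℝ) + 1)) * κ₁)
          * (κ * c' + (2 * c' + ((d : ℝ) + 1) * Real.exp δ * cd))
          ≤ (A₂ / M + ap * (A₁ / M)) * (A₁ * c' + (2 * c' + ((d : ℝ) + 1) * Real.exp δ * cd)) :=
        mul_le_mul (add_le_add hκ₂' (mul_le_mul hajp hκ₁' hκ₁0 hap0))
          (add_le_add (mul_le_mul_of_nonneg_right hκ' hc'0) le_rfl) (by positivity) (by positivity)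
      refine (add_le_add t1 t2).trans (le_of_eq ?_)
      rw [hCP]
      field_simp
    have hA0 : 0 ≤ κ₁ * (1 + Real.exp δ) * ((d + 1) * (κ * cs + cH))
        + (κ₂ + (a (fin D cq.1 cq.2) + c (fin D cq.1 cq.2)) * ((ℓ : ℝ) + 1) * Real.exp (δ * ((ℓ : ℝ) + 1)) * κ₁)
          * (κ * c' + (2 * c' + ((d : ℝ) + 1) * Real.exp δ * cd)) := by positivity
    have hexp : Real.exp (-(δ * Dd / nn)) ≤ EE * E6 := by
      rw [hDd, hEE, hE6]; exact exp_Dd_le hδpos.le h6δ hn1 hdist0nn d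
    have hnw := hfarW nn le_rfl
    calc s ^ (-α) * |((bX D a c hP cq hc)ᵀ *ᵥ g) x' - ((bX D a c hP cq hc)ᵀ *ᵥ g) x|
        ≤ nn ^ (-α) * (κ₁ * (1 + Real.exp δ) * ((d + 1) * (κ * cs + cH))
            + (κ₂ + (a (fin D cq.1 cq.2) + c (fin D cq.1 cq.2)) * ((ℓ : ℝ) + 1) * Real.exp (δ * ((ℓ : ℝ) + 1)) * κ₁)
              * (κ * c' + (2 * c' + ((d : ℝ) + 1) * Real.exp δ * cd)))
            * Real.exp (-(δ * Dd / nn)) * (((ℓ : ℝ) + 1) * LJ * B) := key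
      _ = (nn ^ (-α) * (((ℓ : ℝ) + 1) * LJ)) * (κ₁ * (1 + Real.exp δ) * ((d + 1) * (κ * cs + cH))
            + (κ₂ + (a (fin D cq.1 cq.2) + c (fin D cq.1 cq.2)) * ((ℓ : ℝ) + 1) * Real.exp (δ * ((ℓ : ℝ) + 1)) * κ₁)
              * (κ * c' + (2 * c' + ((d : ℝ) + 1) * Real.exp δ * cd)))
            * (Real.exp (-(δ * Dd / nn)) * B) := by ring
      _ ≤ (((ℓ : ℝ) + 1) ^ 2 * LJ ^ (1 - α)) * (CP / M) * ((EE * E6) * B) :=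
          mul_le_mul (mul_le_mul hnw hAle hA0 (by positivity)) (mul_le_mul_of_nonneg_right hexp hB0)
            (by positivity) (by positivity)
      _ = LJ ^ (1 - α) * ((((ℓ : ℝ) + 1) ^ 2 * EE * CP) / M * E6 * B) := by ring
      _ ≤ LJ ^ (1 - α) * ((((ℓ : ℝ) + 1) ^ 2 * EE * CP) / Mh * E6 * B) := by
          refine mul_le_mul_of_nonneg_left (mul_le_mul_of_nonneg_right (mul_le_mul_of_nonneg_right
            (div_le_div_of_nonneg_left (by positivity) hMh0 hMhM) hE60) hB0) hLJα0
      _ ≤ LJ ^ (1 - α)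
          * ((((ℓ : ℝ) + 1) ^ 2 * EE * CP + 2 * ((ℓ : ℝ) + 1) ^ 2 * K₇ + 1) / Mh * E6 * B) := by
          refine mul_le_mul_of_nonneg_left (mul_le_mul_of_nonneg_right (mul_le_mul_of_nonneg_right
            (div_le_div_of_nonneg_right hQ1 hMh0.le) hE60) hB0) hLJα0
  · -- FAR PAIRS: two single columns
    have hns : nn ≤ s := by push Not at hnear; exact hnear.le
    have hsw := hfarW s hns
    calc s ^ (-α) * |((bX D a c hP cq hc)ᵀ *ᵥ g) x' - ((bX D a c hP cq hc)ᵀ *ᵥ g) x|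
        ≤ s ^ (-α) * (((ℓ : ℝ) + 1) * LJ * (K₇ / Mh * Real.exp (-(δ₇ / (d + 1) * dist0)) * B)
            + ((ℓ : ℝ) + 1) * LJ * (K₇ / Mh * Real.exp (-(δ₇ / (d + 1) * dist0)) * B)) :=
          mul_le_mul_of_nonneg_left ((abs_sub _ _).trans (add_le_add hcolx' hcolx)) hW0
      _ = (s ^ (-α) * (((ℓ : ℝ) + 1) * LJ)) * (2 * (K₇ / Mh) * Real.exp (-(δ₇ / (d + 1) * dist0)) * B) := by ring
      _ ≤ (((ℓ : ℝ) + 1) ^ 2 * LJ ^ (1 - α)) * (2 * (K₇ / Mh) * E6 * B) :=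
          mul_le_mul hsw (mul_le_mul_of_nonneg_right (mul_le_mul_of_nonneg_left hE7 (by positivity)) hB0)
            (by positivity) (by positivity)
      _ = LJ ^ (1 - α) * ((2 * ((ℓ : ℝ) + 1) ^ 2 * K₇) / Mh * E6 * B) := by ring
      _ ≤ LJ ^ (1 - α)
          * ((((ℓ : ℝ) + 1) ^ 2 * EE * CP + 2 * ((ℓ : ℝ) + 1) ^ 2 * K₇ + 1) / Mh * E6 * B) := by
          refine mul_le_mul_of_nonneg_left (mul_le_mul_of_nonneg_right (mul_le_mul_of_nonneg_right
            (div_le_div_of_nonneg_right hQ2 hMh0.le) hE60) hB0) hLJα0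

end ColPair

end

end Literature.MathematicalPhysics.QuantumFieldTheory.Balaban1983to89.B6DualHolderTermMultiLevelBox
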